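import Mathlib
import Literature.Analysis.PDE.WeakBVStability
import Literature.Analysis.PDE.BurgersHopfLaxWeakSolution
import HarnessLib

/-!
# Weak–BV stability for isentropic Euler (Chen–Krupa–Vasseur 2022): proved steps of the printed
# proof

Sorry-free lemmas towards the named fact
`Literature.Analysis.PDE.chenKrupaVasseur_weakBV_isentropicEuler` of `WeakBVStability.lean`
([ChenKrupaVasseur2022, Thm 1.3 with Lemma 4.5]; numbering of arXiv:2010.04761), following the
printed proof and landing its elementary ingredients in the tree's vocabulary:

* **Lemma 4.5, Assumption 1.1 (e)** (bounded characteristic speeds): on the interior `𝒱` of the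
  state set, `|v| < C` and `c₁ρ^{(γ-1)/2} < 2C` (printed: "from (InvReg), `|v| ≤ C`, and
  `c₁ρ^{(γ−1)/2} ≤ 2C`. This shows (e)"), whence `|λ±| = |v ± √γ ρ^{(γ-1)/2}| < γC`, the density
  bound `ρ < (2C/c₁)^{2/(γ-1)}`, and boundedness of `𝒱` and `𝒰₀ = 𝒱 ∪ {0}` (the standing
  hypothesis "the set of states `𝒰₀` is supposed to be bounded" of §1, and the source of the
  uniform `L^∞` bounds in Thm 1.3).
* **Lemma 4.5, Assumption 1.1 (d)**: "`f₁` is linear in `u`, and `f₂` is convex. Hence, for any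
  vector `ℓ` …: `ℓ·f = ℓ₁f₁ + ℓ₂f₂` is convex if `ℓ₂ ≥ 0`, and concave if `ℓ₂ ≤ 0`", proved on the
  half-plane `{ρ > 0} ⊇ 𝒱`.
* **Thm 1.3, last sentence** ("Especially, `u` is unique in the class `𝒮_weak`"): for a bounded
  state set the uniqueness clause of `WeakBVStable` follows from its convergence clause applied to
  a constant sequence (`weakBVStable_of_convergence`), by `ess sup = 0 ⇒` a.e. and Fubini; hence
  `chenKrupaVasseur_weakBV_isentropicEuler` reduces to the convergence statement of Thm 1.3
  (`chenKrupaVasseur_weakBV_isentropicEuler_of_convergence`).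

* **§1, "any BV function verifies the Strong Trace Property. Hence, any BV solution to (1.1),
  (1.3) belongs to `𝒮_weak`"** (used in the proof of Thm 1.3 when it is applied "to the constant
  sequence `ū_n = u`"): one-sided limits of `BV` slices exist (componentwise Jordan
  decomposition), the traces along a Lipschitz curve are measurable in `t` (sequential limits),
  and the trace integrals of Def. 1.2 tend to `0` by dominated convergence
  (`hasStrongTraces_of_boundedVariationOn`, `InSbv.inSweak`).
* **Non-vacuity of the classes**: constant states are entropy weak solutions (Fubini and the
  fundamental theorem of calculus on `(0,∞)` against a test function), so `c ∈ 𝒪` gives a member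
  of `𝒮_BV^ε` for every `ε ≥ 0` (`inSbv_const`) and `c ∈ 𝒰₀` a member of `𝒮_weak` (`inSweak_const`).

* **§3, (3.1)** ("if `u` is a weak solution of (1.1), (1.3), then `u` verifies also the full family
  of entropy inequalities for any `b ∈ 𝒱` constant: `(η(u|b))ₜ + (q(u;b))ₓ ≤ 0`"): the relative
  entropy inequality for constant states in integral form, for a general system
  (`relEntropy_weak_ineq_const`) and for isentropic Euler (`relEntropy_weak_ineq_const_isentropicEuler`,
  with the bounds of `f, η, q` on `𝒰₀` it needs).

* **Lemma 4.5, Assumption 1.1 (c)** ("well known, see Serre"): `f, η, q` are differentiable on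
  `{ρ ≠ 0}` with the explicit derivatives `Df = [[0,1],[-v²+γρ^{γ-1}, 2v]]`,
  `∇η = (-v²/2 + γρ^{γ-1}/(γ-1), v)`, `∇q`, and **`Dq = Dη ∘ Df`** (`q' = η' f'`,
  `fderiv_isentropicEulerEntropyFlux_eq_comp`); `η` is STRICTLY convex on `{ρ > 0}`
  (`strictConvexOn_isentropicEulerEntropy`); `f, η, q ∈ C(𝒰₀)` including the vacuum
  (`continuousOn_isentropicEuler_states`).

* **Lemma 4.5, Assumption 1.1 (a), (b)**: `Df(u)` has the eigenvalues
  `λ± = v ± √γ ρ^{(γ-1)/2}` with eigenvectors `(1, λ±)`, `λ₋ < λ₊` on `{ρ > 0}`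
  (`strictHyperbolic_isentropicEuler`), and both families are genuinely nonlinear,
  `∇λ± · r± = ± √γ (γ+1)/2 ρ^{(γ-1)/2-1} ≠ 0` (`genuinelyNonlinear_isentropicEuler`).

* **§3 / Lemma 3.1 (qualitative part)**: the relative entropy
  `η(u|v) = η(u) - η(v) - ∇η(v)(u - v)` of isentropic Euler (`γ > 1`) is positive for `u ≠ v`,
  `u ∈ {ρ > 0} ∪ {vacuum}`, `ρ_v > 0` (`relEntropy_isentropicEuler_pos`; at the vacuum
  `η(0|v) = ρ_v^γ`), via the strict supporting-hyperplane inequality for strictly convex functions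
  (`strictConvexOn_lt_of_hasFDerivAt`).

* **Assumption 1.1 (c), second order, and Lemma 3.1 on convex sets**: the Hessian quadratic form
  of `η` along lines, `d²/dt² η(v+te) = (e₂ - v e₁)²/ρ + γρ^{γ-2}e₁²` (positive definite,
  `hessian_isentropicEulerEntropy_pos`), and the second-order Taylor pinching
  `λ/2 |u-v|² ≤ η(u|v) ≤ Λ/2 |u-v|²` on any convex `S ⊆ {ρ > 0}` where the Hessian form is pinched
  between `λ|e|²` and `Λ|e|²` (`relEntropy_isentropicEuler_bounds_of_hessian`).

* **Lemma 3.1 for isentropic Euler** (`relEntropy_isentropicEuler_equiv_sq`): for every compact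
  `V ⊆ 𝒱` there are `c*, c** > 0` with `c*|u-v|² ≤ η(u|v) ≤ c**|u-v|²` on `𝒰₀ × V` — explicit
  Hessian pinching on a slab around `V` (`hessian_isentropicEulerEntropy_pinching`), the
  second-order bounds near the diagonal, convexity along segments and `η(0|v) = ρ_v^γ` away
  from it.

* **Proof of Thm 1.3, §3, "the limit `ψ` is also solution to (1.1) (1.3)"**: strong
  `L^∞(0,T; L²(-R,R))` (or `L²_loc`) limits of entropy weak solutions valued in a set where
  `f, η, q` are continuous and bounded are entropy weak solutions with the limit datum
  (`isEntropyWeakSolution_of_tendsto`, `…_of_tendsto_essSup`; Markov ⇒ convergence in measure ⇒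
  a.e. subsequences ⇒ dominated convergence in the weak forms), and its isentropic Euler instance
  (`isEntropyWeakSolution_of_tendsto_isentropicEuler`, limit valued in `𝒰₀`).

* **§1, Riemann invariants** ("Those systems have Riemann invariants `w₁` and `w₂` … This provides
  naturally invariant regions as (InvReg)"): with `c₁ = 2√γ/(γ-1)` (`isentropicEulerC₁`, not
  displayed in print), `∇w_{1,2}` with `w_{1,2} = v ∓ c₁ρ^{(γ-1)/2}` are left eigenvectors of `Df`
  for `λ_{1,2} = v ∓ √γρ^{(γ-1)/2}` (`riemannInvariants_isentropicEuler`) — validating the vendored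
  constant of the state set `𝒰₀`.

Deliberately NOT here (the remaining, non-elementary part of the printed proof): Prop 3.2
(modified front tracking driven by the a-contraction shifts of the companion paper, §§5–7),
Lemma 2.6 (Aubin–Lions limit inheriting the Bounded Variation Condition), Thm 2.3
(Bressan–Lewicka uniqueness under the Bounded Variation Condition), and Assumption 1.1 (f)–(k)
for isentropic Euler (shock curves, Lax/Liu admissibility, "the shock strengthens"; cited in print
to Leger–Vasseur 2011).

## References

* G. Chen, S. G. Krupa, A. F. Vasseur, *Uniqueness and weak-BV stability for `2 × 2`
  conservation laws*, Arch. Ration. Mech. Anal. 246 (2022) 299–332; arXiv:2010.04761, §1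
  (Thm 1.3), §3 (proof of Thm 1.3 from Prop 3.2), §4 Lemma 4.5 [ChenKrupaVasseur2022].
-/

noncomputable section

open MeasureTheory Set Filter Bornology
open scoped Topology ENNReal

namespace Literature.Analysis.PDE

variable {n : ℕ} {γ C : ℝ}

/-! ## Lemma 4.5 (e): bounds on the interior `𝒱` of the state set -/

/-- The Riemann-invariant constant `c₁ = 2√γ/(γ-1)` is positive for `γ > 1`. [folklore] -/
theorem isentropicEulerC₁_pos (hγ : 1 < γ) : 0 < isentropicEulerC₁ γ :=
  div_pos (mul_pos two_pos (Real.sqrt_pos.2 (by linarith))) (by linarith)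

/-- Proof of Lemma 4.5, Assumption 1.1 (e): on `𝒱`, "from (InvReg), `|v| ≤ C`, and
`c₁ρ^{(γ−1)/2} ≤ 2C`" (both in fact strict). [cite: ChenKrupaVasseur2022, Lemma 4.5 (proof)] -/
theorem abs_vel_lt_of_mem_isentropicEulerInterior (hγ : 1 < γ) {u : Fin 2 → ℝ}
    (hu : u ∈ isentropicEulerInterior γ C) :
    |u 1 / u 0| < C ∧ isentropicEulerC₁ γ * (u 0) ^ ((γ - 1) / 2) < 2 * C := by
  obtain ⟨hρ, h1, h2⟩ := hu
  have hc : 0 < isentropicEulerC₁ γ * (u 0) ^ ((γ - 1) / 2) :=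
    mul_pos (isentropicEulerC₁_pos hγ) (Real.rpow_pos_of_pos hρ _)
  exact ⟨abs_lt.2 ⟨by linarith, by linarith⟩, by linarith⟩

/-- Lemma 4.5, Assumption 1.1 (e) with an explicit constant: the characteristic speeds
`λ∓ = v ∓ √γ ρ^{(γ-1)/2}` of the isentropic Euler system ("the eigenvalues of `f'` are given by the
formula `λ± = v ± √(γρ^{γ−1})`") satisfy `|λ∓| < γC` on `𝒱` (`√γ ρ^{(γ-1)/2} = ((γ-1)/2) c₁ρ^{(γ-1)/2}
< (γ-1)C` and `|v| < C`). [cite: ChenKrupaVasseur2022, Lemma 4.5 (proof)] -/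
theorem abs_charSpeed_lt_of_mem_isentropicEulerInterior (hγ : 1 < γ) {u : Fin 2 → ℝ}
    (hu : u ∈ isentropicEulerInterior γ C) :
    |u 1 / u 0 - Real.sqrt γ * (u 0) ^ ((γ - 1) / 2)| < γ * C ∧
      |u 1 / u 0 + Real.sqrt γ * (u 0) ^ ((γ - 1) / 2)| < γ * C := by
  obtain ⟨hv, hc⟩ := abs_vel_lt_of_mem_isentropicEulerInterior hγ hu
  have hγ1 : γ - 1 ≠ 0 := by linarith
  have hs : Real.sqrt γ * (u 0) ^ ((γ - 1) / 2)
      = (γ - 1) / 2 * (isentropicEulerC₁ γ * (u 0) ^ ((γ - 1) / 2)) := by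
    unfold isentropicEulerC₁
    field_simp
  have hpos : 0 ≤ Real.sqrt γ * (u 0) ^ ((γ - 1) / 2) :=
    mul_nonneg (Real.sqrt_nonneg _) (Real.rpow_nonneg hu.1.le _)
  have hlt : Real.sqrt γ * (u 0) ^ ((γ - 1) / 2) < (γ - 1) * C := by
    rw [hs]; nlinarith
  rw [abs_lt] at hv
  constructor <;> rw [abs_lt] <;> constructor <;> nlinarith

/-- Density bound on `𝒱`: `ρ < (2C/c₁)^{2/(γ-1)}` (from `c₁ρ^{(γ-1)/2} < 2C`).
[cite: ChenKrupaVasseur2022, Lemma 4.5 (proof)] -/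
theorem density_lt_of_mem_isentropicEulerInterior (hγ : 1 < γ) {u : Fin 2 → ℝ}
    (hu : u ∈ isentropicEulerInterior γ C) :
    u 0 < (2 * C / isentropicEulerC₁ γ) ^ (2 / (γ - 1)) := by
  have hρ : 0 < u 0 := hu.1
  have hc₁ := isentropicEulerC₁_pos hγ
  have hγ1 : γ - 1 ≠ 0 := by linarith
  have hlt : (u 0) ^ ((γ - 1) / 2) < 2 * C / isentropicEulerC₁ γ := by
    rw [lt_div_iff₀ hc₁, mul_comm]
    exact (abs_vel_lt_of_mem_isentropicEulerInterior hγ hu).2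
  have hid : u 0 = ((u 0) ^ ((γ - 1) / 2)) ^ (2 / (γ - 1)) := by
    rw [← Real.rpow_mul hρ.le]
    have : (γ - 1) / 2 * (2 / (γ - 1)) = 1 := by field_simp
    rw [this, Real.rpow_one]
  calc u 0 = ((u 0) ^ ((γ - 1) / 2)) ^ (2 / (γ - 1)) := hid
    _ < (2 * C / isentropicEulerC₁ γ) ^ (2 / (γ - 1)) :=
        Real.rpow_lt_rpow (Real.rpow_nonneg hρ.le _) hlt (div_pos two_pos (by linarith))

/-- Sup-norm bound on `𝒱`: `‖(ρ, ρv)‖ ≤ (2C/c₁)^{2/(γ-1)} (1 + C)` (from `ρ < (2C/c₁)^{2/(γ-1)}` and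
`|v| < C`). [cite: ChenKrupaVasseur2022, Lemma 4.5 (proof)] -/
theorem norm_le_of_mem_isentropicEulerInterior (hγ : 1 < γ) (hC : 0 < C) {u : Fin 2 → ℝ}
    (hu : u ∈ isentropicEulerInterior γ C) :
    ‖u‖ ≤ (2 * C / isentropicEulerC₁ γ) ^ (2 / (γ - 1)) * (1 + C) := by
  set B := (2 * C / isentropicEulerC₁ γ) ^ (2 / (γ - 1)) with hB
  have hBpos : 0 < B :=
    Real.rpow_pos_of_pos (div_pos (by linarith) (isentropicEulerC₁_pos hγ)) _
  have hρ : 0 < u 0 := hu.1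
  have hρB : u 0 < B := density_lt_of_mem_isentropicEulerInterior hγ hu
  have hv : |u 1 / u 0| < C := (abs_vel_lt_of_mem_isentropicEulerInterior hγ hu).1
  refine (pi_norm_le_iff_of_nonneg (by positivity)).2 (Fin.forall_fin_two.2 ⟨?_, ?_⟩)
  · rw [Real.norm_eq_abs, abs_of_pos hρ]
    nlinarith
  · have h1 : u 1 = u 0 * (u 1 / u 0) := by field_simp
    rw [Real.norm_eq_abs, h1, abs_mul, abs_of_pos hρ]
    nlinarith [abs_nonneg (u 1 / u 0)]

/-- For `C ≤ 0` the interior `𝒱` is empty (`-C + c₁ρ^θ < v < C - c₁ρ^θ` forces `C > 0`).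
[cite: ChenKrupaVasseur2022, §1 state set (invariant region)] -/
theorem isentropicEulerInterior_eq_empty (hγ : 1 < γ) (hC : C ≤ 0) :
    isentropicEulerInterior γ C = ∅ := by
  ext u
  simp only [mem_empty_iff_false, iff_false]
  intro hu
  have := abs_vel_lt_of_mem_isentropicEulerInterior hγ hu
  have hc : 0 < isentropicEulerC₁ γ * (u 0) ^ ((γ - 1) / 2) :=
    mul_pos (isentropicEulerC₁_pos hγ) (Real.rpow_pos_of_pos hu.1 _)
  linarith [this.2]

/-- `𝒱` is bounded ("the set of states `𝒰₀` is supposed to be bounded, and we denote `𝒱` its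
interior", §1; here a consequence of Lemma 4.5 (e)). [cite: ChenKrupaVasseur2022, Lemma 4.5] -/
theorem isBounded_isentropicEulerInterior (hγ : 1 < γ) :
    IsBounded (isentropicEulerInterior γ C) := by
  rcases le_or_gt C 0 with hC | hC
  · rw [isentropicEulerInterior_eq_empty hγ hC]; exact isBounded_empty
  · exact isBounded_iff_forall_norm_le.2
      ⟨_, fun u hu => norm_le_of_mem_isentropicEulerInterior hγ hC hu⟩

/-- `𝒰₀ = 𝒱 ∪ {0}` is bounded. [cite: ChenKrupaVasseur2022, §1 and Lemma 4.5] -/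
theorem isBounded_isentropicEulerStates (hγ : 1 < γ) :
    IsBounded (isentropicEulerStates γ C) :=
  (isBounded_isentropicEulerInterior hγ).union isBounded_singleton

/-! ## Lemma 4.5 (d): convexity of `ℓ · f` -/

/-- The half-plane `{ρ > 0}` of conservative states is convex. [folklore] -/
theorem convex_posDensity : Convex ℝ {u : Fin 2 → ℝ | 0 < u 0} :=
  convex_halfSpace_gt (LinearMap.proj (R := ℝ) (φ := fun _ : Fin 2 => ℝ) 0).isLinear 0

/-- "`f₂` is convex": the quadratic-over-linear part `u ↦ u₂²/u₁` of the momentum flux is convex on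
`{u₁ > 0}` (`(a x₁ + b y₁)² (…) ≤ (a x₁²/x₀ + b y₁²/y₀)(a x₀ + b y₀)` by Cauchy–Schwarz).
[cite: ChenKrupaVasseur2022, Lemma 4.5 (proof)] -/
theorem convexOn_sq_div_posDensity :
    ConvexOn ℝ {u : Fin 2 → ℝ | 0 < u 0} (fun u => u 1 ^ 2 / u 0) := by
  refine ⟨convex_posDensity, ?_⟩
  intro x hx y hy a b ha hb hab
  have hx0 : 0 < x 0 := hx
  have hy0 : 0 < y 0 := hy
  simp only [smul_eq_mul, Pi.add_apply, Pi.smul_apply]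
  set p := x 1 ^ 2 / x 0 with hp
  set q := y 1 ^ 2 / y 0 with hq
  have hpx : p * x 0 = x 1 ^ 2 := by rw [hp]; field_simp
  have hqy : q * y 0 = y 1 ^ 2 := by rw [hq]; field_simp
  have hp0 : 0 ≤ p := by positivity
  have hq0 : 0 ≤ q := by positivity
  have hden : 0 < a * x 0 + b * y 0 := by
    rcases ha.eq_or_lt with rfl | ha'
    · simp only [zero_add] at hab; subst hab; simpa using hy0
    · nlinarith [mul_nonneg hb hy0.le]
  -- key: 2 x₁ y₁ ≤ p y₀ + q x₀  (⇔ (x₁y₀ - y₁x₀)² ≥ 0 after multiplying by x₀y₀ > 0)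
  have key : 2 * x 1 * y 1 ≤ p * y 0 + q * x 0 := by
    have hxy : 0 < x 0 * y 0 := mul_pos hx0 hy0
    have : 2 * x 1 * y 1 * (x 0 * y 0) ≤ (p * y 0 + q * x 0) * (x 0 * y 0) := by
      have e : (p * y 0 + q * x 0) * (x 0 * y 0) = x 1 ^ 2 * y 0 ^ 2 + y 1 ^ 2 * x 0 ^ 2 := by
        nlinarith [hpx, hqy]
      rw [e]; nlinarith [sq_nonneg (x 1 * y 0 - y 1 * x 0)]
    exact le_of_mul_le_mul_right this hxy
  rw [div_le_iff₀ hden]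
  nlinarith [mul_nonneg ha hb, key, hpx, hqy, sq_nonneg a, sq_nonneg b]

/-- `u ↦ ρ^γ = u₁^γ` is convex on `{u₁ > 0}` for `γ ≥ 1`. [folklore] -/
theorem convexOn_rpow_posDensity (hγ : 1 ≤ γ) :
    ConvexOn ℝ {u : Fin 2 → ℝ | 0 < u 0} (fun u => (u 0) ^ γ) := by
  have h := (convexOn_rpow hγ).comp_linearMap
    (LinearMap.proj (R := ℝ) (φ := fun _ : Fin 2 => ℝ) 0)
  refine h.subset (fun u hu => ?_) convex_posDensity
  exact le_of_lt (show 0 < u 0 from hu)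

/-- "`f₂` is convex": the momentum flux `f₂(u) = u₂²/u₁ + u₁^γ` of the isentropic Euler system is
convex on `{u₁ > 0}` for `γ ≥ 1`. [cite: ChenKrupaVasseur2022, Lemma 4.5 (proof)] -/
theorem convexOn_isentropicEulerFlux_one (hγ : 1 ≤ γ) :
    ConvexOn ℝ {u : Fin 2 → ℝ | 0 < u 0} (fun u => isentropicEulerFlux γ u 1) := by
  refine ((convexOn_sq_div_posDensity).add (convexOn_rpow_posDensity hγ)).congr ?_
  intro u _
  simp [isentropicEulerFlux]

/-- "`f₁` is linear in `u`": the mass flux `f₁(u) = u₂` is convex … [folklore] -/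
theorem convexOn_isentropicEulerFlux_zero (γ : ℝ) :
    ConvexOn ℝ {u : Fin 2 → ℝ | 0 < u 0} (fun u => isentropicEulerFlux γ u 0) := by
  have h := (LinearMap.proj (R := ℝ) (φ := fun _ : Fin 2 => ℝ) 1).convexOn convex_posDensity
  simpa [isentropicEulerFlux] using h

/-- … and concave on `{u₁ > 0}`. [folklore] -/
theorem concaveOn_isentropicEulerFlux_zero (γ : ℝ) :
    ConcaveOn ℝ {u : Fin 2 → ℝ | 0 < u 0} (fun u => isentropicEulerFlux γ u 0) := by
  have h := (LinearMap.proj (R := ℝ) (φ := fun _ : Fin 2 => ℝ) 1).concaveOn convex_posDensity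
  simpa [isentropicEulerFlux] using h

/-- **Lemma 4.5, Assumption 1.1 (d), convex case**: for any vector `ℓ` with `ℓ₂ ≥ 0`,
`u ↦ ℓ · f(u) = ℓ₁f₁(u) + ℓ₂f₂(u)` is convex on `{ρ > 0} ⊇ 𝒱` (`γ ≥ 1`).
[cite: ChenKrupaVasseur2022, Lemma 4.5 (proof)] -/
theorem convexOn_dotProduct_isentropicEulerFlux (hγ : 1 ≤ γ) {ℓ : Fin 2 → ℝ} (hℓ : 0 ≤ ℓ 1) :
    ConvexOn ℝ {u : Fin 2 → ℝ | 0 < u 0} (fun u => ℓ ⬝ᵥ isentropicEulerFlux γ u) := by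
  have h0 : ConvexOn ℝ {u : Fin 2 → ℝ | 0 < u 0} (fun u => ℓ 0 * isentropicEulerFlux γ u 0) := by
    refine (((ℓ 0) • (LinearMap.proj (R := ℝ) (φ := fun _ : Fin 2 => ℝ) 1)).convexOn
      convex_posDensity).congr ?_
    intro u _
    simp [isentropicEulerFlux]
  have h1 : ConvexOn ℝ {u : Fin 2 → ℝ | 0 < u 0} (fun u => ℓ 1 * isentropicEulerFlux γ u 1) :=
    (convexOn_isentropicEulerFlux_one hγ).smul hℓ
  refine (h0.add h1).congr ?_
  intro u _
  simp [dotProduct, Fin.sum_univ_two]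

/-- **Lemma 4.5, Assumption 1.1 (d), concave case**: for any vector `ℓ` with `ℓ₂ ≤ 0`,
`u ↦ ℓ · f(u)` is concave on `{ρ > 0} ⊇ 𝒱` (`γ ≥ 1`).
[cite: ChenKrupaVasseur2022, Lemma 4.5 (proof)] -/
theorem concaveOn_dotProduct_isentropicEulerFlux (hγ : 1 ≤ γ) {ℓ : Fin 2 → ℝ} (hℓ : ℓ 1 ≤ 0) :
    ConcaveOn ℝ {u : Fin 2 → ℝ | 0 < u 0} (fun u => ℓ ⬝ᵥ isentropicEulerFlux γ u) := by
  have h0 : ConcaveOn ℝ {u : Fin 2 → ℝ | 0 < u 0} (fun u => ℓ 0 * isentropicEulerFlux γ u 0) := by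
    refine (((ℓ 0) • (LinearMap.proj (R := ℝ) (φ := fun _ : Fin 2 => ℝ) 1)).concaveOn
      convex_posDensity).congr ?_
    intro u _
    simp [isentropicEulerFlux]
  have h1 : ConcaveOn ℝ {u : Fin 2 → ℝ | 0 < u 0} (fun u => ℓ 1 * isentropicEulerFlux γ u 1) := by
    have h := ((convexOn_isentropicEulerFlux_one hγ).neg.smul (neg_nonneg.2 hℓ))
    refine h.congr ?_  -- (-ℓ 1) • (-f₂) = ℓ 1 * f₂
    intro u _
    simp [smul_eq_mul]
  refine (h0.add h1).congr ?_
  intro u _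
  simp [dotProduct, Fin.sum_univ_two]

/-! ## Thm 1.3, last sentence: uniqueness in `𝒮_weak` from the convergence statement -/

/-- Measure-theoretic core of "Especially, `u` is unique in the class `𝒮_weak`": if
`ess sup_{t ∈ (0,T)} ∫_{(-R,R)} |v - u|² = 0` for all `T, R > 0` and `u, v` are jointly measurable,
then `v = u` a.e. on `{t > 0}`. [folklore] -/
theorem ae_eq_of_essSup_lintegral_sq_eq_zero {u v : ℝ → ℝ → Fin n → ℝ}
    (hu : Measurable (Function.uncurry u)) (hv : Measurable (Function.uncurry v))
    (h : ∀ T R : ℝ, 0 < T → 0 < R →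
      essSup (fun t => ∫⁻ x in Ioo (-R) R, ‖v t x - u t x‖ₑ ^ 2) (volume.restrict (Ioo 0 T))
        = 0) :
    ∀ᵐ p : ℝ × ℝ, 0 < p.1 → v p.1 p.2 = u p.1 p.2 := by
  -- slices are measurable
  have hsl : ∀ t : ℝ, Measurable fun x => ‖v t x - u t x‖ₑ ^ 2 := fun t =>
    ((hv.comp measurable_prodMk_left).sub (hu.comp measurable_prodMk_left)).enorm.pow_const _
  -- for each `N`, a.e. `t ∈ (0,N+1)`, a.e. `x ∈ (-(N+1), N+1)`: `v t x = u t x`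
  have hN : ∀ N : ℕ, ∀ᵐ t : ℝ, t ∈ Ioo (0 : ℝ) (N + 1) →
      ∀ᵐ x : ℝ, x ∈ Ioo (-((N : ℝ) + 1)) (N + 1) → v t x = u t x := by
    intro N
    have hT : (0 : ℝ) < N + 1 := by positivity
    have h0 := h (N + 1) (N + 1) hT hT
    rw [ENNReal.essSup_eq_zero_iff] at h0
    have h1 := (ae_restrict_iff' (μ := volume) measurableSet_Ioo).1 h0
    filter_upwards [h1] with t ht htI
    have h2 : (fun x => ‖v t x - u t x‖ₑ ^ 2) =ᵐ[volume.restrict (Ioo (-((N : ℝ) + 1)) (N + 1))]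
        0 := (lintegral_eq_zero_iff (hsl t)).1 (ht htI)
    have h3 := (ae_restrict_iff' (μ := volume) measurableSet_Ioo).1 h2
    filter_upwards [h3] with x hx hxI
    have := hx hxI
    simp only [Pi.zero_apply, pow_eq_zero_iff, ne_eq, OfNat.ofNat_ne_zero, not_false_eq_true,
      enorm_eq_zero, sub_eq_zero] at this
    exact this
  rw [← ae_all_iff] at hN
  -- iterated a.e. statement
  have hiter : ∀ᵐ t : ℝ, 0 < t → ∀ᵐ x : ℝ, v t x = u t x := by
    filter_upwards [hN] with t ht ht0
    have ht' : ∀ N : ℕ, ∀ᵐ x : ℝ, t < (N : ℝ) + 1 →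
        x ∈ Ioo (-((N : ℝ) + 1)) (N + 1) → v t x = u t x := by
      intro N
      by_cases htN : t < (N : ℝ) + 1
      · filter_upwards [ht N ⟨ht0, htN⟩] with x hx _ hxI using hx hxI
      · exact Eventually.of_forall fun x h _ => absurd h htN
    rw [← ae_all_iff] at ht'
    filter_upwards [ht'] with x hx
    obtain ⟨N, hN⟩ := exists_nat_gt (max t |x|)
    have htN : t < (N : ℝ) + 1 := by
      have := le_max_left t |x|; linarith
    have hxN : x ∈ Ioo (-((N : ℝ) + 1)) (N + 1) := by
      have h1 := le_max_right t |x|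
      have h2 := abs_lt.1 (show |x| < (N : ℝ) + 1 by linarith)
      exact ⟨h2.1, h2.2⟩
    exact hx N htN hxN
  -- pass to the product measure
  have hs : MeasurableSet {p : ℝ × ℝ | 0 < p.1 → v p.1 p.2 = u p.1 p.2} := by
    have h1 : MeasurableSet {p : ℝ × ℝ | 0 < p.1} :=
      measurableSet_lt measurable_const measurable_fst
    have h2 : MeasurableSet {p : ℝ × ℝ | Function.uncurry v p = Function.uncurry u p} :=
      measurableSet_eq_fun hv hu
    have : {p : ℝ × ℝ | 0 < p.1 → v p.1 p.2 = u p.1 p.2}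
        = {p : ℝ × ℝ | 0 < p.1}ᶜ ∪ {p | Function.uncurry v p = Function.uncurry u p} := by
      ext p; simp only [mem_setOf_eq, mem_union, mem_compl_iff]
      constructor
      · intro h; by_cases hp : 0 < p.1
        · exact Or.inr (h hp)
        · exact Or.inl hp
      · rintro (h | h) hp
        · exact absurd hp h
        · exact h
    rw [this]; exact h1.compl.union h2
  have hprod : ∀ᵐ p : ℝ × ℝ ∂(volume.prod volume), p ∈ {p : ℝ × ℝ | 0 < p.1 → v p.1 p.2 = u p.1 p.2} := by
    rw [Measure.ae_prod_mem_iff_ae_ae_mem hs]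
    filter_upwards [hiter] with t ht
    by_cases ht0 : 0 < t
    · filter_upwards [ht ht0] with x hx _ using hx
    · exact Eventually.of_forall fun x h => absurd h ht0
  rw [Measure.volume_eq_prod]
  exact hprod

/-- **Thm 1.3, last sentence.** For a system with a BOUNDED state set `𝒰₀` (the standing
hypothesis of §1), the uniqueness clause of `WeakBVStable` follows from its convergence clause:
given `u ∈ 𝒮_BV^ε` with datum `u⁰` and a competitor `v ∈ 𝒮_weak` with the same datum, apply the
convergence statement to the constant sequence `u_n = v` ("Applying the result to the constant
sequence …", proof of Thm 1.3, §3): `ess sup_{(0,T)} ‖v - u‖²_{L²(-R,R)} → 0` for a constant sequence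
means it vanishes, so `v = u` a.e. on `{t > 0}`. [cite: ChenKrupaVasseur2022, Thm 1.3 (proof, §3)] -/
theorem weakBVStable_of_convergence {f : (Fin n → ℝ) → (Fin n → ℝ)} {η q : (Fin n → ℝ) → ℝ}
    {U₀ V : Set (Fin n → ℝ)} (hU₀ : IsBounded U₀)
    (h : ∀ O : Set (Fin n → ℝ), IsOpen O → closure O ⊆ V →
      ∃ ε > (0 : ℝ), ∀ (u₀ : ℝ → Fin n → ℝ) (u : ℝ → ℝ → Fin n → ℝ), InSbv f η q O ε u₀ u →
        ∀ (v₀ : ℕ → ℝ → Fin n → ℝ) (v : ℕ → ℝ → ℝ → Fin n → ℝ),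
          (∀ k, InSweak f η q U₀ (v₀ k) (v k)) →
          (∃ M : ℝ, ∀ k t x, 0 ≤ t → ‖v k t x‖ ≤ M) →
          Tendsto (fun k => ∫⁻ x, ‖v₀ k x - u₀ x‖ₑ ^ 2) atTop (𝓝 0) →
          ∀ T R : ℝ, 0 < T → 0 < R →
            Tendsto (fun k => essSup (fun t => ∫⁻ x in Ioo (-R) R, ‖v k t x - u t x‖ₑ ^ 2)
              (volume.restrict (Ioo 0 T))) atTop (𝓝 0)) :
    WeakBVStable f η q U₀ V := by
  intro O hO hOV
  obtain ⟨ε, hε, hstab⟩ := h O hO hOV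
  refine ⟨ε, hε, fun u₀ u hu => ⟨hstab u₀ u hu, fun v hv => ?_⟩⟩
  obtain ⟨M, hM⟩ := hU₀.exists_norm_le
  have hbound : ∃ M : ℝ, ∀ (k : ℕ) (t x : ℝ), 0 ≤ t → ‖(fun _ : ℕ => v) k t x‖ ≤ M :=
    ⟨M, fun _ t x ht => hM _ (hv.2.2.1 t x ht)⟩
  have hdata : Tendsto (fun k : ℕ => ∫⁻ x, ‖(fun _ : ℕ => u₀) k x - u₀ x‖ₑ ^ 2) atTop (𝓝 0) := by
    simp
  have hconv := hstab u₀ u hu (fun _ => u₀) (fun _ => v) (fun _ => hv) hbound hdata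
  refine ae_eq_of_essSup_lintegral_sq_eq_zero hu.1 hv.1 fun T R hT hR => ?_
  exact tendsto_const_nhds_iff.1 (hconv T R hT hR)

/-- The named fact `chenKrupaVasseur_weakBV_isentropicEuler` reduces to the convergence statement
of Thm 1.3 for the isentropic Euler system (its uniqueness clause is then automatic, `𝒰₀` being
bounded by Lemma 4.5 (e)). [cite: ChenKrupaVasseur2022, Thm 1.3 (proof, §3) and Lemma 4.5] -/
theorem chenKrupaVasseur_weakBV_isentropicEuler_of_convergence
    (h : ∀ γ C : ℝ, 1 < γ → 0 < C → ∀ O : Set (Fin 2 → ℝ), IsOpen O →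
      closure O ⊆ isentropicEulerInterior γ C →
      ∃ ε > (0 : ℝ), ∀ (u₀ : ℝ → Fin 2 → ℝ) (u : ℝ → ℝ → Fin 2 → ℝ),
        InSbv (isentropicEulerFlux γ) (isentropicEulerEntropy γ) (isentropicEulerEntropyFlux γ)
          O ε u₀ u →
        ∀ (v₀ : ℕ → ℝ → Fin 2 → ℝ) (v : ℕ → ℝ → ℝ → Fin 2 → ℝ),
          (∀ k, InSweak (isentropicEulerFlux γ) (isentropicEulerEntropy γ)
            (isentropicEulerEntropyFlux γ) (isentropicEulerStates γ C) (v₀ k) (v k)) →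
          (∃ M : ℝ, ∀ k t x, 0 ≤ t → ‖v k t x‖ ≤ M) →
          Tendsto (fun k => ∫⁻ x, ‖v₀ k x - u₀ x‖ₑ ^ 2) atTop (𝓝 0) →
          ∀ T R : ℝ, 0 < T → 0 < R →
            Tendsto (fun k => essSup (fun t => ∫⁻ x in Ioo (-R) R, ‖v k t x - u t x‖ₑ ^ 2)
              (volume.restrict (Ioo 0 T))) atTop (𝓝 0)) :
    chenKrupaVasseur_weakBV_isentropicEuler :=
  fun γ C hγ hC => weakBVStable_of_convergence (isBounded_isentropicEulerStates hγ) (h γ C hγ hC)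

/-! ## §1: BV solutions have strong traces, hence `𝒮_BV^ε ⊆ 𝒮_weak` -/

/-- A function `ℝ → ℝⁿ` of bounded variation has a limit from the right at every point
(componentwise Jordan decomposition into monotone functions, which have one-sided limits).
[folklore] -/
theorem exists_tendsto_nhdsGT_of_boundedVariationOn {g : ℝ → Fin n → ℝ}
    (hg : BoundedVariationOn g univ) (x : ℝ) : ∃ L : Fin n → ℝ, Tendsto g (𝓝[>] x) (𝓝 L) := by
  have hcomp : ∀ i : Fin n, ∃ l : ℝ, Tendsto (fun y => g y i) (𝓝[>] x) (𝓝 l) := by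
    intro i
    have hgi : LocallyBoundedVariationOn (fun y => g y i) univ :=
      ((LipschitzWith.eval (α := fun _ : Fin n => ℝ) i).comp_boundedVariationOn
        hg).locallyBoundedVariationOn
    obtain ⟨p, q, hp, hq, hpq⟩ := hgi.exists_monotoneOn_sub_monotoneOn
    have hp' : Monotone p := fun a b hab => hp (mem_univ a) (mem_univ b) hab
    have hq' : Monotone q := fun a b hab => hq (mem_univ a) (mem_univ b) hab
    refine ⟨sInf (p '' Ioi x) - sInf (q '' Ioi x), ?_⟩
    rw [hpq]
    exact (hp'.tendsto_nhdsGT x).sub (hq'.tendsto_nhdsGT x)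
  choose l hl using hcomp
  exact ⟨fun i => l i, tendsto_pi_nhds.2 hl⟩

/-- A function `ℝ → ℝⁿ` of bounded variation has a limit from the left at every point.
[folklore] -/
theorem exists_tendsto_nhdsLT_of_boundedVariationOn {g : ℝ → Fin n → ℝ}
    (hg : BoundedVariationOn g univ) (x : ℝ) : ∃ L : Fin n → ℝ, Tendsto g (𝓝[<] x) (𝓝 L) := by
  have hcomp : ∀ i : Fin n, ∃ l : ℝ, Tendsto (fun y => g y i) (𝓝[<] x) (𝓝 l) := by
    intro i
    have hgi : LocallyBoundedVariationOn (fun y => g y i) univ :=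
      ((LipschitzWith.eval (α := fun _ : Fin n => ℝ) i).comp_boundedVariationOn
        hg).locallyBoundedVariationOn
    obtain ⟨p, q, hp, hq, hpq⟩ := hgi.exists_monotoneOn_sub_monotoneOn
    have hp' : Monotone p := fun a b hab => hp (mem_univ a) (mem_univ b) hab
    have hq' : Monotone q := fun a b hab => hq (mem_univ a) (mem_univ b) hab
    refine ⟨sSup (p '' Iio x) - sSup (q '' Iio x), ?_⟩
    rw [hpq]
    exact (hp'.tendsto_nhdsLT x).sub (hq'.tendsto_nhdsLT x)
  choose l hl using hcomp
  exact ⟨fun i => l i, tendsto_pi_nhds.2 hl⟩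

/-- Dominated-convergence step of Def. 1.2: if the slices `u(t,·)`, `t ≥ 0`, and the candidate
trace `w` are bounded by `M`, and for every `t > 0` the values `u(t, X(t)+y)`, `y ∈ S_k`, approach
`w(t)` uniformly as `k → ∞`, then `∫₀ᵀ ess sup_{y ∈ S_k} |u(t,X(t)+y) - w(t)| dt → 0` (the integrand
need not be measurable in `t`: it is replaced by a measurable minorant with the same integral).
[folklore] -/
theorem tendsto_lintegral_essSup_enorm_sub {u : ℝ → ℝ → Fin n → ℝ} {X : ℝ → ℝ}
    {w : ℝ → Fin n → ℝ} {M : ℝ} (S : ℕ → Set ℝ)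
    (hbdd : ∀ t x, 0 ≤ t → ‖u t x‖ ≤ M) (hw : ∀ t, 0 ≤ t → ‖w t‖ ≤ M)
    (hlim : ∀ t, 0 < t → ∀ ε : ℝ≥0∞, 0 < ε → ∃ N : ℕ, ∀ k ≥ N, ∀ y ∈ S k,
      ‖u t (X t + y) - w t‖ₑ ≤ ε)
    (hS : ∀ k, MeasurableSet (S k)) (T : ℝ) :
    Tendsto (fun k : ℕ => ∫⁻ t in Ioo 0 T,
        essSup (fun y => ‖u t (X t + y) - w t‖ₑ) (volume.restrict (S k))) atTop (𝓝 0) := by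
  set F : ℕ → ℝ → ℝ≥0∞ := fun k t =>
    essSup (fun y => ‖u t (X t + y) - w t‖ₑ) (volume.restrict (S k)) with hF
  set μ : Measure ℝ := volume.restrict (Ioo 0 T) with hμ
  -- pointwise bound
  have hFbd : ∀ k t, 0 ≤ t → F k t ≤ ENNReal.ofReal M + ENNReal.ofReal M := by
    intro k t ht
    refine essSup_le_of_ae_le _ (Eventually.of_forall fun y => ?_)
    calc ‖u t (X t + y) - w t‖ₑ ≤ ‖u t (X t + y)‖ₑ + ‖w t‖ₑ := enorm_sub_le
      _ ≤ ENNReal.ofReal M + ENNReal.ofReal M := by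
        rw [← ofReal_norm, ← ofReal_norm]
        exact add_le_add (ENNReal.ofReal_le_ofReal (hbdd t _ ht))
          (ENNReal.ofReal_le_ofReal (hw t ht))
  -- pointwise limit
  have hFlim : ∀ t, 0 < t → Tendsto (fun k => F k t) atTop (𝓝 0) := by
    intro t ht
    rw [ENNReal.tendsto_atTop_zero]
    intro ε hε
    obtain ⟨N, hN⟩ := hlim t ht ε hε
    refine ⟨N, fun k hk => essSup_le_of_ae_le _ ?_⟩
    filter_upwards [ae_restrict_mem (hS k)] with y hy using hN k hk y hy
  -- measurable minorants with the same integrals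
  have hg : ∀ k, ∃ g : ℝ → ℝ≥0∞, Measurable g ∧ g ≤ F k ∧ ∫⁻ t, F k t ∂μ = ∫⁻ t, g t ∂μ :=
    fun k => exists_measurable_le_lintegral_eq μ (F k)
  choose g hgm hgle hgeq using hg
  have hae : ∀ᵐ t ∂μ, t ∈ Ioo 0 T := ae_restrict_mem measurableSet_Ioo
  have hfin : ∫⁻ _ : ℝ, ENNReal.ofReal M + ENNReal.ofReal M ∂μ ≠ ∞ := by
    rw [lintegral_const, hμ, Measure.restrict_apply_univ, Real.volume_Ioo]
    exact ENNReal.mul_ne_top (by simp) ENNReal.ofReal_ne_top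
  have key := tendsto_lintegral_of_dominated_convergence (μ := μ) (F := g) (f := fun _ => 0)
    (fun _ => ENNReal.ofReal M + ENNReal.ofReal M) hgm
    (fun k => hae.mono fun t ht => (hgle k t).trans (hFbd k t ht.1.le)) hfin
    (hae.mono fun t ht => tendsto_of_tendsto_of_tendsto_of_le_of_le tendsto_const_nhds
      (hFlim t ht.1) (fun k => zero_le) (fun k => hgle k t))
  rw [lintegral_zero] at key
  have hrw : (fun k : ℕ => ∫⁻ t in Ioo 0 T, F k t) = fun k => ∫⁻ t, g k t ∂μ :=
    funext fun k => hgeq k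
  show Tendsto (fun k : ℕ => ∫⁻ t in Ioo 0 T, F k t) atTop (𝓝 0)
  rw [hrw]
  exact key

/-- **"Any BV function verifies the Strong Trace Property"** (§1, before Thm 1.4), in the form
needed for `𝒮_BV^ε ⊆ 𝒮_weak`: a jointly measurable `u` whose slices `u(t,·)`, `t ≥ 0`, have
bounded variation on `ℝ` and are uniformly bounded has strong traces (Def. 1.2) along every
Lipschitz curve `X`, namely the one-sided limits `u(t, X(t)±)`.
[cite: ChenKrupaVasseur2022, §1 (remark before Thm 1.4)] -/
theorem hasStrongTraces_of_boundedVariationOn {u : ℝ → ℝ → Fin n → ℝ}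
    (hmeas : Measurable (Function.uncurry u))
    (hbv : ∀ t, 0 ≤ t → BoundedVariationOn (u t) univ)
    {M : ℝ} (hbdd : ∀ t x, 0 ≤ t → ‖u t x‖ ≤ M) :
    HasStrongTraces u := by
  classical
  intro X hX
  obtain ⟨K, hK⟩ := hX
  have hXc : Continuous X := hK.continuous
  have hM0 : 0 ≤ M := (norm_nonneg _).trans (hbdd 0 0 le_rfl)
  -- one-sided limits along the curve (junk value `0` for `t < 0`)
  have hRex : ∀ t, ∃ L : Fin n → ℝ, 0 ≤ t → Tendsto (u t) (𝓝[>] (X t)) (𝓝 L) := by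
    intro t
    by_cases ht : 0 ≤ t
    · obtain ⟨L, hL⟩ := exists_tendsto_nhdsGT_of_boundedVariationOn (hbv t ht) (X t)
      exact ⟨L, fun _ => hL⟩
    · exact ⟨0, fun h => absurd h ht⟩
  have hLex : ∀ t, ∃ L : Fin n → ℝ, 0 ≤ t → Tendsto (u t) (𝓝[<] (X t)) (𝓝 L) := by
    intro t
    by_cases ht : 0 ≤ t
    · obtain ⟨L, hL⟩ := exists_tendsto_nhdsLT_of_boundedVariationOn (hbv t ht) (X t)
      exact ⟨L, fun _ => hL⟩
    · exact ⟨0, fun h => absurd h ht⟩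
  choose R hR using hRex
  choose L hL using hLex
  have hsec : ∀ c : ℝ, Measurable fun t => u t (X t + c) := fun c =>
    hmeas.comp (measurable_id.prodMk (hXc.measurable.add_const c))
  -- the traces
  set up : ℝ → Fin n → ℝ := fun t => if 0 ≤ t then R t else 0 with hup
  set um : ℝ → Fin n → ℝ := fun t => if 0 ≤ t then L t else 0 with hum
  have hup_meas : Measurable up := by
    refine measurable_of_tendsto_metrizable
      (f := fun (k : ℕ) (t : ℝ) => if 0 ≤ t then u t (X t + 1 / ((k : ℝ) + 1)) else 0)
      (fun k => Measurable.ite measurableSet_Ici (hsec _) measurable_const) ?_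
    rw [tendsto_pi_nhds]
    intro t
    by_cases ht : 0 ≤ t
    · simp only [ht, if_true, hup]
      refine (hR t ht).comp (tendsto_nhdsWithin_iff.2 ⟨?_, Eventually.of_forall fun k => ?_⟩)
      · simpa using
          (tendsto_const_nhds (x := X t)).add tendsto_one_div_add_atTop_nhds_zero_nat
      · simp only [mem_Ioi, lt_add_iff_pos_right]
        positivity
    · simp only [ht, if_false, hup]
      exact tendsto_const_nhds
  have hum_meas : Measurable um := by
    refine measurable_of_tendsto_metrizable
      (f := fun (k : ℕ) (t : ℝ) => if 0 ≤ t then u t (X t + -(1 / ((k : ℝ) + 1))) else 0)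
      (fun k => Measurable.ite measurableSet_Ici (hsec _) measurable_const) ?_
    rw [tendsto_pi_nhds]
    intro t
    by_cases ht : 0 ≤ t
    · simp only [ht, if_true, hum]
      refine (hL t ht).comp (tendsto_nhdsWithin_iff.2 ⟨?_, Eventually.of_forall fun k => ?_⟩)
      · simpa using
          (tendsto_const_nhds (x := X t)).add tendsto_one_div_add_atTop_nhds_zero_nat.neg
      · simp only [mem_Iio, add_neg_lt_iff_lt_add, lt_add_iff_pos_right]
        positivity
    · simp only [ht, if_false, hum]
      exact tendsto_const_nhds
  have hRbd : ∀ t, 0 ≤ t → ‖R t‖ ≤ M := fun t ht =>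
    le_of_tendsto' (hR t ht).norm fun y => hbdd t y ht
  have hLbd : ∀ t, 0 ≤ t → ‖L t‖ ≤ M := fun t ht =>
    le_of_tendsto' (hL t ht).norm fun y => hbdd t y ht
  have hup_bd : ∀ t, ‖up t‖ ≤ M := fun t => by
    by_cases ht : 0 ≤ t
    · simp only [hup, ht, if_true]; exact hRbd t ht
    · simp only [hup, ht, if_false, norm_zero]; exact hM0
  have hum_bd : ∀ t, ‖um t‖ ≤ M := fun t => by
    by_cases ht : 0 ≤ t
    · simp only [hum, ht, if_true]; exact hLbd t ht
    · simp only [hum, ht, if_false, norm_zero]; exact hM0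
  refine ⟨um, up, hum_meas, hup_meas, ⟨M, fun t => ⟨hum_bd t, hup_bd t⟩⟩, fun T _ => ⟨?_, ?_⟩⟩
  · -- right traces
    refine tendsto_lintegral_essSup_enorm_sub (fun k : ℕ => Ioo (0 : ℝ) (1 / (k : ℝ))) hbdd
      (fun t ht => by simpa [hup, ht] using hRbd t ht) (fun t ht ε hε => ?_)
      (fun k => measurableSet_Ioo) T
    have hup_t : up t = R t := by simp [hup, ht.le]
    have h1 : ∀ᶠ z in 𝓝[>] (X t), ‖u t z - R t‖ₑ < ε := by
      have := (EMetric.tendsto_nhds.1 (hR t ht.le)) ε hε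
      simpa only [edist_eq_enorm_sub] using this
    obtain ⟨b, hb, hbsub⟩ := mem_nhdsGT_iff_exists_Ioo_subset.1 h1
    obtain ⟨N, hN⟩ := exists_nat_one_div_lt (sub_pos.2 (show X t < b from hb))
    refine ⟨N + 1, fun k hk y hy => ?_⟩
    rw [hup_t]
    have hk1 : (1 : ℝ) / k ≤ 1 / ((N : ℝ) + 1) :=
      one_div_le_one_div_of_le (by positivity) (by exact_mod_cast hk)
    have hz : X t + y ∈ Ioo (X t) b := ⟨by linarith [hy.1], by linarith [hy.2]⟩
    exact (hbsub hz).le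
  · -- left traces
    refine tendsto_lintegral_essSup_enorm_sub (fun k : ℕ => Ioo (-(1 / (k : ℝ))) (0 : ℝ)) hbdd
      (fun t ht => by simpa [hum, ht] using hLbd t ht) (fun t ht ε hε => ?_)
      (fun k => measurableSet_Ioo) T
    have hum_t : um t = L t := by simp [hum, ht.le]
    have h1 : ∀ᶠ z in 𝓝[<] (X t), ‖u t z - L t‖ₑ < ε := by
      have := (EMetric.tendsto_nhds.1 (hL t ht.le)) ε hε
      simpa only [edist_eq_enorm_sub] using this
    obtain ⟨b, hb, hbsub⟩ := mem_nhdsLT_iff_exists_Ioo_subset.1 h1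
    obtain ⟨N, hN⟩ := exists_nat_one_div_lt (sub_pos.2 (show b < X t from hb))
    refine ⟨N + 1, fun k hk y hy => ?_⟩
    rw [hum_t]
    have hk1 : (1 : ℝ) / k ≤ 1 / ((N : ℝ) + 1) :=
      one_div_le_one_div_of_le (by positivity) (by exact_mod_cast hk)
    have hz : X t + y ∈ Ioo b (X t) := ⟨by linarith [hy.1], by linarith [hy.2]⟩
    exact (hbsub hz).le

/-- **`𝒮_BV^ε ⊆ 𝒮_weak`** ("any BV solution to (1.1), (1.3) belongs to `𝒮_weak`", §1): a member
of `𝒮_BV^ε` valued in `𝒪` with `𝒪̄ ⊆ 𝒱 ⊆ 𝒰₀`, `𝒱` bounded, is a member of `𝒮_weak` with the same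
datum. [cite: ChenKrupaVasseur2022, §1 (remark before Thm 1.4)] -/
theorem InSbv.inSweak {f : (Fin n → ℝ) → (Fin n → ℝ)} {η q : (Fin n → ℝ) → ℝ}
    {O U₀ V : Set (Fin n → ℝ)} {ε : ℝ} {u₀ : ℝ → Fin n → ℝ} {u : ℝ → ℝ → Fin n → ℝ}
    (h : InSbv f η q O ε u₀ u) (hOV : closure O ⊆ V) (hVU : V ⊆ U₀) (hV : IsBounded V) :
    InSweak f η q U₀ u₀ u := by
  obtain ⟨hmeas, hmeas₀, hO, hO₀, hvar, -, hsol⟩ := h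
  obtain ⟨M, hM⟩ := hV.exists_norm_le
  have hOV' : O ⊆ V := subset_closure.trans hOV
  have hbdd : ∀ t x, 0 ≤ t → ‖u t x‖ ≤ M := fun t x ht => hM _ (hOV' (hO t x ht))
  refine ⟨hmeas, hmeas₀, fun t x ht => hVU (hOV' (hO t x ht)), ⟨M, fun x => hM _ (hOV' (hO₀ x))⟩,
    hsol, hasStrongTraces_of_boundedVariationOn hmeas (fun t ht => ?_) hbdd⟩
  exact ne_top_of_le_ne_top ENNReal.ofReal_ne_top (hvar t ht)

/-! ## Non-vacuity: constant states are entropy weak solutions -/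

/-- The weak form against a test function vanishes on constants:
`∫_{t>0}∫ (φₜ a + φₓ b) dx dt + ∫ φ(0,x) a dx = 0` for `φ ∈ C_c^∞(ℝ²)` and constants `a, b`
(`∫ φₓ dx = 0`, and `∫_{t>0} φₜ dt = -φ(0,x)` by the fundamental theorem of calculus, Fubini).
[folklore] -/
theorem weakForm_const {φ : ℝ × ℝ → ℝ} (hφ : ContDiff ℝ (⊤ : ℕ∞) φ) (hsupp : HasCompactSupport φ)
    (a b : ℝ) :
    (∫ t in Ioi (0 : ℝ), ∫ x : ℝ, (deriv (fun s => φ (s, x)) t * a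
        + deriv (fun y => φ (t, y)) x * b)) + ∫ x : ℝ, φ (0, x) * a = 0 := by
  have hφ1 : ContDiff ℝ 1 φ := hφ.of_le (by exact_mod_cast le_top)
  obtain ⟨R, hR, hRφ⟩ := exists_radius_of_hasCompactSupport hsupp
  -- partial derivatives as continuous functions with square support
  set A : ℝ × ℝ → ℝ := fun p => fderiv ℝ φ p (1, 0) with hA
  set B : ℝ × ℝ → ℝ := fun p => fderiv ℝ φ p (0, 1) with hB
  have hAc : Continuous A := (hφ1.continuous_fderiv one_ne_zero).clm_apply continuous_const
  have hBc : Continuous B := (hφ1.continuous_fderiv one_ne_zero).clm_apply continuous_const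
  have hAs : ∀ p : ℝ × ℝ, (R < |p.1| ∨ R < |p.2|) → A p = 0 := fun p hp => by
    simp [hA, (hRφ p hp).2]
  have hBs : ∀ p : ℝ × ℝ, (R < |p.1| ∨ R < |p.2|) → B p = 0 := fun p hp => by
    simp [hB, (hRφ p hp).2]
  have hdt : ∀ t x, deriv (fun s => φ (s, x)) t = A (t, x) := fun t x =>
    (hasDerivAt_testSlice_t hφ1 t x).deriv
  have hdx : ∀ t x, deriv (fun y => φ (t, y)) x = B (t, x) := fun t x =>
    (hasDerivAt_testSlice_x hφ1 t x).deriv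
  simp_rw [hdt, hdx]
  -- slices are integrable
  have hφc : Continuous φ := hφ1.continuous
  have hint_x : ∀ (G : ℝ × ℝ → ℝ), Continuous G → (∀ p : ℝ × ℝ, (R < |p.1| ∨ R < |p.2|) → G p = 0) →
      ∀ t, Integrable (fun x => G (t, x)) := by
    intro G hG hGs t
    refine (hG.comp (Continuous.prodMk_right t)).integrable_of_hasCompactSupport
      (hasCompactSupport_of_interval (R := R) fun x hx => hGs (t, x) (Or.inr hx))
  have hint_t : ∀ (G : ℝ × ℝ → ℝ), Continuous G → (∀ p : ℝ × ℝ, (R < |p.1| ∨ R < |p.2|) → G p = 0) →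
      ∀ x, Integrable (fun t => G (t, x)) := by
    intro G hG hGs x
    refine (hG.comp (Continuous.prodMk_left x)).integrable_of_hasCompactSupport
      (hasCompactSupport_of_interval (R := R) fun t ht => hGs (t, x) (Or.inl ht))
  -- `∫ φₓ(t,x) dx = 0`
  have hBint : ∀ t, ∫ x, B (t, x) = 0 := fun t =>
    integral_eq_zero_of_hasDerivAt_of_integrable
      (fun x => by simpa [hB] using hasDerivAt_testSlice_x hφ1 t x)
      (hint_x B hBc hBs t) (hint_x φ hφc (fun p hp => (hRφ p hp).1) t)
  -- `∫_{t>0} φₜ(t,x) dt = -φ(0,x)`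
  have hAint : ∀ x, ∫ t in Ioi (0 : ℝ), A (t, x) = -φ (0, x) := by
    intro x
    have hlim : Tendsto (fun t => φ (t, x)) atTop (𝓝 0) := by
      refine tendsto_const_nhds.congr' ?_
      filter_upwards [eventually_gt_atTop R] with t ht
      exact ((hRφ (t, x) (Or.inl (lt_of_lt_of_le ht (le_abs_self t)))).1).symm
    have := integral_Ioi_of_hasDerivAt_of_tendsto (f := fun t => φ (t, x)) (a := 0) (m := 0)
      (hφc.comp (Continuous.prodMk_left x)).continuousWithinAt
      (fun t _ => by simpa [hA] using hasDerivAt_testSlice_t hφ1 t x)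
      ((hint_t A hAc hAs x).integrableOn) hlim
    simpa using this
  -- inner integral in `x`
  have hinner : ∀ t, ∫ x, (A (t, x) * a + B (t, x) * b) = a * ∫ x, A (t, x) := by
    intro t
    rw [integral_add ((hint_x A hAc hAs t).mul_const a) ((hint_x B hBc hBs t).mul_const b),
      integral_mul_const, integral_mul_const, hBint t]
    ring
  simp_rw [hinner]
  -- swap the order of integration in the remaining term
  have hswap : ∫ t in Ioi (0 : ℝ), ∫ x, A (t, x) = ∫ x, ∫ t in Ioi (0 : ℝ), A (t, x) :=
    integral_integral_swap (integrable_prod_Ioi_of_continuous hAc hAs)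
  rw [integral_const_mul, hswap]
  simp_rw [hAint]
  rw [integral_neg, integral_mul_const]
  ring

/-- Constant states are weak solutions of the Cauchy problem (1.1) with constant datum.
[folklore] -/
theorem isSystemWeakSolution_const (f : (Fin n → ℝ) → (Fin n → ℝ)) (c : Fin n → ℝ) :
    IsSystemWeakSolution f (fun _ => c) (fun _ _ => c) :=
  fun i _ hφ hsupp => weakForm_const hφ hsupp (c i) (f c i)

/-- Constant states are entropy weak solutions for ANY pair `(η, q)` (the entropy inequality holds
with equality). [folklore] -/
theorem isEntropyWeakSolution_const (f : (Fin n → ℝ) → (Fin n → ℝ)) (η q : (Fin n → ℝ) → ℝ)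
    (c : Fin n → ℝ) : IsEntropyWeakSolution f η q (fun _ => c) (fun _ _ => c) :=
  ⟨isSystemWeakSolution_const f c,
    fun _ hφ hsupp _ => (weakForm_const hφ hsupp (η c) (q c)).symm.le⟩

/-- **Non-vacuity of `𝒮_BV^ε`**: a constant state `c ∈ 𝒪` is a member of `𝒮_BV^ε` (valued in `𝒪`)
for every `ε ≥ 0`. [folklore] -/
theorem inSbv_const (f : (Fin n → ℝ) → (Fin n → ℝ)) (η q : (Fin n → ℝ) → ℝ)
    {O : Set (Fin n → ℝ)} {ε : ℝ} {c : Fin n → ℝ} (hc : c ∈ O) :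
    InSbv f η q O ε (fun _ => c) (fun _ _ => c) := by
  have hvar : eVariationOn (fun _ : ℝ => c) univ = 0 :=
    eVariationOn.constant_on (Set.subsingleton_of_forall_eq c (by rintro _ ⟨_, _, rfl⟩; rfl))
  refine ⟨measurable_const, measurable_const, fun _ _ _ => hc, fun _ => hc,
    fun t _ => ?_, ?_, isEntropyWeakSolution_const f η q c⟩
  · exact (le_of_eq hvar).trans zero_le
  · exact (le_of_eq hvar).trans zero_le

/-- **Non-vacuity of `𝒮_weak`**: a constant state `c` of a bounded state set `𝒰₀` is a member of
`𝒮_weak`. [folklore] -/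
theorem inSweak_const (f : (Fin n → ℝ) → (Fin n → ℝ)) (η q : (Fin n → ℝ) → ℝ)
    {U₀ : Set (Fin n → ℝ)} (hU₀ : IsBounded U₀) {c : Fin n → ℝ} (hc : c ∈ U₀) :
    InSweak f η q U₀ (fun _ => c) (fun _ _ => c) := by
  obtain ⟨M, hM⟩ := hU₀.exists_norm_le
  refine ⟨measurable_const, measurable_const, fun _ _ _ => hc, ⟨M, fun _ => hM c hc⟩,
    isEntropyWeakSolution_const f η q c, ?_⟩
  refine hasStrongTraces_of_boundedVariationOn (M := M) measurable_const (fun t _ => ?_)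
    (fun _ _ _ => hM c hc)
  have hvar : eVariationOn (fun _ : ℝ => c) univ = 0 :=
    eVariationOn.constant_on (Set.subsingleton_of_forall_eq c (by rintro _ ⟨_, _, rfl⟩; rfl))
  exact ne_top_of_le_ne_top ENNReal.zero_ne_top (le_of_eq hvar)

/-- For the isentropic Euler system: every constant state of `𝒪 ⊆ 𝒱` is in `𝒮_BV^ε`, and every
state of `𝒰₀` (including the vacuum) is a constant member of `𝒮_weak` — the classes quantified
over in `chenKrupaVasseur_weakBV_isentropicEuler` are inhabited. [folklore] -/
theorem inSweak_const_isentropicEuler (hγ : 1 < γ) {c : Fin 2 → ℝ}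
    (hc : c ∈ isentropicEulerStates γ C) :
    InSweak (isentropicEulerFlux γ) (isentropicEulerEntropy γ) (isentropicEulerEntropyFlux γ)
      (isentropicEulerStates γ C) (fun _ => c) (fun _ _ => c) :=
  inSweak_const _ _ _ (isBounded_isentropicEulerStates hγ) hc

/-! ## §3 (3.1): the relative entropy inequality for constant states -/

/-- **Relative entropy inequality for constant states** (§3, (3.1)): "if `u` is a weak solution of
(1.1), (1.3), then `u` verifies also the full family of entropy inequalities for any `b ∈ 𝒱`
constant: `(η(u|b))ₜ + (q(u;b))ₓ ≤ 0`", where `η(u|b) = η(u) - η(b) - ∇η(b)(u-b)` and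
`q(u;b) = q(u) - q(b) - ∇η(b)(f(u)-f(b))`, in the integral form of §1 (test functions `φ ≥ 0`, with
the `t = 0` term). It holds with ANY vector `π` in place of `∇η(b)` and any constant `b`: the left
side is the entropy inequality minus `∑ᵢ πᵢ ×` (the `i`-th weak identity) plus the weak form of a
constant, by linearity of the integrals — which is where the boundedness and measurability
hypotheses (values of `u`, `f(u)`, `η(u)`, `q(u)` for `t > 0`, and of `u⁰`, `η(u⁰)`) are used.
[cite: ChenKrupaVasseur2022, §3 (3.1)] -/
theorem relEntropy_weak_ineq_const {f : (Fin n → ℝ) → (Fin n → ℝ)} {η q : (Fin n → ℝ) → ℝ}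
    {u₀ : ℝ → Fin n → ℝ} {u : ℝ → ℝ → Fin n → ℝ}
    (hu : Measurable (Function.uncurry u)) (hu₀ : Measurable u₀)
    (hfm : Measurable f) (hηm : Measurable η) (hqm : Measurable q) {B : ℝ}
    (hB : ∀ t x, 0 < t → ‖u t x‖ ≤ B ∧ ‖f (u t x)‖ ≤ B ∧ |η (u t x)| ≤ B ∧ |q (u t x)| ≤ B)
    (hB₀ : ∀ x, ‖u₀ x‖ ≤ B ∧ |η (u₀ x)| ≤ B)
    (hsol : IsEntropyWeakSolution f η q u₀ u) (b π : Fin n → ℝ)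
    {φ : ℝ × ℝ → ℝ} (hφ : ContDiff ℝ (⊤ : ℕ∞) φ) (hsupp : HasCompactSupport φ)
    (hφ0 : ∀ p, 0 ≤ φ p) :
    0 ≤ (∫ t in Ioi (0 : ℝ), ∫ x : ℝ,
          (deriv (fun s => φ (s, x)) t * (η (u t x) - η b - π ⬝ᵥ (u t x - b))
            + deriv (fun y => φ (t, y)) x * (q (u t x) - q b - π ⬝ᵥ (f (u t x) - f b))))
        + ∫ x : ℝ, φ (0, x) * (η (u₀ x) - η b - π ⬝ᵥ (u₀ x - b)) := by
  have hφ1 : ContDiff ℝ 1 φ := hφ.of_le (by exact_mod_cast le_top)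
  have hφc : Continuous φ := hφ1.continuous
  obtain ⟨R, hR, hRφ⟩ := exists_radius_of_hasCompactSupport hsupp
  -- partial derivatives as continuous functions with square support
  set A : ℝ × ℝ → ℝ := fun p => fderiv ℝ φ p (1, 0) with hA
  set D : ℝ × ℝ → ℝ := fun p => fderiv ℝ φ p (0, 1) with hD
  have hAc : Continuous A := (hφ1.continuous_fderiv one_ne_zero).clm_apply continuous_const
  have hDc : Continuous D := (hφ1.continuous_fderiv one_ne_zero).clm_apply continuous_const
  have hAs : ∀ p : ℝ × ℝ, (R < |p.1| ∨ R < |p.2|) → A p = 0 := fun p hp => by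
    simp [hA, (hRφ p hp).2]
  have hDs : ∀ p : ℝ × ℝ, (R < |p.1| ∨ R < |p.2|) → D p = 0 := fun p hp => by
    simp [hD, (hRφ p hp).2]
  have hdt : ∀ t x, deriv (fun s => φ (s, x)) t = A (t, x) := fun t x =>
    (hasDerivAt_testSlice_t hφ1 t x).deriv
  have hdx : ∀ t x, deriv (fun y => φ (t, y)) x = D (t, x) := fun t x =>
    (hasDerivAt_testSlice_x hφ1 t x).deriv
  -- the three printed ingredients, with the derivatives rewritten
  have hS : ∀ i, (∫ t in Ioi (0 : ℝ), ∫ x : ℝ, (A (t, x) * u t x i + D (t, x) * f (u t x) i))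
      + ∫ x : ℝ, φ (0, x) * u₀ x i = 0 := by
    intro i
    have := hsol.1 i φ hφ hsupp
    simpa only [hdt, hdx] using this
  have hE : 0 ≤ (∫ t in Ioi (0 : ℝ), ∫ x : ℝ, (A (t, x) * η (u t x) + D (t, x) * q (u t x)))
      + ∫ x : ℝ, φ (0, x) * η (u₀ x) := by
    have := hsol.2 φ hφ hsupp hφ0
    simpa only [hdt, hdx] using this
  have hK := weakForm_const hφ hsupp (-η b + π ⬝ᵥ b) (-q b + π ⬝ᵥ f b)
  simp only [hdt, hdx] at hK ⊢
  -- the product measure on the half plane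
  set μ : Measure (ℝ × ℝ) := ((volume : Measure ℝ).restrict (Ioi 0)).prod volume with hμ
  have hae : ∀ᵐ p ∂μ, 0 < p.1 := by
    have hμ' : μ = (volume : Measure (ℝ × ℝ)).restrict (Ioi 0 ×ˢ univ) := by
      rw [hμ, Measure.restrict_prod_eq_prod_univ, Measure.volume_eq_prod]
    rw [hμ']
    filter_upwards [ae_restrict_mem (measurableSet_Ioi.prod MeasurableSet.univ)] with p hp
    exact hp.1
  -- integrability on `μ` of (continuous, square support) × (measurable, bounded for `t > 0`)
  have hint : ∀ G : ℝ × ℝ → ℝ, Continuous G → (∀ p : ℝ × ℝ, (R < |p.1| ∨ R < |p.2|) → G p = 0) →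
      ∀ g : ℝ × ℝ → ℝ, Measurable g → (∀ p : ℝ × ℝ, 0 < p.1 → |g p| ≤ B) →
      Integrable (fun p => G p * g p) μ := by
    intro G hG hGs g hg hgB
    refine (integrable_prod_Ioi_of_continuous hG hGs).mul_bdd (c := B) hg.aestronglyMeasurable ?_
    filter_upwards [hae] with p hp
    rw [Real.norm_eq_abs]
    exact hgB p hp
  -- measurability of the compositions
  have hum : Measurable fun p : ℝ × ℝ => u p.1 p.2 := hu
  have hηu : Measurable fun p : ℝ × ℝ => η (u p.1 p.2) := hηm.comp hu
  have hqu : Measurable fun p : ℝ × ℝ => q (u p.1 p.2) := hqm.comp hu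
  have hfu : ∀ i, Measurable fun p : ℝ × ℝ => f (u p.1 p.2) i :=
    fun i => (measurable_pi_apply i).comp (hfm.comp hu)
  have hui : ∀ i, Measurable fun p : ℝ × ℝ => u p.1 p.2 i :=
    fun i => (measurable_pi_apply i).comp hu
  -- bounds for `t > 0`
  have hbη : ∀ p : ℝ × ℝ, 0 < p.1 → |η (u p.1 p.2)| ≤ B := fun p hp => (hB p.1 p.2 hp).2.2.1
  have hbq : ∀ p : ℝ × ℝ, 0 < p.1 → |q (u p.1 p.2)| ≤ B := fun p hp => (hB p.1 p.2 hp).2.2.2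
  have hbu : ∀ i, ∀ p : ℝ × ℝ, 0 < p.1 → |u p.1 p.2 i| ≤ B := fun i p hp =>
    (norm_le_pi_norm (u p.1 p.2) i).trans (hB p.1 p.2 hp).1
  have hbf : ∀ i, ∀ p : ℝ × ℝ, 0 < p.1 → |f (u p.1 p.2) i| ≤ B := fun i p hp =>
    (norm_le_pi_norm (f (u p.1 p.2)) i).trans (hB p.1 p.2 hp).2.1
  -- the integrands on the half plane
  set GE : ℝ × ℝ → ℝ := fun p => A p * η (u p.1 p.2) + D p * q (u p.1 p.2) with hGE
  set GS : Fin n → ℝ × ℝ → ℝ := fun i p => A p * u p.1 p.2 i + D p * f (u p.1 p.2) i with hGS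
  set GK : ℝ × ℝ → ℝ := fun p => A p * (-η b + π ⬝ᵥ b) + D p * (-q b + π ⬝ᵥ f b) with hGK
  set Grel : ℝ × ℝ → ℝ := fun p => A p * (η (u p.1 p.2) - η b - π ⬝ᵥ (u p.1 p.2 - b))
    + D p * (q (u p.1 p.2) - q b - π ⬝ᵥ (f (u p.1 p.2) - f b)) with hGrel
  have hGEi : Integrable GE μ := (hint A hAc hAs _ hηu hbη).add (hint D hDc hDs _ hqu hbq)
  have hGSi : ∀ i, Integrable (GS i) μ := fun i =>
    (hint A hAc hAs _ (hui i) (hbu i)).add (hint D hDc hDs _ (hfu i) (hbf i))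
  have hGKi : Integrable GK μ :=
    ((integrable_prod_Ioi_of_continuous hAc hAs).mul_const _).add
      ((integrable_prod_Ioi_of_continuous hDc hDs).mul_const _)
  -- pointwise decomposition `Grel = GE - ∑ πᵢ GSᵢ + GK`
  have hsumGS : ∀ p, ∑ i, π i * GS i p
      = A p * (π ⬝ᵥ u p.1 p.2) + D p * (π ⬝ᵥ f (u p.1 p.2)) := by
    intro p
    simp only [hGS, dotProduct, Finset.mul_sum, ← Finset.sum_add_distrib]
    exact Finset.sum_congr rfl fun i _ => by ring
  have hdec : Grel = fun p => GE p - ∑ i, π i * GS i p + GK p := by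
    funext p
    rw [hsumGS p]
    simp only [hGrel, hGE, hGK, dotProduct_sub]
    ring
  have hGreli : Integrable Grel μ := by
    rw [hdec]
    exact (hGEi.sub (integrable_finsetSum _ fun i _ => (hGSi i).const_mul (π i))).add hGKi
  -- iterated integrals as integrals on `μ`
  have iE : ∫ t in Ioi (0 : ℝ), ∫ x : ℝ, (A (t, x) * η (u t x) + D (t, x) * q (u t x))
      = ∫ p, GE p ∂μ := (integral_prod GE hGEi).symm
  have iS : ∀ i, ∫ t in Ioi (0 : ℝ), ∫ x : ℝ, (A (t, x) * u t x i + D (t, x) * f (u t x) i)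
      = ∫ p, GS i p ∂μ := fun i => (integral_prod (GS i) (hGSi i)).symm
  have iK : ∫ t in Ioi (0 : ℝ), ∫ x : ℝ, (A (t, x) * (-η b + π ⬝ᵥ b) + D (t, x) * (-q b + π ⬝ᵥ f b))
      = ∫ p, GK p ∂μ := (integral_prod GK hGKi).symm
  have irel : ∫ t in Ioi (0 : ℝ), ∫ x : ℝ, (A (t, x) * (η (u t x) - η b - π ⬝ᵥ (u t x - b))
      + D (t, x) * (q (u t x) - q b - π ⬝ᵥ (f (u t x) - f b))) = ∫ p, Grel p ∂μ :=
    (integral_prod Grel hGreli).symm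
  -- linearity on `μ`
  have hSsum : Integrable (fun p => ∑ i, π i * GS i p) μ :=
    integrable_finsetSum _ fun i _ => (hGSi i).const_mul (π i)
  have hEsub : Integrable (fun p => GE p - ∑ i, π i * GS i p) μ := hGEi.sub hSsum
  have hlin : ∫ p, Grel p ∂μ = ∫ p, GE p ∂μ - ∑ i, π i * ∫ p, GS i p ∂μ + ∫ p, GK p ∂μ := by
    have e : ∫ p, Grel p ∂μ = ∫ p, (GE p - ∑ i, π i * GS i p + GK p) ∂μ := by rw [hdec]
    rw [e, integral_add hEsub hGKi, integral_sub hGEi hSsum,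
      integral_finsetSum _ fun i _ => (hGSi i).const_mul (π i)]
    simp only [integral_const_mul]
  -- the `t = 0` terms
  have hint₀ : ∀ g : ℝ → ℝ, Measurable g → (∀ x, |g x| ≤ B) →
      Integrable (fun x => φ (0, x) * g x) := by
    intro g hg hgB
    refine ((hφc.comp (Continuous.prodMk_right 0)).integrable_of_hasCompactSupport
      (hasCompactSupport_of_interval (R := R) fun x hx =>
        (hRφ (0, x) (Or.inr hx)).1)).mul_bdd (c := B) hg.aestronglyMeasurable ?_
    exact Eventually.of_forall fun x => by rw [Real.norm_eq_abs]; exact hgB x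
  have h0η : Integrable fun x => φ (0, x) * η (u₀ x) :=
    hint₀ _ (hηm.comp hu₀) fun x => (hB₀ x).2
  have h0u : ∀ i, Integrable fun x => φ (0, x) * u₀ x i := fun i =>
    hint₀ _ ((measurable_pi_apply i).comp hu₀) fun x => (norm_le_pi_norm (u₀ x) i).trans (hB₀ x).1
  have h0K : Integrable fun x => φ (0, x) * (-η b + π ⬝ᵥ b) :=
    ((hφc.comp (Continuous.prodMk_right 0)).integrable_of_hasCompactSupport
      (hasCompactSupport_of_interval (R := R) fun x hx => (hRφ (0, x) (Or.inr hx)).1)).mul_const _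
  have hsum0 : ∀ x, ∑ i, π i * (φ (0, x) * u₀ x i) = φ (0, x) * (π ⬝ᵥ u₀ x) := by
    intro x
    simp only [dotProduct, Finset.mul_sum]
    exact Finset.sum_congr rfl fun i _ => by ring
  have hdec₀ : (fun x => φ (0, x) * (η (u₀ x) - η b - π ⬝ᵥ (u₀ x - b)))
      = fun x => φ (0, x) * η (u₀ x) - ∑ i, π i * (φ (0, x) * u₀ x i)
        + φ (0, x) * (-η b + π ⬝ᵥ b) := by
    funext x
    rw [hsum0 x]
    simp only [dotProduct_sub]
    ring
  have h0sum : Integrable (fun x => ∑ i, π i * (φ (0, x) * u₀ x i)) :=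
    integrable_finsetSum _ fun i _ => (h0u i).const_mul (π i)
  have h0sub : Integrable (fun x => φ (0, x) * η (u₀ x) - ∑ i, π i * (φ (0, x) * u₀ x i)) :=
    h0η.sub h0sum
  have hlin₀ : ∫ x, φ (0, x) * (η (u₀ x) - η b - π ⬝ᵥ (u₀ x - b))
      = (∫ x, φ (0, x) * η (u₀ x)) - ∑ i, π i * (∫ x, φ (0, x) * u₀ x i)
        + ∫ x, φ (0, x) * (-η b + π ⬝ᵥ b) := by
    have e : ∫ x, φ (0, x) * (η (u₀ x) - η b - π ⬝ᵥ (u₀ x - b))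
        = ∫ x, (φ (0, x) * η (u₀ x) - ∑ i, π i * (φ (0, x) * u₀ x i)
          + φ (0, x) * (-η b + π ⬝ᵥ b)) := by rw [hdec₀]
    rw [e, integral_add h0sub h0K, integral_sub h0η h0sum,
      integral_finsetSum _ fun i _ => (h0u i).const_mul (π i)]
    simp only [integral_const_mul]
  -- assemble
  rw [irel, hlin, hlin₀]
  rw [iE] at hE
  rw [iK] at hK
  have hS' : ∀ i, ∫ p, GS i p ∂μ + ∫ x, φ (0, x) * u₀ x i = 0 := fun i => by rw [← iS i]; exact hS i
  have hsum : ∑ i, π i * ∫ p, GS i p ∂μ + ∑ i, π i * ∫ x, φ (0, x) * u₀ x i = 0 := by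
    rw [← Finset.sum_add_distrib]
    refine Finset.sum_eq_zero fun i _ => ?_
    rw [← mul_add, hS' i, mul_zero]
  set IE := ∫ p, GE p ∂μ with hIE
  set IK := ∫ p, GK p ∂μ with hIK
  set I0η := ∫ x, φ (0, x) * η (u₀ x) with hI0η
  set I0K := ∫ x, φ (0, x) * (-η b + π ⬝ᵥ b) with hI0K
  set S1 := ∑ i, π i * ∫ p, GS i p ∂μ with hS1
  set S2 := ∑ i, π i * ∫ x, φ (0, x) * u₀ x i with hS2
  linarith

/-- The isentropic Euler flux is measurable (a composition of coordinate projections, division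
and real powers). [folklore] -/
theorem measurable_isentropicEulerFlux (γ : ℝ) : Measurable (isentropicEulerFlux γ) := by
  refine measurable_pi_iff.2 fun i => ?_
  fin_cases i
  · simpa [isentropicEulerFlux] using measurable_pi_apply 1
  · simp only [isentropicEulerFlux, Fin.mk_one, Matrix.cons_val_one, Matrix.cons_val_fin_one]
    exact (((measurable_pi_apply 1).pow_const 2).div (measurable_pi_apply 0)).add
      ((measurable_pi_apply 0).pow_const γ)

/-- The physical entropy of isentropic Euler is measurable. [folklore] -/
theorem measurable_isentropicEulerEntropy (γ : ℝ) : Measurable (isentropicEulerEntropy γ) := by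
  unfold isentropicEulerEntropy
  exact (((measurable_pi_apply 1).pow_const 2).div ((measurable_pi_apply 0).const_mul 2)).add
    (((measurable_pi_apply 0).pow_const γ).div_const _)

/-- The entropy flux of isentropic Euler is measurable. [folklore] -/
theorem measurable_isentropicEulerEntropyFlux (γ : ℝ) :
    Measurable (isentropicEulerEntropyFlux γ) := by
  unfold isentropicEulerEntropyFlux
  exact ((measurable_pi_apply 1).div (measurable_pi_apply 0)).mul
    ((((measurable_pi_apply 1).pow_const 2).div ((measurable_pi_apply 0).const_mul 2)).add
      (((measurable_pi_apply 0).pow_const γ).const_mul _))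

/-- Bounds on `𝒱` for the flux, entropy and entropy flux of isentropic Euler: with `|v| < C` and
`ρ < P := (2C/c₁)^{2/(γ-1)}`, `ρ^γ < P^γ`, one has `‖f(u)‖ ≤ P C² + P^γ`,
`|η(u)| ≤ P C² + P^γ/(γ-1)` and `|q(u)| ≤ C (P C² + γ P^γ/(γ-1))`.
[cite: ChenKrupaVasseur2022, Lemma 4.5 (proof)] -/
theorem bounds_of_mem_isentropicEulerInterior (hγ : 1 < γ) (hC : 0 < C) {u : Fin 2 → ℝ}
    (hu : u ∈ isentropicEulerInterior γ C) :
    ‖isentropicEulerFlux γ u‖ ≤ (2 * C / isentropicEulerC₁ γ) ^ (2 / (γ - 1)) * (1 + C) * C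
        + ((2 * C / isentropicEulerC₁ γ) ^ (2 / (γ - 1))) ^ γ ∧
      |isentropicEulerEntropy γ u| ≤ (2 * C / isentropicEulerC₁ γ) ^ (2 / (γ - 1)) * C ^ 2
        + ((2 * C / isentropicEulerC₁ γ) ^ (2 / (γ - 1))) ^ γ / (γ - 1) ∧
      |isentropicEulerEntropyFlux γ u| ≤ C * ((2 * C / isentropicEulerC₁ γ) ^ (2 / (γ - 1)) * C ^ 2
        + γ / (γ - 1) * ((2 * C / isentropicEulerC₁ γ) ^ (2 / (γ - 1))) ^ γ) := by
  set P := (2 * C / isentropicEulerC₁ γ) ^ (2 / (γ - 1)) with hP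
  have hPpos : 0 < P := Real.rpow_pos_of_pos (div_pos (by linarith) (isentropicEulerC₁_pos hγ)) _
  have hρ : 0 < u 0 := hu.1
  have hρP : u 0 < P := density_lt_of_mem_isentropicEulerInterior hγ hu
  have hv : |u 1 / u 0| < C := (abs_vel_lt_of_mem_isentropicEulerInterior hγ hu).1
  have hγ1 : 0 < γ - 1 := by linarith
  have hργ : (u 0) ^ γ < P ^ γ := Real.rpow_lt_rpow hρ.le hρP (by linarith)
  have hργ0 : 0 ≤ (u 0) ^ γ := Real.rpow_nonneg hρ.le _
  set v := u 1 / u 0 with hvdef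
  have h1 : u 1 = u 0 * v := by rw [hvdef]; field_simp
  have hv2 : v ^ 2 ≤ C ^ 2 := by
    have := abs_lt.1 hv
    nlinarith [sq_abs v, abs_nonneg v]
  have hvabs : |v| ≤ C := hv.le
  -- the three quantities in terms of `ρ, v`
  have ef1 : isentropicEulerFlux γ u 1 = u 0 * v ^ 2 + (u 0) ^ γ := by
    simp only [isentropicEulerFlux, Matrix.cons_val_one, Matrix.cons_val_fin_one]
    rw [h1]; field_simp
  have ef0 : isentropicEulerFlux γ u 0 = u 0 * v := by
    simp only [isentropicEulerFlux, Matrix.cons_val_zero]; exact h1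
  have eη : isentropicEulerEntropy γ u = u 0 * v ^ 2 / 2 + (u 0) ^ γ / (γ - 1) := by
    unfold isentropicEulerEntropy; rw [h1]; field_simp
  have eq' : isentropicEulerEntropyFlux γ u
      = v * (u 0 * v ^ 2 / 2 + γ / (γ - 1) * (u 0) ^ γ) := by
    unfold isentropicEulerEntropyFlux; rw [← hvdef, h1]
    congr 1
    field_simp
  refine ⟨?_, ?_, ?_⟩
  · refine (pi_norm_le_iff_of_nonneg (by positivity)).2 (Fin.forall_fin_two.2 ⟨?_, ?_⟩)
    · rw [ef0, Real.norm_eq_abs, abs_mul, abs_of_pos hρ]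
      nlinarith [abs_nonneg v, mul_le_mul_of_nonneg_left hvabs hρ.le]
    · rw [ef1, Real.norm_eq_abs, abs_of_nonneg (by positivity)]
      nlinarith [mul_le_mul_of_nonneg_left hv2 hρ.le]
  · rw [eη, abs_of_nonneg (by positivity)]
    have : (u 0) ^ γ / (γ - 1) ≤ P ^ γ / (γ - 1) := div_le_div_of_nonneg_right hργ.le hγ1.le
    nlinarith [mul_le_mul_of_nonneg_left hv2 hρ.le]
  · rw [eq', abs_mul]
    have hin : 0 ≤ u 0 * v ^ 2 / 2 + γ / (γ - 1) * (u 0) ^ γ := by positivity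
    rw [abs_of_nonneg hin]
    have h2 : u 0 * v ^ 2 / 2 + γ / (γ - 1) * (u 0) ^ γ ≤ P * C ^ 2 + γ / (γ - 1) * P ^ γ := by
      have hγ' : 0 ≤ γ / (γ - 1) := by positivity
      nlinarith [mul_le_mul_of_nonneg_left hv2 hρ.le, mul_le_mul_of_nonneg_left hργ.le hγ']
    exact mul_le_mul hvabs h2 hin hC.le

/-- The flux, entropy and entropy flux of isentropic Euler vanish at the vacuum (Lean values at
`u = 0`; these are also the continuous extensions from `𝒱`). [folklore] -/
theorem isentropicEuler_vacuum (γ : ℝ) (hγ : 1 < γ) :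
    isentropicEulerFlux γ 0 = 0 ∧ isentropicEulerEntropy γ 0 = 0 ∧
      isentropicEulerEntropyFlux γ 0 = 0 := by
  have h0 : (0 : ℝ) ^ γ = 0 := Real.zero_rpow (by linarith)
  refine ⟨?_, ?_, ?_⟩
  · ext i; fin_cases i <;> simp [isentropicEulerFlux, h0]
  · simp [isentropicEulerEntropy, h0]
  · simp [isentropicEulerEntropyFlux]

/-- **(3.1) for isentropic Euler**: every member of `𝒮_weak` (state set `𝒰₀` of §1, `γ > 1`,
`C > 0`) whose datum is valued in `𝒰₀` satisfies the relative entropy inequality for every constant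
state `b` and every vector `π` (in print `π = ∇η(b)`, `b ∈ 𝒱`).
[cite: ChenKrupaVasseur2022, §3 (3.1) with Lemma 4.5] -/
theorem relEntropy_weak_ineq_const_isentropicEuler (hγ : 1 < γ) (hC : 0 < C)
    {u₀ : ℝ → Fin 2 → ℝ} {u : ℝ → ℝ → Fin 2 → ℝ}
    (h : InSweak (isentropicEulerFlux γ) (isentropicEulerEntropy γ) (isentropicEulerEntropyFlux γ)
      (isentropicEulerStates γ C) u₀ u)
    (h₀ : ∀ x, u₀ x ∈ isentropicEulerStates γ C) (b π : Fin 2 → ℝ)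
    {φ : ℝ × ℝ → ℝ} (hφ : ContDiff ℝ (⊤ : ℕ∞) φ) (hsupp : HasCompactSupport φ)
    (hφ0 : ∀ p, 0 ≤ φ p) :
    0 ≤ (∫ t in Ioi (0 : ℝ), ∫ x : ℝ,
          (deriv (fun s => φ (s, x)) t
              * (isentropicEulerEntropy γ (u t x) - isentropicEulerEntropy γ b - π ⬝ᵥ (u t x - b))
            + deriv (fun y => φ (t, y)) x
              * (isentropicEulerEntropyFlux γ (u t x) - isentropicEulerEntropyFlux γ b
                - π ⬝ᵥ (isentropicEulerFlux γ (u t x) - isentropicEulerFlux γ b))))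
        + ∫ x : ℝ, φ (0, x)
          * (isentropicEulerEntropy γ (u₀ x) - isentropicEulerEntropy γ b - π ⬝ᵥ (u₀ x - b)) := by
  obtain ⟨hmeas, hmeas₀, hU, -, hsol, -⟩ := h
  -- one bound for everything on `𝒰₀ = 𝒱 ∪ {0}`
  set P := (2 * C / isentropicEulerC₁ γ) ^ (2 / (γ - 1)) with hP
  set B := P * (1 + C) + (P * (1 + C) * C + P ^ γ) + (P * C ^ 2 + P ^ γ / (γ - 1))
    + C * (P * C ^ 2 + γ / (γ - 1) * P ^ γ) with hBdef
  have hPpos : 0 < P := Real.rpow_pos_of_pos (div_pos (by linarith) (isentropicEulerC₁_pos hγ)) _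
  have hγ1 : 0 < γ - 1 := by linarith
  have hPγ : 0 ≤ P ^ γ := Real.rpow_nonneg hPpos.le _
  have t1 : 0 ≤ P * (1 + C) := by positivity
  have t2 : 0 ≤ P * (1 + C) * C + P ^ γ := by positivity
  have t3 : 0 ≤ P * C ^ 2 + P ^ γ / (γ - 1) := by positivity
  have t4 : 0 ≤ C * (P * C ^ 2 + γ / (γ - 1) * P ^ γ) := by positivity
  have hall : ∀ w ∈ isentropicEulerStates γ C, ‖w‖ ≤ B ∧ ‖isentropicEulerFlux γ w‖ ≤ B ∧
      |isentropicEulerEntropy γ w| ≤ B ∧ |isentropicEulerEntropyFlux γ w| ≤ B := by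
    intro w hw
    rcases hw with hw | hw
    · have hn := norm_le_of_mem_isentropicEulerInterior hγ hC hw
      obtain ⟨hf, hη, hq⟩ := bounds_of_mem_isentropicEulerInterior hγ hC hw
      refine ⟨?_, ?_, ?_, ?_⟩ <;> linarith
    · rw [mem_singleton_iff] at hw
      subst hw
      obtain ⟨hf, hη, hq⟩ := isentropicEuler_vacuum γ hγ
      rw [hf, hη, hq, norm_zero, abs_zero]
      have : 0 ≤ B := by positivity
      exact ⟨this, this, this, this⟩
  refine relEntropy_weak_ineq_const hmeas hmeas₀ (measurable_isentropicEulerFlux γ)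
    (measurable_isentropicEulerEntropy γ) (measurable_isentropicEulerEntropyFlux γ) (B := B)
    (fun t x ht => hall _ (hU t x ht.le)) (fun x => ⟨(hall _ (h₀ x)).1, (hall _ (h₀ x)).2.2.1⟩)
    hsol b π hφ hsupp hφ0

/-! ## Lemma 4.5 (c): `(η, q)` is an entropy pair, `q' = η' f'` on `{ρ > 0}` -/

section EntropyPair

/-- Derivative of the isentropic Euler flux on `{ρ ≠ 0}`:
`Df(u) = [[0, 1], [-v² + γρ^{γ-1}, 2v]]` (`v = u₂/u₁`), as a continuous linear map.
[cite: ChenKrupaVasseur2022, Lemma 4.5 (proof)] -/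
theorem hasFDerivAt_isentropicEulerFlux (γ : ℝ) {u : Fin 2 → ℝ} (hρ : u 0 ≠ 0) :
    HasFDerivAt (isentropicEulerFlux γ)
      (ContinuousLinearMap.pi ![ContinuousLinearMap.proj (R := ℝ) (φ := fun _ : Fin 2 => ℝ) 1,
        (-(u 1 ^ 2 / u 0 ^ 2) + γ * u 0 ^ (γ - 1)) •
            ContinuousLinearMap.proj (R := ℝ) (φ := fun _ : Fin 2 => ℝ) 0
          + (2 * u 1 / u 0) • ContinuousLinearMap.proj (R := ℝ) (φ := fun _ : Fin 2 => ℝ) 1]) u := by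
  have h0 : HasFDerivAt (fun v : Fin 2 → ℝ => v 0)
      (ContinuousLinearMap.proj (R := ℝ) (φ := fun _ : Fin 2 => ℝ) 0) u := hasFDerivAt_apply 0 u
  have h1 : HasFDerivAt (fun v : Fin 2 → ℝ => v 1)
      (ContinuousLinearMap.proj (R := ℝ) (φ := fun _ : Fin 2 => ℝ) 1) u := hasFDerivAt_apply 1 u
  have hinv : HasFDerivAt (fun v : Fin 2 → ℝ => (v 0)⁻¹)
      ((-(u 0 ^ 2)⁻¹) • ContinuousLinearMap.proj (R := ℝ) (φ := fun _ : Fin 2 => ℝ) 0) u :=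
    (hasDerivAt_inv hρ).comp_hasFDerivAt u h0
  have hsq := h1.pow 2
  have hA := hsq.mul hinv
  have hB := h0.rpow_const (p := γ) (Or.inl hρ)
  have hcomp1 := hA.add hB
  have hfun : isentropicEulerFlux γ = fun v i => ![v 1, v 1 ^ 2 * (v 0)⁻¹ + v 0 ^ γ] i := by
    funext v i
    simp only [isentropicEulerFlux, div_eq_mul_inv]
  rw [hfun]
  refine hasFDerivAt_pi.2 fun i => ?_
  fin_cases i
  · simpa using h1
  · simp only [Fin.mk_one, Matrix.cons_val_one, Matrix.cons_val_fin_one]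
    refine hcomp1.congr_fderiv ?_
    refine ContinuousLinearMap.ext fun h => ?_
    simp
    field_simp
    ring

/-- Derivative of the physical entropy on `{ρ ≠ 0}`:
`∇η(u) = (-v²/2 + γρ^{γ-1}/(γ-1), v)`. [cite: ChenKrupaVasseur2022, Lemma 4.5 (proof)] -/
theorem hasFDerivAt_isentropicEulerEntropy (γ : ℝ) {u : Fin 2 → ℝ} (hρ : u 0 ≠ 0) :
    HasFDerivAt (isentropicEulerEntropy γ)
      ((-(u 1 ^ 2 / (2 * u 0 ^ 2)) + γ / (γ - 1) * u 0 ^ (γ - 1)) •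
          ContinuousLinearMap.proj (R := ℝ) (φ := fun _ : Fin 2 => ℝ) 0
        + (u 1 / u 0) • ContinuousLinearMap.proj (R := ℝ) (φ := fun _ : Fin 2 => ℝ) 1) u := by
  have h0 : HasFDerivAt (fun v : Fin 2 → ℝ => v 0)
      (ContinuousLinearMap.proj (R := ℝ) (φ := fun _ : Fin 2 => ℝ) 0) u := hasFDerivAt_apply 0 u
  have h1 : HasFDerivAt (fun v : Fin 2 → ℝ => v 1)
      (ContinuousLinearMap.proj (R := ℝ) (φ := fun _ : Fin 2 => ℝ) 1) u := hasFDerivAt_apply 1 u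
  have hinv : HasFDerivAt (fun v : Fin 2 → ℝ => (v 0)⁻¹)
      ((-(u 0 ^ 2)⁻¹) • ContinuousLinearMap.proj (R := ℝ) (φ := fun _ : Fin 2 => ℝ) 0) u :=
    (hasDerivAt_inv hρ).comp_hasFDerivAt u h0
  have hA := ((h1.pow 2).mul hinv).const_mul (1 / 2 : ℝ)
  have hB := (h0.rpow_const (p := γ) (Or.inl hρ)).const_mul (1 / (γ - 1))
  have hsum := hA.add hB
  have hfun : isentropicEulerEntropy γ
      = fun v => 1 / 2 * (v 1 ^ 2 * (v 0)⁻¹) + 1 / (γ - 1) * v 0 ^ γ := by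
    funext v
    simp only [isentropicEulerEntropy]
    ring
  rw [hfun]
  refine hsum.congr_fderiv (ContinuousLinearMap.ext fun h => ?_)
  simp
  field_simp
  ring

/-- Derivative of the entropy flux on `{ρ ≠ 0}` (`γ ≠ 1`):
`∇q(u) = (-v³ + γ v ρ^{γ-1}, 3v²/2 + γρ^{γ-1}/(γ-1))`.
[cite: ChenKrupaVasseur2022, Assumption 1.1 (c)] -/
theorem hasFDerivAt_isentropicEulerEntropyFlux {γ : ℝ} (hγ : γ ≠ 1) {u : Fin 2 → ℝ}
    (hρ : u 0 ≠ 0) :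
    HasFDerivAt (isentropicEulerEntropyFlux γ)
      ((-(u 1 ^ 3 / u 0 ^ 3) + γ * (u 1 / u 0) * u 0 ^ (γ - 1)) •
          ContinuousLinearMap.proj (R := ℝ) (φ := fun _ : Fin 2 => ℝ) 0
        + (3 * u 1 ^ 2 / (2 * u 0 ^ 2) + γ / (γ - 1) * u 0 ^ (γ - 1)) •
          ContinuousLinearMap.proj (R := ℝ) (φ := fun _ : Fin 2 => ℝ) 1) u := by
  have h0 : HasFDerivAt (fun v : Fin 2 → ℝ => v 0)
      (ContinuousLinearMap.proj (R := ℝ) (φ := fun _ : Fin 2 => ℝ) 0) u := hasFDerivAt_apply 0 u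
  have h1 : HasFDerivAt (fun v : Fin 2 → ℝ => v 1)
      (ContinuousLinearMap.proj (R := ℝ) (φ := fun _ : Fin 2 => ℝ) 1) u := hasFDerivAt_apply 1 u
  have hinv : HasFDerivAt (fun v : Fin 2 → ℝ => (v 0)⁻¹)
      ((-(u 0 ^ 2)⁻¹) • ContinuousLinearMap.proj (R := ℝ) (φ := fun _ : Fin 2 => ℝ) 0) u :=
    (hasDerivAt_inv hρ).comp_hasFDerivAt u h0
  -- `v ↦ u₂/u₁`
  have hv := h1.mul hinv
  -- `v ↦ η-like bracket`
  have hA := ((h1.pow 2).mul hinv).const_mul (1 / 2 : ℝ)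
  have hB := (h0.rpow_const (p := γ) (Or.inl hρ)).const_mul (γ / (γ - 1))
  have hbr := hA.add hB
  have hprod := hv.mul hbr
  have hfun : isentropicEulerEntropyFlux γ
      = fun v => (v 1 * (v 0)⁻¹) * (1 / 2 * (v 1 ^ 2 * (v 0)⁻¹) + γ / (γ - 1) * v 0 ^ γ) := by
    funext v
    simp only [isentropicEulerEntropyFlux]
    ring
  rw [hfun]
  have hγ' : γ - 1 ≠ 0 := sub_ne_zero.2 hγ
  refine hprod.congr_fderiv (ContinuousLinearMap.ext fun h => ?_)
  simp
  rw [Real.rpow_sub_one hρ]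
  field_simp
  ring

/-- **Lemma 4.5, Assumption 1.1 (c): `q' = η' f'`** — the physical entropy and its flux form an
entropy pair of the isentropic Euler system (`γ ≠ 1`) on `{ρ ≠ 0} ⊇ 𝒱`:
`Dq(u) = Dη(u) ∘ Df(u)`. [cite: ChenKrupaVasseur2022, Assumption 1.1 (c) and Lemma 4.5] -/
theorem fderiv_isentropicEulerEntropyFlux_eq_comp {γ : ℝ} (hγ : γ ≠ 1) {u : Fin 2 → ℝ}
    (hρ : u 0 ≠ 0) :
    fderiv ℝ (isentropicEulerEntropyFlux γ) u
      = (fderiv ℝ (isentropicEulerEntropy γ) u).comp (fderiv ℝ (isentropicEulerFlux γ) u) := by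
  rw [(hasFDerivAt_isentropicEulerEntropyFlux hγ hρ).fderiv,
    (hasFDerivAt_isentropicEulerEntropy γ hρ).fderiv, (hasFDerivAt_isentropicEulerFlux γ hρ).fderiv]
  have hγ' : γ - 1 ≠ 0 := sub_ne_zero.2 hγ
  refine ContinuousLinearMap.ext fun h => ?_
  simp
  rw [Real.rpow_sub_one hρ]
  field_simp
  ring

end EntropyPair

/-! ## Lemma 4.5 (c): strict convexity of `η` on `{ρ > 0}` and continuity on `𝒰₀` -/

/-- **Lemma 4.5, Assumption 1.1 (c): `η` is strictly convex** on `{ρ > 0} ⊇ 𝒱` for `γ > 1`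
(`u₂²/(2u₁)` is convex and strictly convex along `u₁ = const`, `u₁^γ/(γ-1)` is convex and strictly
convex across `u₁ ≠ const`). [cite: ChenKrupaVasseur2022, Assumption 1.1 (c) and Lemma 4.5] -/
theorem strictConvexOn_isentropicEulerEntropy (hγ : 1 < γ) :
    StrictConvexOn ℝ {u : Fin 2 → ℝ | 0 < u 0} (isentropicEulerEntropy γ) := by
  refine ⟨convex_posDensity, ?_⟩
  intro x hx y hy hxy a b ha hb hab
  have hx0 : 0 < x 0 := hx
  have hy0 : 0 < y 0 := hy
  have hγ1 : 0 < γ - 1 := by linarith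
  have hsq := (convexOn_sq_div_posDensity).2 hx hy ha.le hb.le hab
  have hrp := (convexOn_rpow_posDensity hγ.le).2 hx hy ha.le hb.le hab
  simp only [smul_eq_mul, Pi.add_apply, Pi.smul_apply] at hsq hrp
  simp only [isentropicEulerEntropy, smul_eq_mul, Pi.add_apply, Pi.smul_apply]
  set D := a * x 0 + b * y 0 with hD
  have hDpos : 0 < D := by positivity
  have eL : (a * x 1 + b * y 1) ^ 2 / (2 * D) + D ^ γ / (γ - 1)
      = 1 / 2 * ((a * x 1 + b * y 1) ^ 2 / D) + 1 / (γ - 1) * D ^ γ := by ring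
  have eR : a * (x 1 ^ 2 / (2 * x 0) + x 0 ^ γ / (γ - 1)) + b * (y 1 ^ 2 / (2 * y 0) + y 0 ^ γ / (γ - 1))
      = 1 / 2 * (a * (x 1 ^ 2 / x 0) + b * (y 1 ^ 2 / y 0))
        + 1 / (γ - 1) * (a * x 0 ^ γ + b * y 0 ^ γ) := by ring
  rw [eL, eR]
  have h2 : (0 : ℝ) < 1 / 2 := by norm_num
  have h3 : 0 < 1 / (γ - 1) := by positivity
  by_cases h0 : x 0 = y 0
  · have h1 : x 1 ≠ y 1 := by
      intro h1
      apply hxy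
      funext i
      fin_cases i
      · exact h0
      · exact h1
    have hDx : D = x 0 := by rw [hD, ← h0, ← add_mul, hab, one_mul]
    have key : (a * x 1 + b * y 1) ^ 2 < a * x 1 ^ 2 + b * y 1 ^ 2 := by
      have hne : x 1 - y 1 ≠ 0 := sub_ne_zero.2 h1
      have hpos : 0 < a * b * (x 1 - y 1) ^ 2 := by positivity
      nlinarith [hpos, hab]
    have hS : (a * x 1 + b * y 1) ^ 2 / D < a * (x 1 ^ 2 / x 0) + b * (y 1 ^ 2 / y 0) := by
      rw [hDx, ← h0]
      have : a * (x 1 ^ 2 / x 0) + b * (y 1 ^ 2 / x 0) = (a * x 1 ^ 2 + b * y 1 ^ 2) / x 0 := by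
        ring
      rw [this]
      exact div_lt_div_of_pos_right key hx0
    nlinarith [mul_lt_mul_of_pos_left hS h2, mul_le_mul_of_nonneg_left hrp h3.le]
  · have hR : D ^ γ < a * x 0 ^ γ + b * y 0 ^ γ := by
      have := (strictConvexOn_rpow hγ).2 (Set.mem_Ici.2 hx0.le) (Set.mem_Ici.2 hy0.le) h0 ha hb
        hab
      simpa [smul_eq_mul] using this
    nlinarith [mul_le_mul_of_nonneg_left hsq h2.le, mul_lt_mul_of_pos_left hR h3]

/-- A function on states vanishing at the vacuum and bounded by `K ρ` on `𝒱` near the vacuum is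
continuous at the vacuum within `𝒰₀ = 𝒱 ∪ {0}`. [folklore] -/
theorem continuousWithinAt_vacuum_of_le {E : Type*} [NormedAddCommGroup E]
    {g : (Fin 2 → ℝ) → E} {K : ℝ} (hK : 0 ≤ K) (hg0 : g 0 = 0)
    (hb : ∀ u ∈ isentropicEulerInterior γ C, u 0 ≤ 1 → ‖g u‖ ≤ K * u 0) :
    ContinuousWithinAt g (isentropicEulerStates γ C) 0 := by
  rw [Metric.continuousWithinAt_iff]
  intro ε hε
  refine ⟨min 1 (ε / (K + 1)), lt_min one_pos (by positivity), fun u hu hdist => ?_⟩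
  rw [dist_zero_right] at hdist
  rw [hg0, dist_zero_right]
  rcases hu with hu | hu
  · have hρ : 0 < u 0 := hu.1
    have hρle : u 0 ≤ ‖u‖ := by
      have := norm_le_pi_norm u 0
      rwa [Real.norm_eq_abs, abs_of_pos hρ] at this
    have hρ1 : u 0 ≤ 1 := (hρle.trans hdist.le).trans (min_le_left _ _)
    have hρε : u 0 < ε / (K + 1) := lt_of_le_of_lt hρle (lt_of_lt_of_le hdist (min_le_right _ _))
    calc ‖g u‖ ≤ K * u 0 := hb u hu hρ1
      _ ≤ K * (ε / (K + 1)) := mul_le_mul_of_nonneg_left hρε.le hK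
      _ < ε := by
        rw [mul_div_assoc', div_lt_iff₀ (by positivity)]
        nlinarith
  · rw [mem_singleton_iff] at hu
    subst hu
    simpa [hg0] using hε

/-- For `0 < ρ ≤ 1` and `γ ≥ 1`: `ρ^γ ≤ ρ`. [folklore] -/
theorem rpow_le_self_of_density_le_one (hγ : 1 ≤ γ) {ρ : ℝ} (hρ : 0 < ρ) (hρ1 : ρ ≤ 1) :
    ρ ^ γ ≤ ρ :=
  Real.rpow_le_self_of_le_one hρ.le hρ1 hγ

/-- **`f, η, q ∈ C(𝒰₀)`** (standing hypothesis of §1 and Assumption 1.1 (c) for isentropic Euler,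
`γ > 1`): the flux, the physical entropy and its flux are continuous on the state set
`𝒰₀ = 𝒱 ∪ {0}`, including at the vacuum, where all three vanish (on `𝒱`, near the vacuum,
`‖f(u)‖ ≤ (C + C² + 1)ρ`, `|η(u)| ≤ (C²/2 + 1/(γ-1))ρ`, `|q(u)| ≤ C(C²/2 + γ/(γ-1))ρ`).
[cite: ChenKrupaVasseur2022, §1 (before Assumption 1.1) and Lemma 4.5] -/
theorem continuousOn_isentropicEuler_states (hγ : 1 < γ) :
    ContinuousOn (isentropicEulerFlux γ) (isentropicEulerStates γ C) ∧
      ContinuousOn (isentropicEulerEntropy γ) (isentropicEulerStates γ C) ∧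
      ContinuousOn (isentropicEulerEntropyFlux γ) (isentropicEulerStates γ C) := by
  have hγ1 : 0 < γ - 1 := by linarith
  have hγne : γ ≠ 1 := by intro h; linarith
  obtain ⟨hf0, hη0, hq0⟩ := isentropicEuler_vacuum γ hγ
  -- elementary identities on `𝒱`
  have ids : ∀ u ∈ isentropicEulerInterior γ C,
      isentropicEulerFlux γ u 0 = u 0 * (u 1 / u 0) ∧
      isentropicEulerFlux γ u 1 = u 0 * (u 1 / u 0) ^ 2 + (u 0) ^ γ ∧
      isentropicEulerEntropy γ u = u 0 * (u 1 / u 0) ^ 2 / 2 + (u 0) ^ γ / (γ - 1) ∧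
      isentropicEulerEntropyFlux γ u
        = (u 1 / u 0) * (u 0 * (u 1 / u 0) ^ 2 / 2 + γ / (γ - 1) * (u 0) ^ γ) := by
    intro u hu
    have hρ : u 0 ≠ 0 := ne_of_gt hu.1
    refine ⟨?_, ?_, ?_, ?_⟩
    · simp only [isentropicEulerFlux, Matrix.cons_val_zero]; field_simp
    · simp only [isentropicEulerFlux, Matrix.cons_val_one, Matrix.cons_val_fin_one]; field_simp
    · unfold isentropicEulerEntropy; field_simp
    · unfold isentropicEulerEntropyFlux; field_simp
  -- case split: interior point (differentiable) or vacuum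
  refine ⟨fun u hu => ?_, fun u hu => ?_, fun u hu => ?_⟩
  · rcases hu with hu | hu
    · exact (hasFDerivAt_isentropicEulerFlux γ (ne_of_gt hu.1)).continuousAt.continuousWithinAt
    · rw [mem_singleton_iff] at hu
      subst hu
      refine continuousWithinAt_vacuum_of_le (K := C + C ^ 2 + 1)
        (by nlinarith [sq_nonneg (C + 1 / 2)]) hf0 fun u hu hρ1 => ?_
      · have hρ : 0 < u 0 := hu.1
        have hC : 0 < C := by
          by_contra h
          rw [isentropicEulerInterior_eq_empty hγ (not_lt.1 h)] at hu
          exact hu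
        obtain ⟨hv, -⟩ := abs_vel_lt_of_mem_isentropicEulerInterior hγ hu
        obtain ⟨e0, e1, -, -⟩ := ids u hu
        have hργ : (u 0) ^ γ ≤ u 0 := rpow_le_self_of_density_le_one hγ.le hρ hρ1
        have hv2 : (u 1 / u 0) ^ 2 ≤ C ^ 2 := by
          have := abs_lt.1 hv; nlinarith [sq_abs (u 1 / u 0)]
        refine (pi_norm_le_iff_of_nonneg (by positivity)).2 (Fin.forall_fin_two.2 ⟨?_, ?_⟩)
        · rw [e0, Real.norm_eq_abs, abs_mul, abs_of_pos hρ]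
          nlinarith [abs_nonneg (u 1 / u 0), mul_le_mul_of_nonneg_left hv.le hρ.le]
        · rw [e1, Real.norm_eq_abs, abs_of_nonneg (by positivity)]
          nlinarith [mul_le_mul_of_nonneg_left hv2 hρ.le]
  · rcases hu with hu | hu
    · exact (hasFDerivAt_isentropicEulerEntropy γ (ne_of_gt hu.1)).continuousAt.continuousWithinAt
    · rw [mem_singleton_iff] at hu
      subst hu
      refine continuousWithinAt_vacuum_of_le (K := C ^ 2 / 2 + 1 / (γ - 1)) (by positivity) hη0
        fun u hu hρ1 => ?_
      have hρ : 0 < u 0 := hu.1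
      obtain ⟨hv, -⟩ := abs_vel_lt_of_mem_isentropicEulerInterior hγ hu
      obtain ⟨-, -, eη, -⟩ := ids u hu
      have hργ : (u 0) ^ γ ≤ u 0 := rpow_le_self_of_density_le_one hγ.le hρ hρ1
      have hv2 : (u 1 / u 0) ^ 2 ≤ C ^ 2 := by
        have := abs_lt.1 hv; nlinarith [sq_abs (u 1 / u 0)]
      rw [eη, Real.norm_eq_abs, abs_of_nonneg (by positivity)]
      have : (u 0) ^ γ / (γ - 1) ≤ u 0 / (γ - 1) := div_le_div_of_nonneg_right hργ hγ1.le
      have e : (C ^ 2 / 2 + 1 / (γ - 1)) * u 0 = u 0 * C ^ 2 / 2 + u 0 / (γ - 1) := by ring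
      rw [e]
      nlinarith [mul_le_mul_of_nonneg_left hv2 hρ.le]
  · rcases hu with hu | hu
    · exact (hasFDerivAt_isentropicEulerEntropyFlux hγne
        (ne_of_gt hu.1)).continuousAt.continuousWithinAt
    · rw [mem_singleton_iff] at hu
      subst hu
      refine continuousWithinAt_vacuum_of_le (K := |C| * (C ^ 2 / 2 + γ / (γ - 1)))
        (by positivity) hq0 fun u hu hρ1 => ?_
      have hρ : 0 < u 0 := hu.1
      have hC : 0 < C := by
        by_contra h
        rw [isentropicEulerInterior_eq_empty hγ (not_lt.1 h)] at hu
        exact hu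
      obtain ⟨hv, -⟩ := abs_vel_lt_of_mem_isentropicEulerInterior hγ hu
      obtain ⟨-, -, -, eq'⟩ := ids u hu
      have hργ : (u 0) ^ γ ≤ u 0 := rpow_le_self_of_density_le_one hγ.le hρ hρ1
      have hv2 : (u 1 / u 0) ^ 2 ≤ C ^ 2 := by
        have := abs_lt.1 hv; nlinarith [sq_abs (u 1 / u 0)]
      rw [eq', Real.norm_eq_abs, abs_mul, abs_of_pos hC]
      have hin : 0 ≤ u 0 * (u 1 / u 0) ^ 2 / 2 + γ / (γ - 1) * (u 0) ^ γ := by positivity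
      rw [abs_of_nonneg hin]
      have hγ' : 0 ≤ γ / (γ - 1) := by positivity
      have h2 : u 0 * (u 1 / u 0) ^ 2 / 2 + γ / (γ - 1) * (u 0) ^ γ
          ≤ (C ^ 2 / 2 + γ / (γ - 1)) * u 0 := by
        nlinarith [mul_le_mul_of_nonneg_left hv2 hρ.le, mul_le_mul_of_nonneg_left hργ hγ']
      calc |u 1 / u 0| * (u 0 * (u 1 / u 0) ^ 2 / 2 + γ / (γ - 1) * u 0 ^ γ)
          ≤ C * ((C ^ 2 / 2 + γ / (γ - 1)) * u 0) := mul_le_mul hv.le h2 hin hC.le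
        _ = C * (C ^ 2 / 2 + γ / (γ - 1)) * u 0 := by ring

/-! ## Lemma 4.5 (a), (b): strict hyperbolicity and genuine nonlinearity on `{ρ > 0}` -/

section Hyperbolicity

/-- `(√γ ρ^{(γ-1)/2})² = γ ρ^{γ-1}` for `ρ > 0`, `γ ≥ 0` (sound speed squared). [folklore] -/
theorem sq_soundSpeed {γ ρ : ℝ} (hγ : 0 ≤ γ) (hρ : 0 < ρ) :
    (Real.sqrt γ * ρ ^ ((γ - 1) / 2)) ^ 2 = γ * ρ ^ (γ - 1) := by
  rw [mul_pow, Real.sq_sqrt hγ, ← Real.rpow_natCast, ← Real.rpow_mul hρ.le]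
  congr 1
  norm_num

/-- **Lemma 4.5, Assumption 1.1 (a) (eigen-structure of `Df`).** On `{ρ > 0}` the derivative
`Df(u) = [[0,1],[-v²+γρ^{γ-1}, 2v]]` of the isentropic Euler flux has the eigenvalue
`λ₋ = v - √γ ρ^{(γ-1)/2}` with eigenvector `r₋ = (1, λ₋)` ("the eigenvalues of `f'` are given by the
formula `λ± = v ± √(γρ^{γ−1})`"). [cite: ChenKrupaVasseur2022, Lemma 4.5 (proof)] -/
theorem hasEigenvector_fderiv_isentropicEulerFlux_minus {γ : ℝ} (hγ : 0 ≤ γ) {u : Fin 2 → ℝ}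
    (hρ : 0 < u 0) :
    Module.End.HasEigenvector (fderiv ℝ (isentropicEulerFlux γ) u).toLinearMap
      (u 1 / u 0 - Real.sqrt γ * (u 0) ^ ((γ - 1) / 2))
      ![1, u 1 / u 0 - Real.sqrt γ * (u 0) ^ ((γ - 1) / 2)] := by
  refine ⟨Module.End.mem_eigenspace_iff.2 ?_, fun h => by simpa using congr_fun h 0⟩
  rw [(hasFDerivAt_isentropicEulerFlux γ hρ.ne').fderiv]
  have hc := sq_soundSpeed hγ hρ
  set c := Real.sqrt γ * (u 0) ^ ((γ - 1) / 2) with hcdef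
  have hρ' : u 0 ≠ 0 := hρ.ne'
  ext i
  fin_cases i
  · simp
  · simp
    rw [← hc]
    field_simp
    ring

/-- **Lemma 4.5, Assumption 1.1 (a) (eigen-structure of `Df`).** The eigenvalue
`λ₊ = v + √γ ρ^{(γ-1)/2}` with eigenvector `r₊ = (1, λ₊)`.
[cite: ChenKrupaVasseur2022, Lemma 4.5 (proof)] -/
theorem hasEigenvector_fderiv_isentropicEulerFlux_plus {γ : ℝ} (hγ : 0 ≤ γ) {u : Fin 2 → ℝ}
    (hρ : 0 < u 0) :
    Module.End.HasEigenvector (fderiv ℝ (isentropicEulerFlux γ) u).toLinearMap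
      (u 1 / u 0 + Real.sqrt γ * (u 0) ^ ((γ - 1) / 2))
      ![1, u 1 / u 0 + Real.sqrt γ * (u 0) ^ ((γ - 1) / 2)] := by
  refine ⟨Module.End.mem_eigenspace_iff.2 ?_, fun h => by simpa using congr_fun h 0⟩
  rw [(hasFDerivAt_isentropicEulerFlux γ hρ.ne').fderiv]
  have hc := sq_soundSpeed hγ hρ
  set c := Real.sqrt γ * (u 0) ^ ((γ - 1) / 2) with hcdef
  have hρ' : u 0 ≠ 0 := hρ.ne'
  ext i
  fin_cases i
  · simp
  · simp
    rw [← hc]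
    field_simp
    ring

/-- **Lemma 4.5, Assumption 1.1 (a): strict hyperbolicity** of isentropic Euler on `{ρ > 0} ⊇ 𝒱`
(`γ > 0`): `λ₋(u) = v - √γρ^{(γ-1)/2} < λ₊(u) = v + √γρ^{(γ-1)/2}`, both eigenvalues of `Df(u)`.
[cite: ChenKrupaVasseur2022, Assumption 1.1 (a) and Lemma 4.5] -/
theorem strictHyperbolic_isentropicEuler {γ : ℝ} (hγ : 0 < γ) {u : Fin 2 → ℝ} (hρ : 0 < u 0) :
    Module.End.HasEigenvalue (fderiv ℝ (isentropicEulerFlux γ) u).toLinearMap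
        (u 1 / u 0 - Real.sqrt γ * (u 0) ^ ((γ - 1) / 2)) ∧
      Module.End.HasEigenvalue (fderiv ℝ (isentropicEulerFlux γ) u).toLinearMap
        (u 1 / u 0 + Real.sqrt γ * (u 0) ^ ((γ - 1) / 2)) ∧
      u 1 / u 0 - Real.sqrt γ * (u 0) ^ ((γ - 1) / 2)
        < u 1 / u 0 + Real.sqrt γ * (u 0) ^ ((γ - 1) / 2) := by
  have hc : 0 < Real.sqrt γ * (u 0) ^ ((γ - 1) / 2) :=
    mul_pos (Real.sqrt_pos.2 hγ) (Real.rpow_pos_of_pos hρ _)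
  exact ⟨Module.End.hasEigenvalue_of_hasEigenvector
      (hasEigenvector_fderiv_isentropicEulerFlux_minus hγ.le hρ),
    Module.End.hasEigenvalue_of_hasEigenvector
      (hasEigenvector_fderiv_isentropicEulerFlux_plus hγ.le hρ), by linarith⟩

/-- Derivative of the characteristic speed `λ₊(u) = u₂/u₁ + √γ u₁^{(γ-1)/2}` on `{ρ ≠ 0}`.
[folklore] -/
theorem hasFDerivAt_charSpeed_plus (γ : ℝ) {u : Fin 2 → ℝ} (hρ : u 0 ≠ 0) :
    HasFDerivAt (fun w : Fin 2 → ℝ => w 1 / w 0 + Real.sqrt γ * (w 0) ^ ((γ - 1) / 2))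
      ((-(u 1 / u 0 ^ 2) + Real.sqrt γ * ((γ - 1) / 2) * (u 0) ^ ((γ - 1) / 2 - 1)) •
          ContinuousLinearMap.proj (R := ℝ) (φ := fun _ : Fin 2 => ℝ) 0
        + (1 / u 0) • ContinuousLinearMap.proj (R := ℝ) (φ := fun _ : Fin 2 => ℝ) 1) u := by
  have h0 : HasFDerivAt (fun v : Fin 2 → ℝ => v 0)
      (ContinuousLinearMap.proj (R := ℝ) (φ := fun _ : Fin 2 => ℝ) 0) u := hasFDerivAt_apply 0 u
  have h1 : HasFDerivAt (fun v : Fin 2 → ℝ => v 1)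
      (ContinuousLinearMap.proj (R := ℝ) (φ := fun _ : Fin 2 => ℝ) 1) u := hasFDerivAt_apply 1 u
  have hinv : HasFDerivAt (fun v : Fin 2 → ℝ => (v 0)⁻¹)
      ((-(u 0 ^ 2)⁻¹) • ContinuousLinearMap.proj (R := ℝ) (φ := fun _ : Fin 2 => ℝ) 0) u :=
    (hasDerivAt_inv hρ).comp_hasFDerivAt u h0
  have hv := h1.mul hinv
  have hB := (h0.rpow_const (p := (γ - 1) / 2) (Or.inl hρ)).const_mul (Real.sqrt γ)
  have hsum := hv.add hB
  have hfun : (fun w : Fin 2 → ℝ => w 1 / w 0 + Real.sqrt γ * (w 0) ^ ((γ - 1) / 2))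
      = fun w => w 1 * (w 0)⁻¹ + Real.sqrt γ * (w 0) ^ ((γ - 1) / 2) := by
    funext w; rw [div_eq_mul_inv]
  rw [hfun]
  refine hsum.congr_fderiv (ContinuousLinearMap.ext fun h => ?_)
  simp
  field_simp
  ring

/-- Derivative of the characteristic speed `λ₋(u) = u₂/u₁ - √γ u₁^{(γ-1)/2}` on `{ρ ≠ 0}`.
[folklore] -/
theorem hasFDerivAt_charSpeed_minus (γ : ℝ) {u : Fin 2 → ℝ} (hρ : u 0 ≠ 0) :
    HasFDerivAt (fun w : Fin 2 → ℝ => w 1 / w 0 - Real.sqrt γ * (w 0) ^ ((γ - 1) / 2))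
      ((-(u 1 / u 0 ^ 2) - Real.sqrt γ * ((γ - 1) / 2) * (u 0) ^ ((γ - 1) / 2 - 1)) •
          ContinuousLinearMap.proj (R := ℝ) (φ := fun _ : Fin 2 => ℝ) 0
        + (1 / u 0) • ContinuousLinearMap.proj (R := ℝ) (φ := fun _ : Fin 2 => ℝ) 1) u := by
  have h0 : HasFDerivAt (fun v : Fin 2 → ℝ => v 0)
      (ContinuousLinearMap.proj (R := ℝ) (φ := fun _ : Fin 2 => ℝ) 0) u := hasFDerivAt_apply 0 u
  have h1 : HasFDerivAt (fun v : Fin 2 → ℝ => v 1)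
      (ContinuousLinearMap.proj (R := ℝ) (φ := fun _ : Fin 2 => ℝ) 1) u := hasFDerivAt_apply 1 u
  have hinv : HasFDerivAt (fun v : Fin 2 → ℝ => (v 0)⁻¹)
      ((-(u 0 ^ 2)⁻¹) • ContinuousLinearMap.proj (R := ℝ) (φ := fun _ : Fin 2 => ℝ) 0) u :=
    (hasDerivAt_inv hρ).comp_hasFDerivAt u h0
  have hv := h1.mul hinv
  have hB := (h0.rpow_const (p := (γ - 1) / 2) (Or.inl hρ)).const_mul (Real.sqrt γ)
  have hsum := hv.sub hB
  have hfun : (fun w : Fin 2 → ℝ => w 1 / w 0 - Real.sqrt γ * (w 0) ^ ((γ - 1) / 2))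
      = fun w => w 1 * (w 0)⁻¹ - Real.sqrt γ * (w 0) ^ ((γ - 1) / 2) := by
    funext w; rw [div_eq_mul_inv]
  rw [hfun]
  refine hsum.congr_fderiv (ContinuousLinearMap.ext fun h => ?_)
  simp
  field_simp
  ring

/-- **Lemma 4.5, Assumption 1.1 (b): genuine nonlinearity** of both characteristic families of
isentropic Euler on `{ρ > 0} ⊇ 𝒱` (`γ > 0`): `∇λ±(u) · r±(u) = ± √γ (γ+1)/2 · ρ^{(γ-1)/2 - 1} ≠ 0`
for the eigenvectors `r± = (1, λ±)` of `Df(u)`.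
[cite: ChenKrupaVasseur2022, Assumption 1.1 (b) and Lemma 4.5] -/
theorem genuinelyNonlinear_isentropicEuler {γ : ℝ} (hγ : 0 < γ) {u : Fin 2 → ℝ} (hρ : 0 < u 0) :
    fderiv ℝ (fun w : Fin 2 → ℝ => w 1 / w 0 + Real.sqrt γ * (w 0) ^ ((γ - 1) / 2)) u
        ![1, u 1 / u 0 + Real.sqrt γ * (u 0) ^ ((γ - 1) / 2)]
        = Real.sqrt γ * ((γ + 1) / 2) * (u 0) ^ ((γ - 1) / 2 - 1) ∧
      fderiv ℝ (fun w : Fin 2 → ℝ => w 1 / w 0 - Real.sqrt γ * (w 0) ^ ((γ - 1) / 2)) u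
        ![1, u 1 / u 0 - Real.sqrt γ * (u 0) ^ ((γ - 1) / 2)]
        = -(Real.sqrt γ * ((γ + 1) / 2) * (u 0) ^ ((γ - 1) / 2 - 1)) ∧
      Real.sqrt γ * ((γ + 1) / 2) * (u 0) ^ ((γ - 1) / 2 - 1) ≠ 0 := by
  have hρ' : u 0 ≠ 0 := hρ.ne'
  have hpow : (u 0) ^ ((γ - 1) / 2) = (u 0) ^ ((γ - 1) / 2 - 1) * u 0 := by
    rw [Real.rpow_sub_one hρ']; field_simp
  refine ⟨?_, ?_, ?_⟩
  · rw [(hasFDerivAt_charSpeed_plus γ hρ').fderiv]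
    simp
    rw [hpow]
    field_simp
    ring
  · rw [(hasFDerivAt_charSpeed_minus γ hρ').fderiv]
    simp
    rw [hpow]
    field_simp
    ring
  · exact mul_ne_zero (mul_ne_zero (Real.sqrt_pos.2 hγ).ne' (by positivity))
      (Real.rpow_pos_of_pos hρ _).ne'

end Hyperbolicity

/-! ## §3: the relative entropy `η(u|v) = η(u) - η(v) - ∇η(v)(u - v)` is positive definite -/

section RelativeEntropy

/-- **Relative entropy of the vacuum** with respect to a state `v` with `ρ > 0` (`γ > 1`):
`η(0|v) = -η(v) + ∇η(v)·v = ρ_v^γ` (the pressure at `v`), in particular it is positive.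
[cite: ChenKrupaVasseur2022, §3 (relative entropy)] -/
theorem relEntropy_isentropicEuler_vacuum {γ : ℝ} (hγ : 1 < γ) {v : Fin 2 → ℝ} (hρ : v 0 ≠ 0) :
    isentropicEulerEntropy γ 0 - isentropicEulerEntropy γ v
      - fderiv ℝ (isentropicEulerEntropy γ) v (0 - v) = (v 0) ^ γ := by
  have hγ' : γ - 1 ≠ 0 := by intro h; linarith
  have hγ0 : γ ≠ 0 := by intro h; linarith
  rw [(hasFDerivAt_isentropicEulerEntropy γ hρ).fderiv]
  simp [isentropicEulerEntropy]
  rw [Real.rpow_sub_one hρ, Real.zero_rpow hγ0]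
  field_simp
  ring

/-- The restriction of a strictly convex function to a nondegenerate segment is strictly convex
(on the parameter set where the segment stays in the domain). [folklore] -/
theorem strictConvexOn_comp_lineMap {E : Type*} [AddCommGroup E] [Module ℝ E] {s : Set E}
    {g : E → ℝ} (hg : StrictConvexOn ℝ s g) {v w : E} (hvw : v ≠ w) :
    StrictConvexOn ℝ {t : ℝ | v + t • (w - v) ∈ s} (fun t => g (v + t • (w - v))) := by
  have hconv : Convex ℝ {t : ℝ | v + t • (w - v) ∈ s} := by
    intro t₁ h₁ t₂ h₂ a b ha hb hab
    have e : v + (a • t₁ + b • t₂) • (w - v) = a • (v + t₁ • (w - v)) + b • (v + t₂ • (w - v)) := by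
      simp only [smul_eq_mul]
      rw [show v + (a * t₁ + b * t₂) • (w - v)
          = (a + b) • v + (a * t₁) • (w - v) + (b * t₂) • (w - v) by
            rw [hab, one_smul, add_smul, add_assoc]]
      rw [add_smul, mul_smul, mul_smul, smul_add, smul_add]
      abel
    show v + (a • t₁ + b • t₂) • (w - v) ∈ s
    rw [e]
    exact hg.1 h₁ h₂ ha hb hab
  refine ⟨hconv, ?_⟩
  intro t₁ h₁ t₂ h₂ ht a b ha hb hab
  have hne : v + t₁ • (w - v) ≠ v + t₂ • (w - v) := by
    intro h
    have h' : (t₁ - t₂) • (w - v) = 0 := by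
      rw [sub_smul]; exact sub_eq_zero.2 (add_left_cancel h)
    rcases smul_eq_zero.1 h' with h'' | h''
    · exact ht (sub_eq_zero.1 h'')
    · exact hvw (sub_eq_zero.1 h'').symm
  have e : v + (a • t₁ + b • t₂) • (w - v) = a • (v + t₁ • (w - v)) + b • (v + t₂ • (w - v)) := by
    simp only [smul_eq_mul]
    rw [show v + (a * t₁ + b * t₂) • (w - v)
        = (a + b) • v + (a * t₁) • (w - v) + (b * t₂) • (w - v) by
          rw [hab, one_smul, add_smul, add_assoc]]
    rw [add_smul, mul_smul, mul_smul, smul_add, smul_add]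
    abel
  show g (v + (a • t₁ + b • t₂) • (w - v)) < a • g (v + t₁ • (w - v)) + b • g (v + t₂ • (w - v))
  rw [e]
  exact hg.2 h₁ h₂ hne ha hb hab

/-- **Strict supporting-hyperplane inequality** for a strictly convex function differentiable at
`v`: `g(w) > g(v) + Dg(v)(w - v)` for `w ≠ v` in the (convex) domain.
[folklore] -/
theorem strictConvexOn_lt_of_hasFDerivAt {E : Type*} [NormedAddCommGroup E] [NormedSpace ℝ E]
    {s : Set E} {g : E → ℝ} (hg : StrictConvexOn ℝ s g) {v w : E} (hv : v ∈ s) (hw : w ∈ s)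
    (hvw : v ≠ w) {g' : E →L[ℝ] ℝ} (hd : HasFDerivAt g g' v) :
    g v + g' (w - v) < g w := by
  have hline := strictConvexOn_comp_lineMap hg hvw
  have h0 : (0 : ℝ) ∈ {t : ℝ | v + t • (w - v) ∈ s} := by simpa using hv
  have h1 : (1 : ℝ) ∈ {t : ℝ | v + t • (w - v) ∈ s} := by simpa using hw
  -- derivative of the restriction at `t = 0`
  have hγ : HasDerivAt (fun t : ℝ => v + t • (w - v)) (w - v) 0 := by
    simpa using ((hasDerivAt_id (0 : ℝ)).smul_const (w - v)).const_add v
  have hcomp : HasDerivAt (fun t : ℝ => g (v + t • (w - v))) (g' (w - v)) 0 := by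
    have hd' : HasFDerivAt g g' (v + (0 : ℝ) • (w - v)) := by simpa using hd
    exact hd'.comp_hasDerivAt 0 hγ
  have hlt := hline.lt_slope_of_hasDerivAt h0 h1 one_pos hcomp
  rw [slope_def_field] at hlt
  simp only [zero_smul, add_zero, one_smul, add_sub_cancel, sub_zero, div_one] at hlt
  linarith

/-- **Positivity of the relative entropy** (§3: "`η(a|b)` … is equivalent to `|a-b|²`", the
qualitative part of Lemma 3.1) for isentropic Euler, `γ > 1`: for a state `v` with `ρ_v > 0` and
any state `u ≠ v` of `{ρ > 0} ∪ {vacuum} ⊇ 𝒰₀`,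
`η(u|v) = η(u) - η(v) - ∇η(v)(u - v) > 0`. [cite: ChenKrupaVasseur2022, §3 and Lemma 3.1] -/
theorem relEntropy_isentropicEuler_pos (hγ : 1 < γ) {u v : Fin 2 → ℝ} (hv : 0 < v 0)
    (hu : 0 < u 0 ∨ u = 0) (huv : u ≠ v) :
    0 < isentropicEulerEntropy γ u - isentropicEulerEntropy γ v
      - fderiv ℝ (isentropicEulerEntropy γ) v (u - v) := by
  rcases hu with hu | hu
  · have key := strictConvexOn_lt_of_hasFDerivAt (strictConvexOn_isentropicEulerEntropy hγ)
      (show v ∈ {u : Fin 2 → ℝ | 0 < u 0} from hv) (show u ∈ {u : Fin 2 → ℝ | 0 < u 0} from hu)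
      (Ne.symm huv) (hasFDerivAt_isentropicEulerEntropy γ hv.ne')
    rw [(hasFDerivAt_isentropicEulerEntropy γ hv.ne').fderiv]
    linarith
  · subst hu
    rw [relEntropy_isentropicEuler_vacuum hγ hv.ne']
    exact Real.rpow_pos_of_pos hv _

/-- The relative entropy is nonnegative on `({ρ > 0} ∪ {vacuum}) × {ρ > 0}` and vanishes only on
the diagonal (`γ > 1`). [cite: ChenKrupaVasseur2022, §3 and Lemma 3.1] -/
theorem relEntropy_isentropicEuler_nonneg (hγ : 1 < γ) {u v : Fin 2 → ℝ} (hv : 0 < v 0)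
    (hu : 0 < u 0 ∨ u = 0) :
    0 ≤ isentropicEulerEntropy γ u - isentropicEulerEntropy γ v
      - fderiv ℝ (isentropicEulerEntropy γ) v (u - v) ∧
    (isentropicEulerEntropy γ u - isentropicEulerEntropy γ v
      - fderiv ℝ (isentropicEulerEntropy γ) v (u - v) = 0 ↔ u = v) := by
  by_cases huv : u = v
  · subst huv
    simp
  · have h := relEntropy_isentropicEuler_pos hγ hv hu huv
    exact ⟨h.le, ⟨fun h0 => absurd h0 h.ne', fun h' => absurd h' huv⟩⟩

end RelativeEntropy

/-! ## Assumption 1.1 (c) continued: the Hessian of `η` ("`η''` is positive", proof of Lemma 4.2) -/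

section Hessian

/-- Directional derivative of the physical entropy along a line `s ↦ v + s e`: at any `t` with
`ρ(v + te) ≠ 0`, `d/ds η(v + s e)|ₜ = ∇η(v + te) · e`. [folklore] -/
theorem hasDerivAt_isentropicEulerEntropy_line (γ : ℝ) (v e : Fin 2 → ℝ) {t : ℝ}
    (hρ : (v + t • e) 0 ≠ 0) :
    HasDerivAt (fun s : ℝ => isentropicEulerEntropy γ (v + s • e))
      (fderiv ℝ (isentropicEulerEntropy γ) (v + t • e) e) t := by
  have hline : HasDerivAt (fun s : ℝ => v + s • e) e t := by
    simpa using ((hasDerivAt_id t).smul_const e).const_add v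
  exact (hasFDerivAt_isentropicEulerEntropy γ hρ).differentiableAt.hasFDerivAt.comp_hasDerivAt t
    hline

/-- The gradient of `η` along a line, explicitly: for `ρ_t = ρ + t e₁' ≠ 0`,
`∇η(v + te) · e = (-(m_t²/(2ρ_t²)) + γ/(γ-1) ρ_t^{γ-1}) e₁' + (m_t/ρ_t) e₂'` with
`m_t = m + t e₂'`. [folklore] -/
theorem fderiv_isentropicEulerEntropy_line_apply (γ : ℝ) {v e : Fin 2 → ℝ} {t : ℝ}
    (hρ : v 0 + t * e 0 ≠ 0) :
    fderiv ℝ (isentropicEulerEntropy γ) (v + t • e) e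
      = (-((v 1 + t * e 1) ^ 2 / (2 * (v 0 + t * e 0) ^ 2))
          + γ / (γ - 1) * (v 0 + t * e 0) ^ (γ - 1)) * e 0
        + (v 1 + t * e 1) / (v 0 + t * e 0) * e 1 := by
  have hρ' : (v + t • e) 0 ≠ 0 := by simpa using hρ
  rw [(hasFDerivAt_isentropicEulerEntropy γ hρ').fderiv]
  simp

/-- **The Hessian quadratic form of `η`** ("`η''` is positive", used in the proof of Lemma 4.2):
for `γ ≠ 1` and `ρ_t = ρ(v + te) ≠ 0`,
`d²/ds² η(v + s e)|ₜ = (e₂ - (m_t/ρ_t) e₁)²/ρ_t + γ ρ_t^{γ-2} e₁²` (here `ρ^{γ-2}` is written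
`ρ^{γ-1}/ρ`). [cite: ChenKrupaVasseur2022, Assumption 1.1 (c), proof of Lemma 4.2] -/
theorem hasDerivAt_fderiv_isentropicEulerEntropy_line {γ : ℝ} (hγ : γ ≠ 1) (v e : Fin 2 → ℝ)
    {t : ℝ} (hρ : v 0 + t * e 0 ≠ 0) :
    HasDerivAt (fun s : ℝ => fderiv ℝ (isentropicEulerEntropy γ) (v + s • e) e)
      ((e 1 - (v 1 + t * e 1) / (v 0 + t * e 0) * e 0) ^ 2 / (v 0 + t * e 0)
        + γ * ((v 0 + t * e 0) ^ (γ - 1) / (v 0 + t * e 0)) * e 0 ^ 2) t := by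
  have hγ' : γ - 1 ≠ 0 := sub_ne_zero.2 hγ
  -- the explicit formula, valid near `t`
  set F : ℝ → ℝ := fun s => (-((v 1 + s * e 1) ^ 2 / (2 * (v 0 + s * e 0) ^ 2))
      + γ / (γ - 1) * (v 0 + s * e 0) ^ (γ - 1)) * e 0
    + (v 1 + s * e 1) / (v 0 + s * e 0) * e 1 with hF
  have hev : (fun s : ℝ => fderiv ℝ (isentropicEulerEntropy γ) (v + s • e) e) =ᶠ[𝓝 t] F := by
    have hopen : ∀ᶠ s : ℝ in 𝓝 t, v 0 + s * e 0 ≠ 0 := by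
      have hc : ContinuousAt (fun s : ℝ => v 0 + s * e 0) t := by fun_prop
      exact hc.eventually_ne hρ
    filter_upwards [hopen] with s hs
    rw [hF, fderiv_isentropicEulerEntropy_line_apply γ hs]
  -- differentiate the explicit formula
  have hρt : HasDerivAt (fun s : ℝ => v 0 + s * e 0) (e 0) t := by
    simpa using ((hasDerivAt_id t).mul_const (e 0)).const_add (v 0)
  have hmt : HasDerivAt (fun s : ℝ => v 1 + s * e 1) (e 1) t := by
    simpa using ((hasDerivAt_id t).mul_const (e 1)).const_add (v 1)
  have hρ0 : (fun s : ℝ => v 0 + s * e 0) t ≠ 0 := by simpa using hρ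
  have h1 := ((hmt.fun_pow 2).fun_div ((hρt.fun_pow 2).const_mul 2)
    (by simpa using hρ)).fun_neg
  have h2 := (hρt.rpow_const (p := γ - 1) (Or.inl hρ0)).const_mul (γ / (γ - 1))
  have h3 := ((h1.fun_add h2).mul_const (e 0))
  have h4 := (hmt.fun_div hρt hρ0).mul_const (e 1)
  have h5 := h3.fun_add h4
  have hFd : HasDerivAt F ((e 1 - (v 1 + t * e 1) / (v 0 + t * e 0) * e 0) ^ 2 / (v 0 + t * e 0)
      + γ * ((v 0 + t * e 0) ^ (γ - 1) / (v 0 + t * e 0)) * e 0 ^ 2) t := by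
    refine (h5.congr_deriv ?_).congr_of_eventuallyEq (Eventually.of_forall fun s => by rw [hF])
    simp
    rw [Real.rpow_sub_one hρ (γ - 1)]
    field_simp
    ring
  exact hFd.congr_of_eventuallyEq hev

/-- The Hessian quadratic form of `η` is positive definite on `{ρ > 0}` (`γ > 0`):
`(e₂ - v e₁)²/ρ + γ ρ^{γ-2} e₁² > 0` for `e ≠ 0`.
[cite: ChenKrupaVasseur2022, Assumption 1.1 (c)] -/
theorem hessian_isentropicEulerEntropy_pos {γ : ℝ} (hγ : 0 < γ) {ρ m : ℝ} (hρ : 0 < ρ)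
    {e : Fin 2 → ℝ} (he : e ≠ 0) :
    0 < (e 1 - m / ρ * e 0) ^ 2 / ρ + γ * (ρ ^ (γ - 1) / ρ) * e 0 ^ 2 := by
  have hA : 0 ≤ (e 1 - m / ρ * e 0) ^ 2 / ρ := by positivity
  have hcoef : 0 < γ * (ρ ^ (γ - 1) / ρ) := mul_pos hγ (div_pos (Real.rpow_pos_of_pos hρ _) hρ)
  by_cases h0 : e 0 = 0
  · have h1 : e 1 ≠ 0 := by
      intro h1; apply he; funext i; fin_cases i <;> simp [h0, h1]
    have : 0 < (e 1 - m / ρ * e 0) ^ 2 / ρ := by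
      rw [h0, mul_zero, sub_zero]; positivity
    nlinarith [mul_nonneg hcoef.le (sq_nonneg (e 0))]
  · have : 0 < γ * (ρ ^ (γ - 1) / ρ) * e 0 ^ 2 := by positivity
    linarith

/-- **Lemma 3.1 on a convex set, from Hessian bounds** ("The constants `c*, c**` depend on bounds
on the second derivative of `η` in `V`"; "follows directly from Taylor's theorem"): if the Hessian
quadratic form of `η` is pinched between `λ|e|²` and `Λ|e|²` on a convex set `S ⊆ {ρ > 0}`, then
for `u, v ∈ S`, `λ/2 |u-v|² ≤ η(u|v) ≤ Λ/2 |u-v|²` (second-order Taylor along the segment, via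
monotonicity of `t ↦ ∇η(v+t(u-v))·(u-v) - λ|u-v|²t` and of the once-integrated quantity).
[cite: ChenKrupaVasseur2022, Lemma 3.1] -/
theorem relEntropy_isentropicEuler_bounds_of_hessian {γ : ℝ} (hγ : γ ≠ 1)
    {S : Set (Fin 2 → ℝ)} (hS : Convex ℝ S) (hSρ : ∀ w ∈ S, 0 < w 0) {lam Lam : ℝ}
    (hlam : ∀ w ∈ S, ∀ e : Fin 2 → ℝ,
      lam * ‖e‖ ^ 2 ≤ (e 1 - w 1 / w 0 * e 0) ^ 2 / w 0 + γ * ((w 0) ^ (γ - 1) / w 0) * e 0 ^ 2)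
    (hLam : ∀ w ∈ S, ∀ e : Fin 2 → ℝ,
      (e 1 - w 1 / w 0 * e 0) ^ 2 / w 0 + γ * ((w 0) ^ (γ - 1) / w 0) * e 0 ^ 2 ≤ Lam * ‖e‖ ^ 2)
    {u v : Fin 2 → ℝ} (hu : u ∈ S) (hv : v ∈ S) :
    lam / 2 * ‖u - v‖ ^ 2 ≤ isentropicEulerEntropy γ u - isentropicEulerEntropy γ v
        - fderiv ℝ (isentropicEulerEntropy γ) v (u - v) ∧
      isentropicEulerEntropy γ u - isentropicEulerEntropy γ v
        - fderiv ℝ (isentropicEulerEntropy γ) v (u - v) ≤ Lam / 2 * ‖u - v‖ ^ 2 := by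
  set e := u - v with he
  -- points of the segment
  have hseg : ∀ t ∈ Icc (0 : ℝ) 1, v + t • e ∈ S := fun t ht => hS.add_smul_sub_mem hv hu ht
  have hρt : ∀ t ∈ Icc (0 : ℝ) 1, v 0 + t * e 0 ≠ 0 := by
    intro t ht
    have := hSρ _ (hseg t ht)
    simp only [Pi.add_apply, Pi.smul_apply, smul_eq_mul] at this
    exact this.ne'
  -- the functions along the segment
  set g : ℝ → ℝ := fun s => isentropicEulerEntropy γ (v + s • e) with hg
  set G : ℝ → ℝ := fun s => fderiv ℝ (isentropicEulerEntropy γ) (v + s • e) e with hG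
  set Q : ℝ → ℝ := fun t => (e 1 - (v 1 + t * e 1) / (v 0 + t * e 0) * e 0) ^ 2 / (v 0 + t * e 0)
    + γ * ((v 0 + t * e 0) ^ (γ - 1) / (v 0 + t * e 0)) * e 0 ^ 2 with hQ
  have hgd : ∀ t ∈ Icc (0 : ℝ) 1, HasDerivAt g (G t) t := by
    intro t ht
    have hρ' : (v + t • e) 0 ≠ 0 := by simpa using hρt t ht
    exact hasDerivAt_isentropicEulerEntropy_line γ v e hρ'
  have hGd : ∀ t ∈ Icc (0 : ℝ) 1, HasDerivAt G (Q t) t := fun t ht =>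
    hasDerivAt_fderiv_isentropicEulerEntropy_line hγ v e (hρt t ht)
  -- Hessian bounds along the segment
  have hQb : ∀ t ∈ Icc (0 : ℝ) 1, lam * ‖e‖ ^ 2 ≤ Q t ∧ Q t ≤ Lam * ‖e‖ ^ 2 := by
    intro t ht
    have h1 := hlam _ (hseg t ht) e
    have h2 := hLam _ (hseg t ht) e
    simp only [Pi.add_apply, Pi.smul_apply, smul_eq_mul] at h1 h2
    exact ⟨h1, h2⟩
  -- continuity / differentiability packages on `D = [0,1]`
  have hDconv : Convex ℝ (Icc (0 : ℝ) 1) := convex_Icc 0 1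
  have hint : interior (Icc (0 : ℝ) 1) ⊆ Icc 0 1 := interior_subset
  -- step A (lower): `G t - G 0 - lam ‖e‖² t` is monotone, hence ≥ 0
  have hk1d : ∀ c : ℝ, ∀ s ∈ Icc (0 : ℝ) 1,
      HasDerivAt (fun s => G s - c * ‖e‖ ^ 2 * s) (Q s - c * ‖e‖ ^ 2) s := by
    intro c s hs
    have := (hGd s hs).fun_sub ((hasDerivAt_id s).const_mul (c * ‖e‖ ^ 2))
    refine this.congr_deriv ?_
    simp
  have hA : ∀ c : ℝ, (∀ t ∈ Icc (0 : ℝ) 1, c * ‖e‖ ^ 2 ≤ Q t) →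
      ∀ t ∈ Icc (0 : ℝ) 1, c * ‖e‖ ^ 2 * t ≤ G t - G 0 := by
    intro c hc t ht
    have hmono := monotoneOn_of_deriv_nonneg hDconv (f := fun s => G s - c * ‖e‖ ^ 2 * s)
      (fun s hs => (hk1d c s hs).continuousAt.continuousWithinAt)
      (fun s hs => (hk1d c s (hint hs)).differentiableAt.differentiableWithinAt)
      (fun s hs => by
        rw [(hk1d c s (hint hs)).deriv]
        have := hc s (hint hs); linarith)
    have := hmono (left_mem_Icc.2 zero_le_one) ht ht.1
    simp only [mul_zero, sub_zero] at this
    linarith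
  have hA' : ∀ c : ℝ, (∀ t ∈ Icc (0 : ℝ) 1, Q t ≤ c * ‖e‖ ^ 2) →
      ∀ t ∈ Icc (0 : ℝ) 1, G t - G 0 ≤ c * ‖e‖ ^ 2 * t := by
    intro c hc t ht
    have hanti := antitoneOn_of_deriv_nonpos hDconv (f := fun s => G s - c * ‖e‖ ^ 2 * s)
      (fun s hs => (hk1d c s hs).continuousAt.continuousWithinAt)
      (fun s hs => (hk1d c s (hint hs)).differentiableAt.differentiableWithinAt)
      (fun s hs => by
        rw [(hk1d c s (hint hs)).deriv]
        have := hc s (hint hs); linarith)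
    have := hanti (left_mem_Icc.2 zero_le_one) ht ht.1
    simp only [mul_zero, sub_zero] at this
    linarith
  -- step B: integrate once more
  have hB : ∀ c : ℝ, (∀ t ∈ Icc (0 : ℝ) 1, c * ‖e‖ ^ 2 * t ≤ G t - G 0) →
      c / 2 * ‖e‖ ^ 2 ≤ g 1 - g 0 - G 0 := by
    intro c hc
    have hkd : ∀ s ∈ Icc (0 : ℝ) 1, HasDerivAt (fun s => g s - G 0 * s - c / 2 * ‖e‖ ^ 2 * s ^ 2)
        (G s - G 0 - c * ‖e‖ ^ 2 * s) s := by
      intro s hs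
      have := ((hgd s hs).sub ((hasDerivAt_id s).const_mul (G 0))).sub
        (((hasDerivAt_id s).fun_pow 2).const_mul (c / 2 * ‖e‖ ^ 2))
      refine this.congr_deriv ?_
      simp; ring
    have hmono := monotoneOn_of_deriv_nonneg hDconv
      (f := fun s => g s - G 0 * s - c / 2 * ‖e‖ ^ 2 * s ^ 2)
      (fun s hs => (hkd s hs).continuousAt.continuousWithinAt)
      (fun s hs => (hkd s (hint hs)).differentiableAt.differentiableWithinAt)
      (fun s hs => by rw [(hkd s (hint hs)).deriv]; have := hc s (hint hs); linarith)
    have := hmono (left_mem_Icc.2 zero_le_one) (right_mem_Icc.2 zero_le_one) zero_le_one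
    simp at this
    linarith
  have hB' : ∀ c : ℝ, (∀ t ∈ Icc (0 : ℝ) 1, G t - G 0 ≤ c * ‖e‖ ^ 2 * t) →
      g 1 - g 0 - G 0 ≤ c / 2 * ‖e‖ ^ 2 := by
    intro c hc
    have hkd : ∀ s ∈ Icc (0 : ℝ) 1, HasDerivAt (fun s => g s - G 0 * s - c / 2 * ‖e‖ ^ 2 * s ^ 2)
        (G s - G 0 - c * ‖e‖ ^ 2 * s) s := by
      intro s hs
      have := ((hgd s hs).sub ((hasDerivAt_id s).const_mul (G 0))).sub
        (((hasDerivAt_id s).fun_pow 2).const_mul (c / 2 * ‖e‖ ^ 2))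
      refine this.congr_deriv ?_
      simp; ring
    have hanti := antitoneOn_of_deriv_nonpos hDconv
      (f := fun s => g s - G 0 * s - c / 2 * ‖e‖ ^ 2 * s ^ 2)
      (fun s hs => (hkd s hs).continuousAt.continuousWithinAt)
      (fun s hs => (hkd s (hint hs)).differentiableAt.differentiableWithinAt)
      (fun s hs => by rw [(hkd s (hint hs)).deriv]; have := hc s (hint hs); linarith)
    have := hanti (left_mem_Icc.2 zero_le_one) (right_mem_Icc.2 zero_le_one) zero_le_one
    simp at this
    linarith
  -- identify `g 1`, `g 0`, `G 0`
  have hg1 : g 1 = isentropicEulerEntropy γ u := by simp [hg, he]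
  have hg0 : g 0 = isentropicEulerEntropy γ v := by simp [hg]
  have hG0 : G 0 = fderiv ℝ (isentropicEulerEntropy γ) v e := by simp [hG]
  have lower := hB lam (hA lam fun t ht => (hQb t ht).1)
  have upper := hB' Lam (hA' Lam fun t ht => (hQb t ht).2)
  rw [hg1, hg0, hG0] at lower upper
  exact ⟨lower, upper⟩

end Hessian

/-! ## Lemma 3.1 for isentropic Euler: `c*|u-v|² ≤ η(u|v) ≤ c**|u-v|²` on `𝒰₀ × V`, `V ⊂ 𝒱` compact -/

section Lemma31

/-- The physical entropy is convex on `{ρ > 0}` (`γ > 1`).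
[cite: ChenKrupaVasseur2022, Assumption 1.1 (c)] -/
theorem convexOn_isentropicEulerEntropy (hγ : 1 < γ) :
    ConvexOn ℝ {u : Fin 2 → ℝ | 0 < u 0} (isentropicEulerEntropy γ) := by
  have hγ1 : 0 < γ - 1 := by linarith
  have h1 := (convexOn_sq_div_posDensity).smul (show (0 : ℝ) ≤ 1 / 2 by norm_num)
  have h2 := (convexOn_rpow_posDensity hγ.le).smul (show (0 : ℝ) ≤ 1 / (γ - 1) by positivity)
  refine (h1.add h2).congr fun u _ => ?_
  simp only [Pi.add_apply, isentropicEulerEntropy, smul_eq_mul]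
  ring

/-- Sup-norm bookkeeping on `ℝ²`: `‖e‖² ≤ e₁² + e₂²`. [folklore] -/
theorem norm_sq_le_sum_sq (e : Fin 2 → ℝ) : ‖e‖ ^ 2 ≤ e 0 ^ 2 + e 1 ^ 2 := by
  have h : ‖e‖ ≤ Real.sqrt (e 0 ^ 2 + e 1 ^ 2) := by
    refine (pi_norm_le_iff_of_nonneg (Real.sqrt_nonneg _)).2 (Fin.forall_fin_two.2 ⟨?_, ?_⟩)
    · rw [Real.norm_eq_abs]
      exact Real.abs_le_sqrt (by nlinarith [sq_nonneg (e 1)])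
    · rw [Real.norm_eq_abs]
      exact Real.abs_le_sqrt (by nlinarith [sq_nonneg (e 0)])
  calc ‖e‖ ^ 2 ≤ (Real.sqrt (e 0 ^ 2 + e 1 ^ 2)) ^ 2 := by gcongr
    _ = e 0 ^ 2 + e 1 ^ 2 := Real.sq_sqrt (by positivity)

/-- **Hessian pinching on a slab.** On `S = {δ < ρ < R, |m| < R}` (`0 < δ ≤ R`, `γ > 1`) the Hessian
quadratic form of `η` is pinched, `λ|e|² ≤ Q_w(e) ≤ Λ|e|²`, with the explicit constants
`λ = min(1/(2R), (γδ^{γ-1}/R)/(2(R/δ)²+1))` and `Λ = (2 + 2(R/δ)² + γR^{γ-1})/δ` (sup norm on `ℝ²`).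
[cite: ChenKrupaVasseur2022, Lemma 3.1] -/
theorem hessian_isentropicEulerEntropy_pinching (hγ : 1 < γ) {δ R : ℝ} (hδ : 0 < δ) (hδR : δ ≤ R)
    {w : Fin 2 → ℝ} (hw1 : δ < w 0) (hw2 : w 0 < R) (hw3 : |w 1| < R) (e : Fin 2 → ℝ) :
    min (1 / (2 * R)) (γ * δ ^ (γ - 1) / R / (2 * (R / δ) ^ 2 + 1)) * ‖e‖ ^ 2
        ≤ (e 1 - w 1 / w 0 * e 0) ^ 2 / w 0 + γ * ((w 0) ^ (γ - 1) / w 0) * e 0 ^ 2 ∧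
      (e 1 - w 1 / w 0 * e 0) ^ 2 / w 0 + γ * ((w 0) ^ (γ - 1) / w 0) * e 0 ^ 2
        ≤ (2 + 2 * (R / δ) ^ 2 + γ * R ^ (γ - 1)) / δ * ‖e‖ ^ 2 := by
  have hR : 0 < R := lt_of_lt_of_le hδ hδR
  have hw0 : 0 < w 0 := lt_trans hδ hw1
  have hγ0 : 0 < γ := by linarith
  have hγ1 : 0 ≤ γ - 1 := by linarith
  set κ := w 1 / w 0 with hκ
  set Vb := R / δ with hVb
  -- `|κ| ≤ Vb`
  have hκb : |κ| ≤ Vb := by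
    rw [hκ, abs_div, abs_of_pos hw0, hVb]
    calc |w 1| / w 0 ≤ R / w 0 := div_le_div_of_nonneg_right hw3.le hw0.le
      _ ≤ R / δ := div_le_div_of_nonneg_left hR.le hδ hw1.le
  have hκ2 : κ ^ 2 ≤ Vb ^ 2 := by
    have h := hκb
    rw [← sq_abs κ]
    exact pow_le_pow_left₀ (abs_nonneg κ) h 2
  -- norms of the components
  have he0 : |e 0| ≤ ‖e‖ := by simpa [Real.norm_eq_abs] using norm_le_pi_norm e 0
  have he1 : |e 1| ≤ ‖e‖ := by simpa [Real.norm_eq_abs] using norm_le_pi_norm e 1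
  have he0sq : e 0 ^ 2 ≤ ‖e‖ ^ 2 := by
    rw [← sq_abs (e 0)]; exact pow_le_pow_left₀ (abs_nonneg _) he0 2
  have he1sq : e 1 ^ 2 ≤ ‖e‖ ^ 2 := by
    rw [← sq_abs (e 1)]; exact pow_le_pow_left₀ (abs_nonneg _) he1 2
  have hsum := norm_sq_le_sum_sq e
  -- powers of the density
  have hpow_lo : δ ^ (γ - 1) ≤ (w 0) ^ (γ - 1) := Real.rpow_le_rpow hδ.le hw1.le hγ1
  have hpow_hi : (w 0) ^ (γ - 1) ≤ R ^ (γ - 1) := Real.rpow_le_rpow hw0.le hw2.le hγ1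
  have hδpow : 0 < δ ^ (γ - 1) := Real.rpow_pos_of_pos hδ _
  have hRpow : 0 < R ^ (γ - 1) := Real.rpow_pos_of_pos hR _
  -- the two terms of `Q`
  set A := (e 1 - κ * e 0) ^ 2 with hA
  have hA0 : 0 ≤ A := sq_nonneg _
  have hcoef_lo : γ * δ ^ (γ - 1) / R ≤ γ * ((w 0) ^ (γ - 1) / w 0) := by
    rw [mul_div_assoc]
    refine mul_le_mul_of_nonneg_left ?_ hγ0.le
    calc δ ^ (γ - 1) / R ≤ (w 0) ^ (γ - 1) / R := div_le_div_of_nonneg_right hpow_lo hR.le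
      _ ≤ (w 0) ^ (γ - 1) / w 0 :=
          div_le_div_of_nonneg_left (Real.rpow_nonneg hw0.le _) hw0 hw2.le
  have hcoef_hi : γ * ((w 0) ^ (γ - 1) / w 0) ≤ γ * (R ^ (γ - 1) / δ) := by
    refine mul_le_mul_of_nonneg_left ?_ hγ0.le
    calc (w 0) ^ (γ - 1) / w 0 ≤ R ^ (γ - 1) / w 0 := div_le_div_of_nonneg_right hpow_hi hw0.le
      _ ≤ R ^ (γ - 1) / δ := div_le_div_of_nonneg_left hRpow.le hδ hw1.le
  constructor
  · -- lower bound
    set α₀ := γ * δ ^ (γ - 1) / R with hα₀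
    have hα₀pos : 0 < α₀ := by positivity
    set lam := min (1 / (2 * R)) (α₀ / (2 * Vb ^ 2 + 1)) with hlam
    have hlam1 : lam ≤ 1 / (2 * R) := min_le_left _ _
    have hlam2 : lam ≤ α₀ / (2 * Vb ^ 2 + 1) := min_le_right _ _
    have hlam0 : 0 ≤ lam := le_min (by positivity) (by positivity)
    have hlam2' : lam * (2 * Vb ^ 2 + 1) ≤ α₀ := by
      rwa [le_div_iff₀ (by positivity)] at hlam2
    -- `e₁² ≤ 2A + 2κ²e₀²`
    have key : e 1 ^ 2 ≤ 2 * A + 2 * Vb ^ 2 * e 0 ^ 2 := by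
      have h1 : e 1 ^ 2 ≤ 2 * A + 2 * (κ * e 0) ^ 2 := by
        rw [hA]; nlinarith [sq_nonneg (e 1 - 2 * κ * e 0)]
      have h2 : (κ * e 0) ^ 2 ≤ Vb ^ 2 * e 0 ^ 2 := by
        rw [mul_pow]; exact mul_le_mul_of_nonneg_right hκ2 (sq_nonneg _)
      linarith
    -- `A / R ≤ A / w 0`
    have hAR : A / R ≤ A / w 0 := div_le_div_of_nonneg_left hA0 hw0 hw2.le
    have hAR' : 1 / (2 * R) * (2 * A) = A / R := by field_simp
    calc lam * ‖e‖ ^ 2 ≤ lam * (e 0 ^ 2 + e 1 ^ 2) := mul_le_mul_of_nonneg_left hsum hlam0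
      _ ≤ lam * e 0 ^ 2 + lam * (2 * A + 2 * Vb ^ 2 * e 0 ^ 2) := by
          rw [mul_add]; exact add_le_add le_rfl (mul_le_mul_of_nonneg_left key hlam0)
      _ = lam * (2 * A) + lam * (2 * Vb ^ 2 + 1) * e 0 ^ 2 := by ring
      _ ≤ 1 / (2 * R) * (2 * A) + α₀ * e 0 ^ 2 :=
          add_le_add (mul_le_mul_of_nonneg_right hlam1 (by positivity))
            (mul_le_mul_of_nonneg_right hlam2' (sq_nonneg _))
      _ = A / R + α₀ * e 0 ^ 2 := by rw [hAR']
      _ ≤ A / w 0 + γ * ((w 0) ^ (γ - 1) / w 0) * e 0 ^ 2 :=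
          add_le_add hAR (mul_le_mul_of_nonneg_right hcoef_lo (sq_nonneg _))
  · -- upper bound
    have hAup : A ≤ (2 + 2 * Vb ^ 2) * ‖e‖ ^ 2 := by
      have h1 : A ≤ 2 * e 1 ^ 2 + 2 * (κ * e 0) ^ 2 := by
        rw [hA]; nlinarith [sq_nonneg (e 1 + κ * e 0)]
      have h2 : (κ * e 0) ^ 2 ≤ Vb ^ 2 * ‖e‖ ^ 2 := by
        rw [mul_pow]; exact mul_le_mul hκ2 he0sq (sq_nonneg _) (by positivity)
      nlinarith
    have hAw : A / w 0 ≤ A / δ := div_le_div_of_nonneg_left hA0 hδ hw1.le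
    calc A / w 0 + γ * ((w 0) ^ (γ - 1) / w 0) * e 0 ^ 2
        ≤ A / δ + γ * (R ^ (γ - 1) / δ) * ‖e‖ ^ 2 :=
          add_le_add hAw (mul_le_mul hcoef_hi he0sq (sq_nonneg _) (by positivity))
      _ ≤ (2 + 2 * Vb ^ 2) * ‖e‖ ^ 2 / δ + γ * (R ^ (γ - 1) / δ) * ‖e‖ ^ 2 :=
          add_le_add (div_le_div_of_nonneg_right hAup hδ.le) le_rfl
      _ = (2 + 2 * (R / δ) ^ 2 + γ * R ^ (γ - 1)) / δ * ‖e‖ ^ 2 := by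
          rw [hVb]; field_simp

/-- **Gradient bound on a slab**: for `δ < ρ < R`, `|m| < R`,
`|∇η(w)·e| ≤ ((R/δ)²/2 + γ/(γ-1) R^{γ-1} + R/δ) |e|`. [folklore] -/
theorem fderiv_isentropicEulerEntropy_apply_le (hγ : 1 < γ) {δ R : ℝ} (hδ : 0 < δ) (hδR : δ ≤ R)
    {w : Fin 2 → ℝ} (hw1 : δ < w 0) (hw2 : w 0 < R) (hw3 : |w 1| < R) (e : Fin 2 → ℝ) :
    |fderiv ℝ (isentropicEulerEntropy γ) w e|
      ≤ ((R / δ) ^ 2 / 2 + γ / (γ - 1) * R ^ (γ - 1) + R / δ) * ‖e‖ := by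
  have hR : 0 < R := lt_of_lt_of_le hδ hδR
  have hw0 : 0 < w 0 := lt_trans hδ hw1
  have hγ0 : 0 < γ := by linarith
  have hγ1 : 0 ≤ γ - 1 := by linarith
  have hγ1' : 0 < γ - 1 := by linarith
  rw [(hasFDerivAt_isentropicEulerEntropy γ hw0.ne').fderiv]
  simp only [add_apply, FunLike.coe_smul, Pi.smul_apply, ContinuousLinearMap.proj_apply,
    smul_eq_mul]
  set κ := w 1 / w 0 with hκ
  have hκb : |κ| ≤ R / δ := by
    rw [hκ, abs_div, abs_of_pos hw0]
    calc |w 1| / w 0 ≤ R / w 0 := div_le_div_of_nonneg_right hw3.le hw0.le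
      _ ≤ R / δ := div_le_div_of_nonneg_left hR.le hδ hw1.le
  have hκ2 : κ ^ 2 ≤ (R / δ) ^ 2 := by
    rw [← sq_abs κ]; exact pow_le_pow_left₀ (abs_nonneg κ) hκb 2
  have hsq : w 1 ^ 2 / (2 * w 0 ^ 2) = κ ^ 2 / 2 := by rw [hκ]; field_simp
  rw [hsq]
  have he0 : |e 0| ≤ ‖e‖ := by simpa [Real.norm_eq_abs] using norm_le_pi_norm e 0
  have he1 : |e 1| ≤ ‖e‖ := by simpa [Real.norm_eq_abs] using norm_le_pi_norm e 1
  have hpow_hi : (w 0) ^ (γ - 1) ≤ R ^ (γ - 1) := Real.rpow_le_rpow hw0.le hw2.le hγ1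
  have hpow0 : 0 ≤ (w 0) ^ (γ - 1) := Real.rpow_nonneg hw0.le _
  have hc1 : |-(κ ^ 2 / 2) + γ / (γ - 1) * (w 0) ^ (γ - 1)| ≤ (R / δ) ^ 2 / 2 + γ / (γ - 1) * R ^ (γ - 1) := by
    refine (abs_add_le _ _).trans ?_
    rw [abs_neg, abs_of_nonneg (by positivity : 0 ≤ κ ^ 2 / 2),
      abs_of_nonneg (by positivity : 0 ≤ γ / (γ - 1) * (w 0) ^ (γ - 1))]
    exact add_le_add (div_le_div_of_nonneg_right hκ2 zero_le_two)
      (mul_le_mul_of_nonneg_left hpow_hi (by positivity))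
  calc |(-(κ ^ 2 / 2) + γ / (γ - 1) * (w 0) ^ (γ - 1)) * e 0 + κ * e 1|
      ≤ |(-(κ ^ 2 / 2) + γ / (γ - 1) * (w 0) ^ (γ - 1)) * e 0| + |κ * e 1| := abs_add_le _ _
    _ = |-(κ ^ 2 / 2) + γ / (γ - 1) * (w 0) ^ (γ - 1)| * |e 0| + |κ| * |e 1| := by
        rw [abs_mul, abs_mul]
    _ ≤ ((R / δ) ^ 2 / 2 + γ / (γ - 1) * R ^ (γ - 1)) * ‖e‖ + (R / δ) * ‖e‖ :=
        add_le_add (mul_le_mul hc1 he0 (abs_nonneg _) ((abs_nonneg _).trans hc1))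
          (mul_le_mul hκb he1 (abs_nonneg _) ((abs_nonneg _).trans hκb))
    _ = ((R / δ) ^ 2 / 2 + γ / (γ - 1) * R ^ (γ - 1) + R / δ) * ‖e‖ := by ring

/-- Componentwise distance control in the sup norm: `|u₁ - v₁| ≤ ‖u - v‖`, `|u₂ - v₂| ≤ ‖u - v‖`.
[folklore] -/
theorem abs_sub_apply_le_norm (u v : Fin 2 → ℝ) (i : Fin 2) : |u i - v i| ≤ ‖u - v‖ := by
  simpa [Real.norm_eq_abs] using norm_le_pi_norm (u - v) i

/-- **Lemma 3.1 for the isentropic Euler system** (`γ > 1`, state set `𝒰₀ = 𝒱 ∪ {0}` of §1): "For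
any fixed compact set `V ⊂ 𝒱`, there exists `c*, c** > 0` such that for all `(u,v) ∈ 𝒰₀ × V`,
`c*|u-v|² ≤ η(u|v) ≤ c**|u-v|²`." Proof as printed ("follows directly from Taylor's theorem"):
near the diagonal, the second-order pinching on a slab around `V`
(`relEntropy_isentropicEuler_bounds_of_hessian` with `hessian_isentropicEulerEntropy_pinching`);
away from it, the upper bound from the bounds of `η`, `∇η` on `𝒰₀`, and the lower bound from
convexity along the segment (`η(v + t(u-v)|v) ≤ t η(u|v)`) and, at the vacuum, `η(0|v) = ρ_v^γ`.
[cite: ChenKrupaVasseur2022, Lemma 3.1 (with Lemma 4.5)] -/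
theorem relEntropy_isentropicEuler_equiv_sq (hγ : 1 < γ) (hC : 0 < C) {V : Set (Fin 2 → ℝ)}
    (hV : IsCompact V) (hVsub : V ⊆ isentropicEulerInterior γ C) :
    ∃ cl cu : ℝ, 0 < cl ∧ 0 < cu ∧ ∀ u ∈ isentropicEulerStates γ C, ∀ v ∈ V,
      cl * ‖u - v‖ ^ 2 ≤ isentropicEulerEntropy γ u - isentropicEulerEntropy γ v
          - fderiv ℝ (isentropicEulerEntropy γ) v (u - v) ∧
        isentropicEulerEntropy γ u - isentropicEulerEntropy γ v
          - fderiv ℝ (isentropicEulerEntropy γ) v (u - v) ≤ cu * ‖u - v‖ ^ 2 := by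
  rcases V.eq_empty_or_nonempty with hVe | hne
  · exact ⟨1, 1, one_pos, one_pos, fun u _ v hv => by simp [hVe] at hv⟩
  have hγ0 : 0 < γ := by linarith
  have hγ1 : 0 < γ - 1 := by linarith
  have hγne : γ ≠ 1 := by intro h; linarith
  -- the minimal density on `V`
  obtain ⟨v₀, hv₀, hmin⟩ := hV.exists_isMinOn hne (continuous_apply 0).continuousOn
  set ρm := v₀ 0 with hρm
  have hρm0 : 0 < ρm := (hVsub hv₀).1
  have hρmle : ∀ v ∈ V, ρm ≤ v 0 := fun v hv => hmin hv
  -- global bounds on `𝒰₀`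
  set P := (2 * C / isentropicEulerC₁ γ) ^ (2 / (γ - 1)) with hP
  have hPpos : 0 < P := Real.rpow_pos_of_pos (div_pos (by linarith) (isentropicEulerC₁_pos hγ)) _
  set B₀ := P * (1 + C) with hB₀
  have hB₀pos : 0 < B₀ := by positivity
  have hnormU : ∀ w ∈ isentropicEulerStates γ C, ‖w‖ ≤ B₀ := by
    intro w hw
    rcases hw with hw | hw
    · exact norm_le_of_mem_isentropicEulerInterior hγ hC hw
    · rw [mem_singleton_iff] at hw; subst hw; rw [norm_zero]; exact hB₀pos.le
  have hnormV : ∀ v ∈ V, ‖v‖ ≤ B₀ := fun v hv => hnormU v (Or.inl (hVsub hv))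
  set Bη := P * C ^ 2 + P ^ γ / (γ - 1) with hBη
  have hBη0 : 0 ≤ Bη := by positivity
  have hη0 : isentropicEulerEntropy γ 0 = 0 := (isentropicEuler_vacuum γ hγ).2.1
  have hηU : ∀ w ∈ isentropicEulerStates γ C, |isentropicEulerEntropy γ w| ≤ Bη := by
    intro w hw
    rcases hw with hw | hw
    · exact (bounds_of_mem_isentropicEulerInterior hγ hC hw).2.1
    · rw [mem_singleton_iff] at hw; subst hw; rw [hη0, abs_zero]; exact hBη0
  have hρmB : ρm ≤ B₀ := by
    have h1 : ρm ≤ ‖v₀‖ := by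
      have := norm_le_pi_norm v₀ 0
      rwa [Real.norm_eq_abs, abs_of_pos hρm0] at this
    exact h1.trans (hnormV v₀ hv₀)
  -- the slab
  set δ := ρm / 4 with hδ
  set R := 2 * B₀ + 1 with hR
  have hδ0 : 0 < δ := by positivity
  have hδR : δ ≤ R := by rw [hδ, hR]; linarith
  set S : Set (Fin 2 → ℝ) := {w | δ < w 0} ∩ {w | w 0 < R} ∩ ({w | w 1 < R} ∩ {w | -R < w 1})
    with hS
  have hSconv : Convex ℝ S := by
    have l0 : IsLinearMap ℝ fun w : Fin 2 → ℝ => w 0 := (LinearMap.proj 0).isLinear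
    have l1 : IsLinearMap ℝ fun w : Fin 2 → ℝ => w 1 := (LinearMap.proj 1).isLinear
    exact ((convex_halfSpace_gt l0 δ).inter (convex_halfSpace_lt l0 R)).inter
      ((convex_halfSpace_lt l1 R).inter (convex_halfSpace_gt l1 (-R)))
  have hSmem : ∀ w : Fin 2 → ℝ, δ < w 0 → w 0 < R → |w 1| < R → w ∈ S := by
    intro w h1 h2 h3
    exact ⟨⟨h1, h2⟩, (abs_lt.1 h3).2, (abs_lt.1 h3).1⟩
  have hSout : ∀ w ∈ S, δ < w 0 ∧ w 0 < R ∧ |w 1| < R := by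
    rintro w ⟨⟨h1, h2⟩, h3, h4⟩
    exact ⟨h1, h2, abs_lt.2 ⟨h4, h3⟩⟩
  have hSρ : ∀ w ∈ S, 0 < w 0 := fun w hw => lt_trans hδ0 (hSout w hw).1
  -- the pinching constants on the slab
  set lam := min (1 / (2 * R)) (γ * δ ^ (γ - 1) / R / (2 * (R / δ) ^ 2 + 1)) with hlam
  set Lam := (2 + 2 * (R / δ) ^ 2 + γ * R ^ (γ - 1)) / δ with hLam
  have hRpos : 0 < R := lt_of_lt_of_le hδ0 hδR
  have hlam0 : 0 < lam := lt_min (by positivity)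
    (div_pos (div_pos (mul_pos hγ0 (Real.rpow_pos_of_pos hδ0 _)) hRpos) (by positivity))
  have hLam0 : 0 < Lam := div_pos (by
    have := Real.rpow_pos_of_pos hRpos (γ - 1); positivity) hδ0
  have hpin : ∀ w ∈ S, ∀ e : Fin 2 → ℝ,
      lam * ‖e‖ ^ 2 ≤ (e 1 - w 1 / w 0 * e 0) ^ 2 / w 0 + γ * ((w 0) ^ (γ - 1) / w 0) * e 0 ^ 2 ∧
      (e 1 - w 1 / w 0 * e 0) ^ 2 / w 0 + γ * ((w 0) ^ (γ - 1) / w 0) * e 0 ^ 2 ≤ Lam * ‖e‖ ^ 2 := by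
    intro w hw e
    obtain ⟨h1, h2, h3⟩ := hSout w hw
    exact hessian_isentropicEulerEntropy_pinching hγ hδ0 hδR h1 h2 h3 e
  -- near-field: `‖u - v‖ ≤ ρm/2`
  have hVS : ∀ v ∈ V, v ∈ S := by
    intro v hv
    have hvn := hnormV v hv
    have h1 : |v 1| ≤ B₀ := by
      simpa [Real.norm_eq_abs] using (norm_le_pi_norm v 1).trans hvn
    have h0 : v 0 ≤ B₀ := by
      have := (norm_le_pi_norm v 0).trans hvn
      rw [Real.norm_eq_abs] at this
      exact (le_abs_self _).trans this
    refine hSmem v ?_ ?_ ?_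
    · have := hρmle v hv; rw [hδ]; linarith
    · rw [hR]; linarith
    · rw [hR]; linarith
  have hnear : ∀ v ∈ V, ∀ u : Fin 2 → ℝ, ‖u - v‖ ≤ ρm / 2 →
      lam / 2 * ‖u - v‖ ^ 2 ≤ isentropicEulerEntropy γ u - isentropicEulerEntropy γ v
          - fderiv ℝ (isentropicEulerEntropy γ) v (u - v) ∧
        isentropicEulerEntropy γ u - isentropicEulerEntropy γ v
          - fderiv ℝ (isentropicEulerEntropy γ) v (u - v) ≤ Lam / 2 * ‖u - v‖ ^ 2 := by
    intro v hv u huv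
    have hvn := hnormV v hv
    have hv1 : |v 1| ≤ B₀ := by
      simpa [Real.norm_eq_abs] using (norm_le_pi_norm v 1).trans hvn
    have hv0 : v 0 ≤ B₀ := by
      have := (norm_le_pi_norm v 0).trans hvn
      rw [Real.norm_eq_abs] at this
      exact (le_abs_self _).trans this
    have hd0 := (abs_sub_apply_le_norm u v 0).trans huv
    have hd1 := (abs_sub_apply_le_norm u v 1).trans huv
    rw [abs_le] at hd0 hd1
    have hρv := hρmle v hv
    have huS : u ∈ S := by
      refine hSmem u ?_ ?_ ?_
      · rw [hδ]; linarith [hd0.1]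
      · rw [hR]; linarith [hd0.2]
      · rw [hR, abs_lt]
        have := abs_le.1 hv1
        constructor <;> linarith [hd1.1, hd1.2]
    exact relEntropy_isentropicEuler_bounds_of_hessian hγne hSconv hSρ
      (fun w hw e => (hpin w hw e).1) (fun w hw e => (hpin w hw e).2) huS (hVS v hv)
  -- gradient bound on `V`
  set D := (R / δ) ^ 2 / 2 + γ / (γ - 1) * R ^ (γ - 1) + R / δ with hD
  have hD0 : 0 ≤ D := by
    have := Real.rpow_pos_of_pos hRpos (γ - 1); positivity
  have hgrad : ∀ v ∈ V, ∀ e : Fin 2 → ℝ,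
      |fderiv ℝ (isentropicEulerEntropy γ) v e| ≤ D * ‖e‖ := by
    intro v hv e
    obtain ⟨h1, h2, h3⟩ := hSout v (hVS v hv)
    exact fderiv_isentropicEulerEntropy_apply_le hγ hδ0 hδR h1 h2 h3 e
  -- far-field constants
  set d₀ := ρm / 2 with hd₀
  have hd₀pos : 0 < d₀ := by positivity
  set Mfar := 2 * Bη + D * (2 * B₀) with hMfar
  have hMfar0 : 0 ≤ Mfar := by positivity
  -- the constants
  refine ⟨min (lam / 2) (min (ρm ^ γ / B₀ ^ 2) (lam * d₀ / (4 * B₀))),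
    max (Lam / 2) (Mfar / d₀ ^ 2), ?_, ?_, ?_⟩
  · refine lt_min (by positivity) (lt_min ?_ (by positivity))
    exact div_pos (Real.rpow_pos_of_pos hρm0 _) (by positivity)
  · exact lt_max_of_lt_left (by positivity)
  intro u hu v hv
  set Φ := isentropicEulerEntropy γ u - isentropicEulerEntropy γ v
    - fderiv ℝ (isentropicEulerEntropy γ) v (u - v) with hΦ
  have hρv : 0 < v 0 := lt_of_lt_of_le hρm0 (hρmle v hv)
  have hdist : ‖u - v‖ ≤ 2 * B₀ := by
    calc ‖u - v‖ ≤ ‖u‖ + ‖v‖ := norm_sub_le u v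
      _ ≤ B₀ + B₀ := add_le_add (hnormU u hu) (hnormV v hv)
      _ = 2 * B₀ := by ring
  by_cases hcase : ‖u - v‖ ≤ ρm / 2
  · -- near the diagonal
    obtain ⟨hlo, hhi⟩ := hnear v hv u hcase
    have hsq : 0 ≤ ‖u - v‖ ^ 2 := sq_nonneg _
    constructor
    · calc min (lam / 2) (min (ρm ^ γ / B₀ ^ 2) (lam * d₀ / (4 * B₀))) * ‖u - v‖ ^ 2
          ≤ lam / 2 * ‖u - v‖ ^ 2 := mul_le_mul_of_nonneg_right (min_le_left _ _) hsq
        _ ≤ Φ := hlo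
    · calc Φ ≤ Lam / 2 * ‖u - v‖ ^ 2 := hhi
        _ ≤ max (Lam / 2) (Mfar / d₀ ^ 2) * ‖u - v‖ ^ 2 :=
            mul_le_mul_of_nonneg_right (le_max_left _ _) hsq
  · -- away from the diagonal
    have hfar : d₀ < ‖u - v‖ := by rw [hd₀]; exact lt_of_not_ge hcase
    have hsq : d₀ ^ 2 ≤ ‖u - v‖ ^ 2 := pow_le_pow_left₀ hd₀pos.le hfar.le 2
    constructor
    · -- lower bound
      have hcl : min (lam / 2) (min (ρm ^ γ / B₀ ^ 2) (lam * d₀ / (4 * B₀))) * ‖u - v‖ ^ 2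
          ≤ min (ρm ^ γ / B₀ ^ 2) (lam * d₀ / (4 * B₀)) * ‖u - v‖ ^ 2 :=
        mul_le_mul_of_nonneg_right (min_le_right _ _) (sq_nonneg _)
      refine hcl.trans ?_
      rcases hu with hu | hu
      · -- `u ∈ 𝒱`: convexity along the segment
        have hρu : 0 < u 0 := hu.1
        have hnuv : 0 < ‖u - v‖ := lt_trans hd₀pos hfar
        set t₀ := d₀ / ‖u - v‖ with ht₀
        have ht₀pos : 0 < t₀ := div_pos hd₀pos hnuv
        have ht₀lt : t₀ < 1 := (div_lt_one hnuv).2 hfar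
        set u' := v + t₀ • (u - v) with hu'
        have hu'v : u' - v = t₀ • (u - v) := by rw [hu']; abel
        have hnorm' : ‖u' - v‖ = d₀ := by
          rw [hu'v, norm_smul, Real.norm_eq_abs, abs_of_pos ht₀pos, ht₀, div_mul_cancel₀ _ hnuv.ne']
        have hnear' := (hnear v hv u' hnorm'.le).1
        rw [hnorm'] at hnear'
        -- convexity: `η u' ≤ (1 - t₀) η v + t₀ η u`
        have hcvx := (convexOn_isentropicEulerEntropy hγ).2 (show v ∈ {w : Fin 2 → ℝ | 0 < w 0}
          from hρv) (show u ∈ {w : Fin 2 → ℝ | 0 < w 0} from hρu)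
          (show 0 ≤ 1 - t₀ by linarith) ht₀pos.le (by ring : 1 - t₀ + t₀ = 1)
        have hpt : (1 - t₀) • v + t₀ • u = u' := by
          rw [hu', sub_smul, one_smul, smul_sub]; abel
        rw [hpt] at hcvx
        simp only [smul_eq_mul] at hcvx
        have hlin : fderiv ℝ (isentropicEulerEntropy γ) v (u' - v)
            = t₀ * fderiv ℝ (isentropicEulerEntropy γ) v (u - v) := by
          rw [hu'v, ContinuousLinearMap.map_smul, smul_eq_mul]
        -- `η(u'|v) ≤ t₀ Φ`
        have hrel : lam / 2 * d₀ ^ 2 ≤ t₀ * Φ := by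
          have : isentropicEulerEntropy γ u' - isentropicEulerEntropy γ v
              - fderiv ℝ (isentropicEulerEntropy γ) v (u' - v) ≤ t₀ * Φ := by
            rw [hlin, hΦ]
            linear_combination hcvx
          exact hnear'.trans this
        -- conclude: `Φ ≥ (lam/2) d₀² / t₀ = (lam/2) d₀ ‖u-v‖ ≥ (lam d₀ /(4 B₀)) ‖u-v‖²`
        have hΦlo : lam / 2 * d₀ * ‖u - v‖ ≤ Φ := by
          have h1 : lam / 2 * d₀ ^ 2 = t₀ * (lam / 2 * d₀ * ‖u - v‖) := by
            rw [ht₀]; field_simp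
          rw [h1] at hrel
          exact le_of_mul_le_mul_left hrel ht₀pos
        calc min (ρm ^ γ / B₀ ^ 2) (lam * d₀ / (4 * B₀)) * ‖u - v‖ ^ 2
            ≤ lam * d₀ / (4 * B₀) * ‖u - v‖ ^ 2 :=
              mul_le_mul_of_nonneg_right (min_le_right _ _) (sq_nonneg _)
          _ = lam / 2 * d₀ * (‖u - v‖ / (2 * B₀)) * ‖u - v‖ := by ring
          _ ≤ lam / 2 * d₀ * 1 * ‖u - v‖ := by
              gcongr
              · exact (div_le_one (by positivity)).2 hdist
          _ = lam / 2 * d₀ * ‖u - v‖ := by ring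
          _ ≤ Φ := hΦlo
      · -- the vacuum: `η(0|v) = ρ_v^γ`
        rw [mem_singleton_iff] at hu
        subst hu
        have hvac : Φ = (v 0) ^ γ := by
          rw [hΦ]; exact relEntropy_isentropicEuler_vacuum hγ hρv.ne'
        have hvn : ‖(0 : Fin 2 → ℝ) - v‖ ≤ B₀ := by rw [zero_sub, norm_neg]; exact hnormV v hv
        have hpow : ρm ^ γ ≤ (v 0) ^ γ := Real.rpow_le_rpow hρm0.le (hρmle v hv) hγ0.le
        calc min (ρm ^ γ / B₀ ^ 2) (lam * d₀ / (4 * B₀)) * ‖(0 : Fin 2 → ℝ) - v‖ ^ 2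
            ≤ ρm ^ γ / B₀ ^ 2 * ‖(0 : Fin 2 → ℝ) - v‖ ^ 2 :=
              mul_le_mul_of_nonneg_right (min_le_left _ _) (sq_nonneg _)
          _ ≤ ρm ^ γ / B₀ ^ 2 * B₀ ^ 2 := by
              refine mul_le_mul_of_nonneg_left ?_ (by positivity)
              exact pow_le_pow_left₀ (norm_nonneg _) hvn 2
          _ = ρm ^ γ := by field_simp
          _ ≤ Φ := by rw [hvac]; exact hpow
    · -- upper bound
      have hΦup : Φ ≤ Mfar := by
        have h1 := hηU u hu
        have h2 := hηU v (Or.inl (hVsub hv))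
        have h3 := hgrad v hv (u - v)
        rw [abs_le] at h1 h2 h3
        have h4 : D * ‖u - v‖ ≤ D * (2 * B₀) := mul_le_mul_of_nonneg_left hdist hD0
        rw [hΦ, hMfar]
        linarith [h1.2, h2.1, h3.1]
      calc Φ ≤ Mfar := hΦup
        _ = Mfar / d₀ ^ 2 * d₀ ^ 2 := by field_simp
        _ ≤ Mfar / d₀ ^ 2 * ‖u - v‖ ^ 2 := mul_le_mul_of_nonneg_left hsq (by positivity)
        _ ≤ max (Lam / 2) (Mfar / d₀ ^ 2) * ‖u - v‖ ^ 2 :=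
            mul_le_mul_of_nonneg_right (le_max_right _ _) (sq_nonneg _)

end Lemma31

/-! ## Proof of Thm 1.3, §3: strong limits of entropy weak solutions are entropy weak solutions -/

section StrongLimits

/-- Markov: `L²`-convergence (`∫ |f_k - g|² → 0`) implies convergence in measure. [folklore] -/
theorem tendstoInMeasure_of_tendsto_lintegral_sq {α E : Type*} [MeasurableSpace α]
    {μ : Measure α} [NormedAddCommGroup E] [MeasurableSpace E] [BorelSpace E]
    [SecondCountableTopology E] {f : ℕ → α → E} {g : α → E}
    (hf : ∀ k, Measurable (f k)) (hg : Measurable g)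
    (h : Tendsto (fun k => ∫⁻ x, ‖f k x - g x‖ₑ ^ 2 ∂μ) atTop (𝓝 0)) :
    TendstoInMeasure μ f atTop g := by
  intro ε hε
  by_cases htop : ε = ⊤
  · subst htop
    have : ∀ k, μ {x | (⊤ : ℝ≥0∞) ≤ edist (f k x) (g x)} = 0 := by
      intro k
      have : {x | (⊤ : ℝ≥0∞) ≤ edist (f k x) (g x)} = ∅ := by
        ext x; simp [edist_ne_top]
      rw [this, measure_empty]
    simp only [this]
    exact tendsto_const_nhds
  have hε2 : ε ^ 2 ≠ 0 := pow_ne_zero _ hε.ne'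
  have hε2' : ε ^ 2 ≠ ⊤ := ENNReal.pow_ne_top htop
  have hbound : ∀ k, μ {x | ε ≤ edist (f k x) (g x)} ≤ (∫⁻ x, ‖f k x - g x‖ₑ ^ 2 ∂μ) / ε ^ 2 := by
    intro k
    have hsub : {x | ε ≤ edist (f k x) (g x)} ⊆ {x | ε ^ 2 ≤ ‖f k x - g x‖ₑ ^ 2} := by
      intro x hx
      simp only [mem_setOf_eq] at hx ⊢
      rw [edist_eq_enorm_sub] at hx
      exact pow_le_pow_left' hx 2
    refine (measure_mono hsub).trans ?_
    exact meas_ge_le_lintegral_div (((hf k).sub hg).enorm.pow_const 2).aemeasurable hε2 hε2'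
  have hlim : Tendsto (fun k => (∫⁻ x, ‖f k x - g x‖ₑ ^ 2 ∂μ) / ε ^ 2) atTop (𝓝 0) := by
    have := ENNReal.Tendsto.div_const h (Or.inr hε2)
    simpa using this
  exact tendsto_of_tendsto_of_tendsto_of_le_of_le tendsto_const_nhds hlim (fun k => zero_le)
    hbound

/-- From `L^∞(0,T; L²(-R,R))` smallness to `L²((0,T) × (-R,R))` smallness:
`∬_{(0,T)×(-R,R)} G ≤ T · ess sup_{t∈(0,T)} ∫_{(-R,R)} G(t,·)`. [folklore] -/
theorem lintegral_box_le_mul_essSup {G : ℝ × ℝ → ℝ≥0∞} (hG : Measurable G) (T R : ℝ) :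
    ∫⁻ p in Ioo (0 : ℝ) T ×ˢ Ioo (-R) R, G p
      ≤ ENNReal.ofReal T * essSup (fun t => ∫⁻ x in Ioo (-R) R, G (t, x))
          (volume.restrict (Ioo 0 T)) := by
  rw [Measure.volume_eq_prod, ← Measure.prod_restrict, lintegral_prod _ hG.aemeasurable]
  set E := essSup (fun t => ∫⁻ x in Ioo (-R) R, G (t, x)) (volume.restrict (Ioo 0 T)) with hE
  calc ∫⁻ t in Ioo 0 T, ∫⁻ x in Ioo (-R) R, G (t, x)
      ≤ ∫⁻ _ in Ioo (0 : ℝ) T, E := lintegral_mono_ae (ENNReal.ae_le_essSup _)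
    _ = ENNReal.ofReal T * E := by
        rw [lintegral_const, Measure.restrict_apply_univ, Real.volume_Ioo, mul_comm]
        simp

/-- `L^∞(0,T; L²(-R,R))` convergence (the mode of Thm 1.3) implies `L²_loc` convergence in
space-time. [folklore] -/
theorem tendsto_lintegral_box_of_tendsto_essSup {w : ℕ → ℝ → ℝ → Fin n → ℝ}
    {ψ : ℝ → ℝ → Fin n → ℝ} (hw : ∀ k, Measurable (Function.uncurry (w k)))
    (hψ : Measurable (Function.uncurry ψ)) {T R : ℝ}
    (h : Tendsto (fun k => essSup (fun t => ∫⁻ x in Ioo (-R) R, ‖w k t x - ψ t x‖ₑ ^ 2)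
      (volume.restrict (Ioo 0 T))) atTop (𝓝 0)) :
    Tendsto (fun k => ∫⁻ p in Ioo (0 : ℝ) T ×ˢ Ioo (-R) R, ‖w k p.1 p.2 - ψ p.1 p.2‖ₑ ^ 2)
      atTop (𝓝 0) := by
  have hmeas : ∀ k, Measurable fun p : ℝ × ℝ => ‖w k p.1 p.2 - ψ p.1 p.2‖ₑ ^ 2 := fun k =>
    ((hw k).sub hψ).enorm.pow_const 2
  have hle := fun k => lintegral_box_le_mul_essSup (hmeas k) T R
  have hlim : Tendsto (fun k => ENNReal.ofReal T * essSup (fun t => ∫⁻ x in Ioo (-R) R,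
      ‖w k t x - ψ t x‖ₑ ^ 2) (volume.restrict (Ioo 0 T))) atTop (𝓝 0) := by
    have := ENNReal.Tendsto.const_mul (a := ENNReal.ofReal T) h (Or.inr ENNReal.ofReal_ne_top)
    simpa using this
  exact tendsto_of_tendsto_of_tendsto_of_le_of_le tendsto_const_nhds hlim (fun k => zero_le) hle

/-- **Core limit lemma for weak forms** (proof of Thm 1.3, §3: "Since the convergence is strong
and `u_m` verifies (1.1) (1.3), the limit `ψ` is also solution to (1.1) (1.3)"): if
`v_k → ψ` in `L²_loc` of space-time (`t > 0`) and the data `v_k⁰ → u⁰` in `L²_loc`, all valued in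
a set `W` on which the (measurable) nonlinearities `g₁, g₂, h₀` are continuous and bounded, then
along a subsequence the weak-form functionals
`∫_{t>0}∫ (A g₁(v_k) + D g₂(v_k)) + ∫ a₀ h₀(v_k⁰)` (with `A, D, a₀` continuous of square support)
converge to the functional of the limit (a.e. convergent subsequences by Markov/Borel–Cantelli,
then dominated convergence). [folklore] -/
theorem exists_subseq_tendsto_weakForm {g₁ g₂ h₀ : (Fin n → ℝ) → ℝ} {W : Set (Fin n → ℝ)}
    {B : ℝ} (hg₁m : Measurable g₁) (hg₂m : Measurable g₂) (hh₀m : Measurable h₀)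
    (hg₁c : ContinuousOn g₁ W) (hg₂c : ContinuousOn g₂ W) (hh₀c : ContinuousOn h₀ W)
    (hB : ∀ w ∈ W, |g₁ w| ≤ B ∧ |g₂ w| ≤ B ∧ |h₀ w| ≤ B)
    {v : ℕ → ℝ → ℝ → Fin n → ℝ} {ψ : ℝ → ℝ → Fin n → ℝ} {v₀ : ℕ → ℝ → Fin n → ℝ}
    {u₀ : ℝ → Fin n → ℝ}
    (hvm : ∀ k, Measurable (Function.uncurry (v k))) (hψm : Measurable (Function.uncurry ψ))
    (hv₀m : ∀ k, Measurable (v₀ k)) (hu₀m : Measurable u₀)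
    (hvW : ∀ k t x, 0 < t → v k t x ∈ W) (hψW : ∀ t x, 0 < t → ψ t x ∈ W)
    (hv₀W : ∀ k x, v₀ k x ∈ W) (hu₀W : ∀ x, u₀ x ∈ W)
    (hdata : ∀ R : ℝ, 0 < R →
      Tendsto (fun k => ∫⁻ x in Ioo (-R) R, ‖v₀ k x - u₀ x‖ₑ ^ 2) atTop (𝓝 0))
    (hconv : ∀ T R : ℝ, 0 < T → 0 < R →
      Tendsto (fun k => ∫⁻ p in Ioo (0 : ℝ) T ×ˢ Ioo (-R) R, ‖v k p.1 p.2 - ψ p.1 p.2‖ₑ ^ 2)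
        atTop (𝓝 0))
    {A D : ℝ × ℝ → ℝ} {a₀ : ℝ → ℝ} (hAc : Continuous A) (hDc : Continuous D)
    (ha₀c : Continuous a₀) {R₀ : ℝ}
    (hAs : ∀ p : ℝ × ℝ, (R₀ < |p.1| ∨ R₀ < |p.2|) → A p = 0)
    (hDs : ∀ p : ℝ × ℝ, (R₀ < |p.1| ∨ R₀ < |p.2|) → D p = 0)
    (ha₀s : ∀ x : ℝ, R₀ < |x| → a₀ x = 0) :
    ∃ ns : ℕ → ℕ, StrictMono ns ∧
      Tendsto (fun j => (∫ t in Ioi (0 : ℝ), ∫ x : ℝ,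
          (A (t, x) * g₁ (v (ns j) t x) + D (t, x) * g₂ (v (ns j) t x)))
        + ∫ x : ℝ, a₀ x * h₀ (v₀ (ns j) x)) atTop
      (𝓝 ((∫ t in Ioi (0 : ℝ), ∫ x : ℝ, (A (t, x) * g₁ (ψ t x) + D (t, x) * g₂ (ψ t x)))
        + ∫ x : ℝ, a₀ x * h₀ (u₀ x))) := by
  -- a positive radius above `R₀`
  set R := max R₀ 0 + 1 with hR
  have hR0 : 0 < R := by rw [hR]; have := le_max_right R₀ 0; linarith
  have hRR₀ : R₀ < R := by rw [hR]; have := le_max_left R₀ 0; linarith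
  -- Step 1: an a.e. convergent subsequence in space-time on the box
  set Box : Set (ℝ × ℝ) := Ioo (0 : ℝ) R ×ˢ Ioo (-R) R with hBox
  have hBoxm : MeasurableSet Box := measurableSet_Ioo.prod measurableSet_Ioo
  have h1 : TendstoInMeasure (volume.restrict Box) (fun k (p : ℝ × ℝ) => v k p.1 p.2) atTop
      (fun p => ψ p.1 p.2) :=
    tendstoInMeasure_of_tendsto_lintegral_sq (fun k => hvm k) hψm (hconv R R hR0 hR0)
  obtain ⟨ns₁, hns₁, hae₁⟩ := h1.exists_seq_tendsto_ae
  -- Step 2: a further subsequence along which the data converge a.e.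
  have h2 : TendstoInMeasure (volume.restrict (Ioo (-R) R)) (fun j x => v₀ (ns₁ j) x) atTop u₀ :=
    tendstoInMeasure_of_tendsto_lintegral_sq (fun j => hv₀m _) hu₀m
      ((hdata R hR0).comp hns₁.tendsto_atTop)
  obtain ⟨ns₂, hns₂, hae₂⟩ := h2.exists_seq_tendsto_ae
  refine ⟨ns₁ ∘ ns₂, hns₁.comp hns₂, ?_⟩
  have hae₁' : ∀ᵐ p ∂(volume.restrict Box),
      Tendsto (fun j => v (ns₁ (ns₂ j)) p.1 p.2) atTop (𝓝 (ψ p.1 p.2)) :=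
    hae₁.mono fun p hp => hp.comp hns₂.tendsto_atTop
  -- Step 3: the space-time term, by dominated convergence on the half plane
  set μ : Measure (ℝ × ℝ) := ((volume : Measure ℝ).restrict (Ioi 0)).prod volume with hμ
  have hμ' : μ = (volume : Measure (ℝ × ℝ)).restrict (Ioi 0 ×ˢ univ) := by
    rw [hμ, Measure.restrict_prod_eq_prod_univ, Measure.volume_eq_prod]
  have haeμ : ∀ᵐ p ∂μ, 0 < p.1 := by
    rw [hμ']
    filter_upwards [ae_restrict_mem (measurableSet_Ioi.prod MeasurableSet.univ)] with p hp
    exact hp.1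
  have hconvμ : ∀ᵐ p ∂μ, p ∈ Box →
      Tendsto (fun j => v (ns₁ (ns₂ j)) p.1 p.2) atTop (𝓝 (ψ p.1 p.2)) := by
    have := (ae_restrict_iff' hBoxm).1 hae₁'
    rw [hμ']
    exact ae_restrict_of_ae this
  set G : ℕ → ℝ × ℝ → ℝ := fun k p => A p * g₁ (v k p.1 p.2) + D p * g₂ (v k p.1 p.2) with hG
  set Gψ : ℝ × ℝ → ℝ := fun p => A p * g₁ (ψ p.1 p.2) + D p * g₂ (ψ p.1 p.2) with hGψ
  set bound : ℝ × ℝ → ℝ := fun p => (|A p| + |D p|) * B with hbound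
  have hADs : ∀ p : ℝ × ℝ, (R₀ < |p.1| ∨ R₀ < |p.2|) → (|A p| + |D p|) * B = 0 := by
    intro p hp; simp [hAs p hp, hDs p hp]
  have hbound_int : Integrable bound μ :=
    integrable_prod_Ioi_of_continuous
      (((continuous_abs.comp hAc).add (continuous_abs.comp hDc)).mul continuous_const) hADs
  have hGmeas : ∀ k, AEStronglyMeasurable (G k) μ := fun k =>
    ((hAc.measurable.mul (hg₁m.comp (hvm k))).add
      (hDc.measurable.mul (hg₂m.comp (hvm k)))).aestronglyMeasurable
  have hGψmeas : AEStronglyMeasurable Gψ μ :=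
    ((hAc.measurable.mul (hg₁m.comp hψm)).add
      (hDc.measurable.mul (hg₂m.comp hψm))).aestronglyMeasurable
  have hGle : ∀ k, ∀ᵐ p ∂μ, ‖G k p‖ ≤ bound p := fun k => haeμ.mono fun p hp => by
    obtain ⟨b1, b2, -⟩ := hB _ (hvW k p.1 p.2 hp)
    rw [Real.norm_eq_abs, hG, hbound]
    calc |A p * g₁ (v k p.1 p.2) + D p * g₂ (v k p.1 p.2)|
        ≤ |A p * g₁ (v k p.1 p.2)| + |D p * g₂ (v k p.1 p.2)| := abs_add_le _ _
      _ = |A p| * |g₁ (v k p.1 p.2)| + |D p| * |g₂ (v k p.1 p.2)| := by rw [abs_mul, abs_mul]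
      _ ≤ |A p| * B + |D p| * B :=
          add_le_add (mul_le_mul_of_nonneg_left b1 (abs_nonneg _))
            (mul_le_mul_of_nonneg_left b2 (abs_nonneg _))
      _ = (|A p| + |D p|) * B := by ring
  have hGψle : ∀ᵐ p ∂μ, ‖Gψ p‖ ≤ bound p := haeμ.mono fun p hp => by
    obtain ⟨b1, b2, -⟩ := hB _ (hψW p.1 p.2 hp)
    rw [Real.norm_eq_abs, hGψ, hbound]
    calc |A p * g₁ (ψ p.1 p.2) + D p * g₂ (ψ p.1 p.2)|
        ≤ |A p * g₁ (ψ p.1 p.2)| + |D p * g₂ (ψ p.1 p.2)| := abs_add_le _ _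
      _ = |A p| * |g₁ (ψ p.1 p.2)| + |D p| * |g₂ (ψ p.1 p.2)| := by rw [abs_mul, abs_mul]
      _ ≤ |A p| * B + |D p| * B :=
          add_le_add (mul_le_mul_of_nonneg_left b1 (abs_nonneg _))
            (mul_le_mul_of_nonneg_left b2 (abs_nonneg _))
      _ = (|A p| + |D p|) * B := by ring
  have hGlim : ∀ᵐ p ∂μ, Tendsto (fun j => G (ns₁ (ns₂ j)) p) atTop (𝓝 (Gψ p)) := by
    filter_upwards [haeμ, hconvμ] with p hp hpconv
    by_cases hbox : p ∈ Box
    · have hv := hpconv hbox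
      have hvin : Tendsto (fun j => v (ns₁ (ns₂ j)) p.1 p.2) atTop (𝓝[W] (ψ p.1 p.2)) :=
        tendsto_nhdsWithin_iff.2 ⟨hv, Eventually.of_forall fun j => hvW _ _ _ hp⟩
      have hW1 : Tendsto (fun j => g₁ (v (ns₁ (ns₂ j)) p.1 p.2)) atTop (𝓝 (g₁ (ψ p.1 p.2))) :=
        (hg₁c _ (hψW _ _ hp)).tendsto.comp hvin
      have hW2 : Tendsto (fun j => g₂ (v (ns₁ (ns₂ j)) p.1 p.2)) atTop (𝓝 (g₂ (ψ p.1 p.2))) :=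
        (hg₂c _ (hψW _ _ hp)).tendsto.comp hvin
      have := (hW1.const_mul (A p)).add (hW2.const_mul (D p))
      simpa [hG, hGψ] using this
    · have hout : R₀ < |p.1| ∨ R₀ < |p.2| := by
        rw [hBox, mem_prod, mem_Ioo, mem_Ioo, not_and_or] at hbox
        rcases hbox with h | h
        · left
          have : R ≤ p.1 := by
            by_contra hlt; exact h ⟨hp, lt_of_not_ge hlt⟩
          exact lt_of_lt_of_le hRR₀ (this.trans (le_abs_self _))
        · right
          have : R ≤ |p.2| := by
            by_contra hlt
            have h' := abs_lt.1 (lt_of_not_ge hlt)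
            exact h ⟨h'.1, h'.2⟩
          exact lt_of_lt_of_le hRR₀ this
      have hA0 := hAs p hout
      have hD0 := hDs p hout
      simp only [hG, hGψ, hA0, hD0, zero_mul, add_zero]
      exact tendsto_const_nhds
  have key1 := tendsto_integral_of_dominated_convergence bound (fun j => hGmeas _) hbound_int
    (fun j => hGle _) hGlim
  -- Step 4: the data term, by dominated convergence on the line
  set g0 : ℕ → ℝ → ℝ := fun k x => a₀ x * h₀ (v₀ k x) with hg0
  set g0ψ : ℝ → ℝ := fun x => a₀ x * h₀ (u₀ x) with hg0ψ
  set bound0 : ℝ → ℝ := fun x => |a₀ x| * B with hbound0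
  have hbound0_int : Integrable bound0 := by
    refine ((continuous_abs.comp ha₀c).mul continuous_const).integrable_of_hasCompactSupport ?_
    exact hasCompactSupport_of_interval (R := R₀) fun x hx => by simp [ha₀s x hx]
  have hg0meas : ∀ k, AEStronglyMeasurable (g0 k) volume := fun k =>
    (ha₀c.measurable.mul (hh₀m.comp (hv₀m k))).aestronglyMeasurable
  have hg0le : ∀ k, ∀ᵐ x ∂volume, ‖g0 k x‖ ≤ bound0 x := fun k => Eventually.of_forall fun x => by
    obtain ⟨-, -, b3⟩ := hB _ (hv₀W k x)
    rw [Real.norm_eq_abs, hg0, hbound0]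
    simp only [abs_mul]
    exact mul_le_mul_of_nonneg_left b3 (abs_nonneg _)
  have hg0lim : ∀ᵐ x ∂volume, Tendsto (fun j => g0 (ns₁ (ns₂ j)) x) atTop (𝓝 (g0ψ x)) := by
    have hae₂' := (ae_restrict_iff' (μ := volume) measurableSet_Ioo).1 hae₂
    filter_upwards [hae₂'] with x hx
    by_cases hxin : x ∈ Ioo (-R) R
    · have hv := hx hxin
      have hvin : Tendsto (fun j => v₀ (ns₁ (ns₂ j)) x) atTop (𝓝[W] (u₀ x)) :=
        tendsto_nhdsWithin_iff.2 ⟨hv, Eventually.of_forall fun j => hv₀W _ _⟩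
      have hW3 : Tendsto (fun j => h₀ (v₀ (ns₁ (ns₂ j)) x)) atTop (𝓝 (h₀ (u₀ x))) :=
        (hh₀c _ (hu₀W x)).tendsto.comp hvin
      have := hW3.const_mul (a₀ x)
      simpa [hg0, hg0ψ] using this
    · have hout : R₀ < |x| := by
        rw [mem_Ioo, not_and_or] at hxin
        have : R ≤ |x| := by
          by_contra hlt
          have h' := abs_lt.1 (lt_of_not_ge hlt)
          rcases hxin with h | h
          · exact h h'.1
          · exact h h'.2
        exact lt_of_lt_of_le hRR₀ this
      simp only [hg0, hg0ψ, ha₀s x hout, zero_mul]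
      exact tendsto_const_nhds
  have key2 := tendsto_integral_of_dominated_convergence bound0 (fun j => hg0meas _) hbound0_int
    (fun j => hg0le _) hg0lim
  -- Step 5: iterated integrals are integrals on `μ`; combine
  have hGint : ∀ k, Integrable (G k) μ := fun k => hbound_int.mono' (hGmeas k) (hGle k)
  have hGψint : Integrable Gψ μ := hbound_int.mono' hGψmeas hGψle
  have hiter : ∀ k, ∫ t in Ioi (0 : ℝ), ∫ x : ℝ, (A (t, x) * g₁ (v k t x) + D (t, x) * g₂ (v k t x))
      = ∫ p, G k p ∂μ := fun k => (integral_prod (G k) (hGint k)).symm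
  have hiterψ : ∫ t in Ioi (0 : ℝ), ∫ x : ℝ, (A (t, x) * g₁ (ψ t x) + D (t, x) * g₂ (ψ t x))
      = ∫ p, Gψ p ∂μ := (integral_prod Gψ hGψint).symm
  have hrw : (fun j => (∫ t in Ioi (0 : ℝ), ∫ x : ℝ,
        (A (t, x) * g₁ (v (ns₁ (ns₂ j)) t x) + D (t, x) * g₂ (v (ns₁ (ns₂ j)) t x)))
        + ∫ x : ℝ, a₀ x * h₀ (v₀ (ns₁ (ns₂ j)) x))
      = fun j => (∫ p, G (ns₁ (ns₂ j)) p ∂μ) + ∫ x, g0 (ns₁ (ns₂ j)) x := by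
    funext j; rw [hiter]
  show Tendsto (fun j => (∫ t in Ioi (0 : ℝ), ∫ x : ℝ,
        (A (t, x) * g₁ (v (ns₁ (ns₂ j)) t x) + D (t, x) * g₂ (v (ns₁ (ns₂ j)) t x)))
        + ∫ x : ℝ, a₀ x * h₀ (v₀ (ns₁ (ns₂ j)) x)) atTop
      (𝓝 ((∫ t in Ioi (0 : ℝ), ∫ x : ℝ, (A (t, x) * g₁ (ψ t x) + D (t, x) * g₂ (ψ t x)))
        + ∫ x : ℝ, a₀ x * h₀ (u₀ x)))
  rw [hrw, hiterψ]
  exact key1.add key2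

/-- **Strong `L²_loc` limits of entropy weak solutions are entropy weak solutions** (proof of
Thm 1.3, §3). Setting: flux `f` and entropy pair `(η, q)` measurable, continuous and bounded on a
set `W` of states containing all values (`t > 0`) of the solutions `v_k`, of the limit `ψ`, and
of the data; `v_k → ψ` in `L²((0,T) × (-R,R))` and `v_k⁰ → u⁰` in `L²(-R,R)` for all `T, R`.
Then `ψ` is an entropy weak solution with datum `u⁰` (each weak identity / entropy inequality
passes to the limit along an a.e.-convergent subsequence, `exists_subseq_tendsto_weakForm`).
[cite: ChenKrupaVasseur2022, Thm 1.3 (proof, §3)] -/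
theorem isEntropyWeakSolution_of_tendsto {f : (Fin n → ℝ) → (Fin n → ℝ)} {η q : (Fin n → ℝ) → ℝ}
    {W : Set (Fin n → ℝ)} {B : ℝ}
    (hfm : Measurable f) (hηm : Measurable η) (hqm : Measurable q)
    (hfc : ContinuousOn f W) (hηc : ContinuousOn η W) (hqc : ContinuousOn q W)
    (hB : ∀ w ∈ W, ‖w‖ ≤ B ∧ ‖f w‖ ≤ B ∧ |η w| ≤ B ∧ |q w| ≤ B)
    {v : ℕ → ℝ → ℝ → Fin n → ℝ} {ψ : ℝ → ℝ → Fin n → ℝ} {v₀ : ℕ → ℝ → Fin n → ℝ}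
    {u₀ : ℝ → Fin n → ℝ}
    (hvm : ∀ k, Measurable (Function.uncurry (v k))) (hψm : Measurable (Function.uncurry ψ))
    (hv₀m : ∀ k, Measurable (v₀ k)) (hu₀m : Measurable u₀)
    (hvW : ∀ k t x, 0 < t → v k t x ∈ W) (hψW : ∀ t x, 0 < t → ψ t x ∈ W)
    (hv₀W : ∀ k x, v₀ k x ∈ W) (hu₀W : ∀ x, u₀ x ∈ W)
    (hsol : ∀ k, IsEntropyWeakSolution f η q (v₀ k) (v k))
    (hdata : ∀ R : ℝ, 0 < R →
      Tendsto (fun k => ∫⁻ x in Ioo (-R) R, ‖v₀ k x - u₀ x‖ₑ ^ 2) atTop (𝓝 0))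
    (hconv : ∀ T R : ℝ, 0 < T → 0 < R →
      Tendsto (fun k => ∫⁻ p in Ioo (0 : ℝ) T ×ˢ Ioo (-R) R, ‖v k p.1 p.2 - ψ p.1 p.2‖ₑ ^ 2)
        atTop (𝓝 0)) :
    IsEntropyWeakSolution f η q u₀ ψ := by
  -- common preparation for a test function
  have prep : ∀ φ : ℝ × ℝ → ℝ, ContDiff ℝ (⊤ : ℕ∞) φ → HasCompactSupport φ →
      ∃ (A D : ℝ × ℝ → ℝ) (R₀ : ℝ), Continuous A ∧ Continuous D ∧
        (∀ p : ℝ × ℝ, (R₀ < |p.1| ∨ R₀ < |p.2|) → A p = 0) ∧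
        (∀ p : ℝ × ℝ, (R₀ < |p.1| ∨ R₀ < |p.2|) → D p = 0) ∧
        (∀ x : ℝ, R₀ < |x| → φ (0, x) = 0) ∧
        (∀ t x, deriv (fun s => φ (s, x)) t = A (t, x)) ∧
        (∀ t x, deriv (fun y => φ (t, y)) x = D (t, x)) := by
    intro φ hφ hsupp
    have hφ1 : ContDiff ℝ 1 φ := hφ.of_le (by exact_mod_cast le_top)
    obtain ⟨R₀, -, hRφ⟩ := exists_radius_of_hasCompactSupport hsupp
    refine ⟨fun p => fderiv ℝ φ p (1, 0), fun p => fderiv ℝ φ p (0, 1), R₀,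
      (hφ1.continuous_fderiv one_ne_zero).clm_apply continuous_const,
      (hφ1.continuous_fderiv one_ne_zero).clm_apply continuous_const,
      fun p hp => by simp [(hRφ p hp).2], fun p hp => by simp [(hRφ p hp).2],
      fun x hx => (hRφ (0, x) (Or.inr hx)).1,
      fun t x => (hasDerivAt_testSlice_t hφ1 t x).deriv,
      fun t x => (hasDerivAt_testSlice_x hφ1 t x).deriv⟩
  constructor
  · -- the weak identities
    intro i φ hφ hsupp
    obtain ⟨A, D, R₀, hAc, hDc, hAs, hDs, h0s, hdt, hdx⟩ := prep φ hφ hsupp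
    have hφc : Continuous φ := (hφ.of_le (by exact_mod_cast le_top) : ContDiff ℝ 1 φ).continuous
    obtain ⟨ns, -, hlim⟩ := exists_subseq_tendsto_weakForm (W := W) (B := B)
      (g₁ := fun w => w i) (g₂ := fun w => f w i) (h₀ := fun w => w i)
      (measurable_pi_apply i) ((measurable_pi_apply i).comp hfm) (measurable_pi_apply i)
      (continuous_apply i).continuousOn ((continuous_apply i).comp_continuousOn hfc)
      (continuous_apply i).continuousOn
      (fun w hw => ⟨(norm_le_pi_norm w i).trans (hB w hw).1,
        (norm_le_pi_norm (f w) i).trans (hB w hw).2.1, (norm_le_pi_norm w i).trans (hB w hw).1⟩)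
      hvm hψm hv₀m hu₀m hvW hψW hv₀W hu₀W hdata hconv hAc hDc
      (hφc.comp (Continuous.prodMk_right 0)) hAs hDs h0s
    have hzero : ∀ j, (∫ t in Ioi (0 : ℝ), ∫ x : ℝ,
        (A (t, x) * v (ns j) t x i + D (t, x) * f (v (ns j) t x) i))
        + ∫ x : ℝ, φ (0, x) * v₀ (ns j) x i = 0 := by
      intro j
      have := (hsol (ns j)).1 i φ hφ hsupp
      simpa only [hdt, hdx] using this
    have hlim0 := hlim.congr (f₂ := fun _ => (0 : ℝ)) hzero
    have := tendsto_nhds_unique tendsto_const_nhds hlim0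
    simp only [hdt, hdx]
    exact this.symm
  · -- the entropy inequality
    intro φ hφ hsupp hφ0
    obtain ⟨A, D, R₀, hAc, hDc, hAs, hDs, h0s, hdt, hdx⟩ := prep φ hφ hsupp
    have hφc : Continuous φ := (hφ.of_le (by exact_mod_cast le_top) : ContDiff ℝ 1 φ).continuous
    obtain ⟨ns, -, hlim⟩ := exists_subseq_tendsto_weakForm (W := W) (B := B)
      (g₁ := η) (g₂ := q) (h₀ := η) hηm hqm hηm hηc hqc hηc
      (fun w hw => ⟨(hB w hw).2.2.1, (hB w hw).2.2.2, (hB w hw).2.2.1⟩)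
      hvm hψm hv₀m hu₀m hvW hψW hv₀W hu₀W hdata hconv hAc hDc
      (hφc.comp (Continuous.prodMk_right 0)) hAs hDs h0s
    have hnonneg : ∀ j, 0 ≤ (∫ t in Ioi (0 : ℝ), ∫ x : ℝ,
        (A (t, x) * η (v (ns j) t x) + D (t, x) * q (v (ns j) t x)))
        + ∫ x : ℝ, φ (0, x) * η (v₀ (ns j) x) := by
      intro j
      have := (hsol (ns j)).2 φ hφ hsupp hφ0
      simpa only [hdt, hdx] using this
    simp only [hdt, hdx]
    exact ge_of_tendsto' hlim hnonneg

/-- The same with convergence in the mode of Thm 1.3, `L^∞(0,T; L²(-R,R))` for all `T, R > 0`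
(which implies `L²_loc` convergence in space-time, `tendsto_lintegral_box_of_tendsto_essSup`).
[cite: ChenKrupaVasseur2022, Thm 1.3 (proof, §3)] -/
theorem isEntropyWeakSolution_of_tendsto_essSup {f : (Fin n → ℝ) → (Fin n → ℝ)}
    {η q : (Fin n → ℝ) → ℝ} {W : Set (Fin n → ℝ)} {B : ℝ}
    (hfm : Measurable f) (hηm : Measurable η) (hqm : Measurable q)
    (hfc : ContinuousOn f W) (hηc : ContinuousOn η W) (hqc : ContinuousOn q W)
    (hB : ∀ w ∈ W, ‖w‖ ≤ B ∧ ‖f w‖ ≤ B ∧ |η w| ≤ B ∧ |q w| ≤ B)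
    {v : ℕ → ℝ → ℝ → Fin n → ℝ} {ψ : ℝ → ℝ → Fin n → ℝ} {v₀ : ℕ → ℝ → Fin n → ℝ}
    {u₀ : ℝ → Fin n → ℝ}
    (hvm : ∀ k, Measurable (Function.uncurry (v k))) (hψm : Measurable (Function.uncurry ψ))
    (hv₀m : ∀ k, Measurable (v₀ k)) (hu₀m : Measurable u₀)
    (hvW : ∀ k t x, 0 < t → v k t x ∈ W) (hψW : ∀ t x, 0 < t → ψ t x ∈ W)
    (hv₀W : ∀ k x, v₀ k x ∈ W) (hu₀W : ∀ x, u₀ x ∈ W)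
    (hsol : ∀ k, IsEntropyWeakSolution f η q (v₀ k) (v k))
    (hdata : ∀ R : ℝ, 0 < R →
      Tendsto (fun k => ∫⁻ x in Ioo (-R) R, ‖v₀ k x - u₀ x‖ₑ ^ 2) atTop (𝓝 0))
    (hconv : ∀ T R : ℝ, 0 < T → 0 < R →
      Tendsto (fun k => essSup (fun t => ∫⁻ x in Ioo (-R) R, ‖v k t x - ψ t x‖ₑ ^ 2)
        (volume.restrict (Ioo 0 T))) atTop (𝓝 0)) :
    IsEntropyWeakSolution f η q u₀ ψ :=
  isEntropyWeakSolution_of_tendsto hfm hηm hqm hfc hηc hqc hB hvm hψm hv₀m hu₀m hvW hψW hv₀W hu₀W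
    hsol hdata fun T R _ _ => tendsto_lintegral_box_of_tendsto_essSup hvm hψm (hconv T R ‹_› ‹_›)

/-- **Strong limits of wild solutions of isentropic Euler are entropy weak solutions** (the step
"the limit `ψ` is also solution to (1.1) (1.3), with initial value `u⁰`" of the proof of Thm 1.3,
for the system of Lemma 4.5): if `v_k ∈ 𝒮_weak` with data `v_k⁰` valued in `𝒰₀`,
`v_k⁰ → u⁰` in `L²_loc`, `v_k → ψ` in `L^∞(0,T; L²(-R,R))` for all `T, R > 0`, and the limit `ψ`
and datum `u⁰` are (jointly) measurable and valued in `𝒰₀`, then `ψ` is an entropy weak solution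
with datum `u⁰`. [cite: ChenKrupaVasseur2022, Thm 1.3 (proof, §3) with Lemma 4.5] -/
theorem isEntropyWeakSolution_of_tendsto_isentropicEuler (hγ : 1 < γ) (hC : 0 < C)
    {v : ℕ → ℝ → ℝ → Fin 2 → ℝ} {ψ : ℝ → ℝ → Fin 2 → ℝ} {v₀ : ℕ → ℝ → Fin 2 → ℝ}
    {u₀ : ℝ → Fin 2 → ℝ}
    (hv : ∀ k, InSweak (isentropicEulerFlux γ) (isentropicEulerEntropy γ)
      (isentropicEulerEntropyFlux γ) (isentropicEulerStates γ C) (v₀ k) (v k))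
    (hv₀ : ∀ k x, v₀ k x ∈ isentropicEulerStates γ C)
    (hψm : Measurable (Function.uncurry ψ)) (hu₀m : Measurable u₀)
    (hψ : ∀ t x, 0 < t → ψ t x ∈ isentropicEulerStates γ C) (hu₀ : ∀ x, u₀ x ∈ isentropicEulerStates γ C)
    (hdata : ∀ R : ℝ, 0 < R →
      Tendsto (fun k => ∫⁻ x in Ioo (-R) R, ‖v₀ k x - u₀ x‖ₑ ^ 2) atTop (𝓝 0))
    (hconv : ∀ T R : ℝ, 0 < T → 0 < R →
      Tendsto (fun k => essSup (fun t => ∫⁻ x in Ioo (-R) R, ‖v k t x - ψ t x‖ₑ ^ 2)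
        (volume.restrict (Ioo 0 T))) atTop (𝓝 0)) :
    IsEntropyWeakSolution (isentropicEulerFlux γ) (isentropicEulerEntropy γ)
      (isentropicEulerEntropyFlux γ) u₀ ψ := by
  obtain ⟨hfc, hηc, hqc⟩ := continuousOn_isentropicEuler_states (C := C) hγ
  -- a common bound on `𝒰₀`
  set P := (2 * C / isentropicEulerC₁ γ) ^ (2 / (γ - 1)) with hP
  have hPpos : 0 < P := Real.rpow_pos_of_pos (div_pos (by linarith) (isentropicEulerC₁_pos hγ)) _
  have hγ1 : 0 < γ - 1 := by linarith
  set B := P * (1 + C) + (P * (1 + C) * C + P ^ γ) + (P * C ^ 2 + P ^ γ / (γ - 1))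
    + C * (P * C ^ 2 + γ / (γ - 1) * P ^ γ) with hBdef
  have hPγ : 0 ≤ P ^ γ := Real.rpow_nonneg hPpos.le _
  have t1 : 0 ≤ P * (1 + C) := by positivity
  have t2 : 0 ≤ P * (1 + C) * C + P ^ γ := by positivity
  have t3 : 0 ≤ P * C ^ 2 + P ^ γ / (γ - 1) := by positivity
  have t4 : 0 ≤ C * (P * C ^ 2 + γ / (γ - 1) * P ^ γ) := by positivity
  have hall : ∀ w ∈ isentropicEulerStates γ C, ‖w‖ ≤ B ∧ ‖isentropicEulerFlux γ w‖ ≤ B ∧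
      |isentropicEulerEntropy γ w| ≤ B ∧ |isentropicEulerEntropyFlux γ w| ≤ B := by
    intro w hw
    rcases hw with hw | hw
    · have hn := norm_le_of_mem_isentropicEulerInterior hγ hC hw
      obtain ⟨hf, hη, hq⟩ := bounds_of_mem_isentropicEulerInterior hγ hC hw
      refine ⟨?_, ?_, ?_, ?_⟩ <;> linarith
    · rw [mem_singleton_iff] at hw
      subst hw
      obtain ⟨hf, hη, hq⟩ := isentropicEuler_vacuum γ hγ
      rw [hf, hη, hq, norm_zero, abs_zero]
      have : 0 ≤ B := by positivity
      exact ⟨this, this, this, this⟩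
  exact isEntropyWeakSolution_of_tendsto_essSup (measurable_isentropicEulerFlux γ)
    (measurable_isentropicEulerEntropy γ) (measurable_isentropicEulerEntropyFlux γ) hfc hηc hqc
    hall (fun k => (hv k).1) hψm (fun k => (hv k).2.1) hu₀m
    (fun k t x ht => (hv k).2.2.1 t x ht.le) hψ hv₀ hu₀ (fun k => (hv k).2.2.2.2.1) hdata hconv

end StrongLimits

/-! ## §1: the Riemann invariants `w_{1,2} = v ∓ c₁ρ^{(γ-1)/2}` (validation of the constant `c₁`) -/

section RiemannInvariants

/-- Derivative of the Riemann invariant `w₁(u) = u₂/u₁ - c₁ u₁^{(γ-1)/2}` on `{ρ ≠ 0}`. [folklore] -/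
theorem hasFDerivAt_riemannInvariant_one (γ : ℝ) {u : Fin 2 → ℝ} (hρ : u 0 ≠ 0) :
    HasFDerivAt (fun w : Fin 2 → ℝ => w 1 / w 0 - isentropicEulerC₁ γ * (w 0) ^ ((γ - 1) / 2))
      ((-(u 1 / u 0 ^ 2) - isentropicEulerC₁ γ * ((γ - 1) / 2) * (u 0) ^ ((γ - 1) / 2 - 1)) •
          ContinuousLinearMap.proj (R := ℝ) (φ := fun _ : Fin 2 => ℝ) 0
        + (1 / u 0) • ContinuousLinearMap.proj (R := ℝ) (φ := fun _ : Fin 2 => ℝ) 1) u := by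
  have h0 : HasFDerivAt (fun v : Fin 2 → ℝ => v 0)
      (ContinuousLinearMap.proj (R := ℝ) (φ := fun _ : Fin 2 => ℝ) 0) u := hasFDerivAt_apply 0 u
  have h1 : HasFDerivAt (fun v : Fin 2 → ℝ => v 1)
      (ContinuousLinearMap.proj (R := ℝ) (φ := fun _ : Fin 2 => ℝ) 1) u := hasFDerivAt_apply 1 u
  have hinv : HasFDerivAt (fun v : Fin 2 → ℝ => (v 0)⁻¹)
      ((-(u 0 ^ 2)⁻¹) • ContinuousLinearMap.proj (R := ℝ) (φ := fun _ : Fin 2 => ℝ) 0) u :=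
    (hasDerivAt_inv hρ).comp_hasFDerivAt u h0
  have hv := h1.mul hinv
  have hB := (h0.rpow_const (p := (γ - 1) / 2) (Or.inl hρ)).const_mul (isentropicEulerC₁ γ)
  have hsum := hv.sub hB
  have hfun : (fun w : Fin 2 → ℝ => w 1 / w 0 - isentropicEulerC₁ γ * (w 0) ^ ((γ - 1) / 2))
      = fun w => w 1 * (w 0)⁻¹ - isentropicEulerC₁ γ * (w 0) ^ ((γ - 1) / 2) := by
    funext w; rw [div_eq_mul_inv]
  rw [hfun]
  refine hsum.congr_fderiv (ContinuousLinearMap.ext fun h => ?_)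
  simp
  field_simp
  ring

/-- Derivative of the Riemann invariant `w₂(u) = u₂/u₁ + c₁ u₁^{(γ-1)/2}` on `{ρ ≠ 0}`. [folklore] -/
theorem hasFDerivAt_riemannInvariant_two (γ : ℝ) {u : Fin 2 → ℝ} (hρ : u 0 ≠ 0) :
    HasFDerivAt (fun w : Fin 2 → ℝ => w 1 / w 0 + isentropicEulerC₁ γ * (w 0) ^ ((γ - 1) / 2))
      ((-(u 1 / u 0 ^ 2) + isentropicEulerC₁ γ * ((γ - 1) / 2) * (u 0) ^ ((γ - 1) / 2 - 1)) •
          ContinuousLinearMap.proj (R := ℝ) (φ := fun _ : Fin 2 => ℝ) 0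
        + (1 / u 0) • ContinuousLinearMap.proj (R := ℝ) (φ := fun _ : Fin 2 => ℝ) 1) u := by
  have h0 : HasFDerivAt (fun v : Fin 2 → ℝ => v 0)
      (ContinuousLinearMap.proj (R := ℝ) (φ := fun _ : Fin 2 => ℝ) 0) u := hasFDerivAt_apply 0 u
  have h1 : HasFDerivAt (fun v : Fin 2 → ℝ => v 1)
      (ContinuousLinearMap.proj (R := ℝ) (φ := fun _ : Fin 2 => ℝ) 1) u := hasFDerivAt_apply 1 u
  have hinv : HasFDerivAt (fun v : Fin 2 → ℝ => (v 0)⁻¹)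
      ((-(u 0 ^ 2)⁻¹) • ContinuousLinearMap.proj (R := ℝ) (φ := fun _ : Fin 2 => ℝ) 0) u :=
    (hasDerivAt_inv hρ).comp_hasFDerivAt u h0
  have hv := h1.mul hinv
  have hB := (h0.rpow_const (p := (γ - 1) / 2) (Or.inl hρ)).const_mul (isentropicEulerC₁ γ)
  have hsum := hv.add hB
  have hfun : (fun w : Fin 2 → ℝ => w 1 / w 0 + isentropicEulerC₁ γ * (w 0) ^ ((γ - 1) / 2))
      = fun w => w 1 * (w 0)⁻¹ + isentropicEulerC₁ γ * (w 0) ^ ((γ - 1) / 2) := by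
    funext w; rw [div_eq_mul_inv]
  rw [hfun]
  refine hsum.congr_fderiv (ContinuousLinearMap.ext fun h => ?_)
  simp
  field_simp
  ring

/-- `c₁ (γ-1)/2 = √γ`: the Riemann-invariant constant times the exponent is the sound-speed
coefficient (`γ ≠ 1`). [folklore] -/
theorem isentropicEulerC₁_mul_exponent {γ : ℝ} (hγ : γ ≠ 1) :
    isentropicEulerC₁ γ * ((γ - 1) / 2) = Real.sqrt γ := by
  have hγ' : γ - 1 ≠ 0 := sub_ne_zero.2 hγ
  unfold isentropicEulerC₁
  field_simp

/-- **`w₁ = v - c₁ρ^{(γ-1)/2}` and `w₂ = v + c₁ρ^{(γ-1)/2}` are Riemann invariants of the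
isentropic Euler system** (§1: "Those systems have Riemann invariants `w₁` and `w₂`, such that
`(w₁)ₜ + λ₁(w₁)ₓ = 0`, `(w₂)ₜ + λ₂(w₂)ₓ = 0`. This provides naturally invariant regions as (InvReg)"):
on `{ρ > 0}` (`γ > 1`), `∇wᵢ(u) ∘ Df(u) = λᵢ(u) ∇wᵢ(u)` with `λ₁,₂ = v ∓ √γ ρ^{(γ-1)/2}` — i.e.
`∇wᵢ` is a left eigenvector of `Df`. This validates the constant `c₁ = 2√γ/(γ-1)` of
`isentropicEulerC₁` (not displayed in print). [cite: ChenKrupaVasseur2022, §1 (Riemann invariants and (InvReg))] -/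
theorem riemannInvariants_isentropicEuler (hγ : 1 < γ) {u : Fin 2 → ℝ} (hρ : 0 < u 0) :
    (fderiv ℝ (fun w : Fin 2 → ℝ => w 1 / w 0 - isentropicEulerC₁ γ * (w 0) ^ ((γ - 1) / 2)) u).comp
        (fderiv ℝ (isentropicEulerFlux γ) u)
      = (u 1 / u 0 - Real.sqrt γ * (u 0) ^ ((γ - 1) / 2)) •
        fderiv ℝ (fun w : Fin 2 → ℝ => w 1 / w 0 - isentropicEulerC₁ γ * (w 0) ^ ((γ - 1) / 2)) u ∧
    (fderiv ℝ (fun w : Fin 2 → ℝ => w 1 / w 0 + isentropicEulerC₁ γ * (w 0) ^ ((γ - 1) / 2)) u).comp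
        (fderiv ℝ (isentropicEulerFlux γ) u)
      = (u 1 / u 0 + Real.sqrt γ * (u 0) ^ ((γ - 1) / 2)) •
        fderiv ℝ (fun w : Fin 2 → ℝ => w 1 / w 0 + isentropicEulerC₁ γ * (w 0) ^ ((γ - 1) / 2)) u := by
  have hγne : γ ≠ 1 := by intro h; linarith
  have hγ0 : 0 ≤ γ := by linarith
  have hρ' : u 0 ≠ 0 := hρ.ne'
  have hc := isentropicEulerC₁_mul_exponent hγne
  -- the power algebra: `t = ρ^{θ-1}`, `ρ^θ = t ρ`, `ρ^{γ-1} = (t ρ)²`, `(√γ)² = γ`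
  set t := (u 0) ^ ((γ - 1) / 2 - 1) with ht
  have hθ : (u 0) ^ ((γ - 1) / 2) = t * u 0 := by
    rw [ht, Real.rpow_sub_one hρ']; field_simp
  have hγ1 : (u 0) ^ (γ - 1) = (t * u 0) ^ 2 := by
    rw [← hθ, ← Real.rpow_natCast, ← Real.rpow_mul hρ.le]; congr 1; push_cast; ring
  have hsq : Real.sqrt γ ^ 2 = γ := Real.sq_sqrt hγ0
  rw [(hasFDerivAt_isentropicEulerFlux γ hρ').fderiv,
    (hasFDerivAt_riemannInvariant_one γ hρ').fderiv, (hasFDerivAt_riemannInvariant_two γ hρ').fderiv]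
  constructor
  · refine ContinuousLinearMap.ext fun h => ?_
    simp
    rw [hγ1, hθ, ← ht, hc, show γ * (t * u 0) ^ 2 = Real.sqrt γ ^ 2 * (t * u 0) ^ 2 by rw [hsq]]
    field_simp
    ring
  · refine ContinuousLinearMap.ext fun h => ?_
    simp
    rw [hγ1, hθ, ← ht, hc, show γ * (t * u 0) ^ 2 = Real.sqrt γ ^ 2 * (t * u 0) ^ 2 by rw [hsq]]
    field_simp
    ring

end RiemannInvariants

end Literature.Analysis.PDE
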